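import Literature.AlgebraicGeometry.HodgeTheory.FermatShiodaCondition
import Mathlib.GroupTheory.Perm.DomMulAct
import HarnessLib

/-!
# Shioda 1981, Appendix: the decomposable (paired) Hodge sextuples of the Fermat fourfold — a closed count at odd level (`182400` at `m = 25`), at even level, and the printed polynomials of Degtyarev–Shimada 2016 (Thm. 1.4, Rem. 4.4) for `n = 4` and `n = 6` (paired octuples) at every `m`

Topic `Literature/AlgebraicGeometry/Shioda1981` (T. Shioda, *Algebraic cycles on abelian varieties of Fermat type*, Math. Ann.
**258** (1981) 65–80, Appendix pp. 78–79; page images read: `run/shared/lean/pub/pub-hfermat/lit/scans/Shioda1981MA/page14.png`,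
`page15.png`, transcription `lit/Shioda1981-MathAnn258.md`). THEOREMS only (no definition of mathematical content beyond two
private abbreviations, no named fact, no `sorry`), in the vocabulary of `HodgeTheory.FermatHodgeCharacters`
(`FermatCharacter.IsHodge` = "`α ∈ 𝔅ⁿₘ`", `FermatCharacter.IsPaired` = "juxtaposition of pairs `(a, −a)`").

* [p. 79] "More precisely, the set `𝔅⁴₂₅` has `4·6!` indecomposable elements which are permutations of `γᵢ` (`1 ≤ i ≤ 4`)
  and `182400` decomposable elements. By the method of [12], we have `182401 ≤ dim 𝒞²(X⁴₂₅) ≤ dim 𝓑²(X⁴₂₅) = 185281` …".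
  HERE: **`card_isHodge_isPaired_six_twentyfive`** — the paired Hodge sextuples of level `25` (the characters of `X⁴₂₅`
  whose multiset of values is a union of three pairs `{a, −a}`; at `m = 25` these are exactly Shioda's decomposable
  elements, the complement being the `2880` permutations of the `γᵢ`, tree: `Shioda1982.PicardNumberPrimePower`,
  `card_hodge_not_paired_twentyfive`) number `182400`; obtained from the CLOSED FORM at every odd level
  **`card_isHodge_isPaired_six`**: `#{α ∈ 𝔅⁴ₘ paired} = 20·h + 180·h(h−1) + 720·C(h,3)`, `h = (m−1)/2`, i.e.
  `= 15(m−1)³ − 45(m−1)² + 40(m−1)` (**`card_isHodge_isPaired_six_eq_poly`**).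
* [Degtyarev–Shimada 2016, Def. 1.3, Thm. 1.4, Rem. 4.4] (A. Degtyarev, I. Shimada, *On the topology of projective
  subspaces in complex Fermat varieties*, J. Math. Soc. Japan **68** (2016) 975–996, arXiv:1405.4683; held text
  `paper:arxiv-1405.4683`, chunks p0003–p0004, p0010): for the Fermat variety of even dimension `n = 2d` and degree `m`,
  `𝓛(X)` = the `ℤ`-span in `Hₙ(X)` of the classes of the `(2d+1)!!·m^{d+1}` standard `d`-spaces, `Γ_𝒥` = the
  `(a₁, …, a_{n+1}) ∈ μₘ^{n+1}`, all `aᵢ ≠ 1`, admitting a matching `J` with `a_{jᵢ} a_{kᵢ} = 1` (Def. 1.3) — in additive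
  notation and with `a₀ = −Σaᵢ` restored: the characters of length `n + 2` with non-zero entries which are juxtapositions
  of pairs `(a, −a)`, i.e. the tree's `IsHodge α ∧ IsPaired α`; "Theorem 1.4. … the rank of the group `𝓛_𝒦(X)` is equal
  to `|Γ_𝒦| + 1`"; "Remark 4.4. The rank of `𝓛(X) = 𝓛_𝒥(X) = 1 + |Γ_𝒥|` is equal to the constant term of the expansion
  of `1 + (x₁ + ⋯ + x_{h−1} + 1 + x_{h−1}⁻¹ + ⋯ + x₁⁻¹)^{n+2}` if `m = 2h` is even, `1 + (x₁ + ⋯ + x_h + x_h⁻¹ + ⋯ +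
  x₁⁻¹)^{n+2}` if `m = 2h+1` is odd. For small dimensions `n`, we have … `15m³ − 90m² + 175m − 100 + (15m − 39)δₘ`
  for `n = 4` … where `δₘ ∈ {0, 1}` satisfies `δₘ ≡ m − 1 mod 2`." HERE (section `EvenLevel`):
  **`card_isHodge_isPaired_six_even`** — the closed count at every even level (`h = (m−2)/2`:
  `1 + 30h + 90h + 360·C(h,2) + 20h + 180·h(h−1) + 720·C(h,3) = 120h³ + 20h + 1`),
  **`card_isHodge_isPaired_six_even_eq_poly`** (`= 15(m−1)³ − 45(m−1)² + 55(m−1) − 24`), and both parities assembled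
  in the printed form **`card_isHodge_isPaired_six_eq_degtyarevShimada`**:
  `#{paired α ∈ 𝔅⁴ₘ} = 15m³ − 90m² + 175m − 100 + (15m − 39)δₘ` for every `m`; instance `m = 26 → 207601`.
  READING NOTE recorded with the statement: the remark displays the three polynomials (`n = 2, 4, 6`) under the
  heading "`rank 𝓛(X) =`", but they are the values of `|Γ_𝒥| = rank 𝓛(X) − 1` (Thm. 1.4; e.g. `(n, m) = (2, 3)`:
  polynomial `6`, the `27` lines span rank `7`, and the displayed constant-term recipe also gives `7`); the statements
  here are about `|Γ_𝒥|` = the number of paired Hodge characters, for which the polynomials are exact.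
* Same source, `n = 6` ("`105m⁴ − 1050m³ + 3955m² − 6335m + 3325 + (210m² − 1302m + 2010)δₘ` for `n = 6`"), odd `m`
  (section `Octuples`): **`card_isHodge_isPaired_eight`** — the paired Hodge octuples `α ∈ 𝔅⁶ₘ` (characters of the Fermat
  sixfold whose value multiset is a union of four pairs) number `40320·C(h,4) + 10080·h·C(h−1,2) + 2520·C(h,2) +
  1120·h(h−1) + 70·h`, `h = (m−1)/2`, by the five shapes `{a,b,c,d}`, `{a,a,b,c}`, `{a,a,b,b}`, `{a,a,a,b}`, `{a,a,a,a}` of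
  the `R`-part; **`card_isHodge_isPaired_eight_eq_poly`** (`= 105m⁴ − 1050m³ + 3955m² − 6335m + 3325`, the printed
  polynomial at `δₘ = 0`); instances `m = 3 → 70`, `m = 25 → 26926200`. The numbers of orderings are obtained from the
  orbit–stabiliser count `#orderings · ∏ₓ(countₓ)! = n!` (private `card_orderings_mul_prod_factorial`, Mathlib's
  `DomMulAct.stabilizer_card'`) rather than by kernel enumeration. Even `m` (section `OctuplesEven`):
  **`card_isHodge_isPaired_eight_even`** (`h = (m−2)/2`; twelve shapes `t + (−t) + (8 − 2|t|)·{η}`: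
  `1 + 56h + 420h + 1680C(h,2) + 560h + 5040h(h−1) + 20160C(h,3) + 40320C(h,4) + 10080·h·C(h−1,2) + 2520C(h,2) +
  1120h(h−1) + 70h`), **`card_isHodge_isPaired_eight_even_eq_poly`** (`= 105m⁴ − 1050m³ + 4165m² − 7637m + 5335`), and
  both parities in the printed form **`card_isHodge_isPaired_eight_eq_degtyarevShimada`**:
  `#{paired α ∈ 𝔅⁶ₘ} = 105m⁴ − 1050m³ + 3955m² − 6335m + 3325 + (210m² − 1302m + 2010)δₘ` for every `m`; instances
  `m = 4 → 1107`, `m = 26 → 32149993`.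

## The proof (elementary counting; the closed forms for general `m` are printed in [Degtyarev–Shimada 2016, Rem. 4.4], obtained there from Thm. 1.4 by a constant-term computation; the source [Shioda 1981] prints `m = 25`)

At odd level no non-zero residue equals its negative, so (`FermatCharacter.isPaired_of_card_filter_eq` and its converse)
a sextuple with non-zero entries is paired iff its multiplicities are symmetric, `#ₓ = #₋ₓ`; its multiset of values is
then `t + (−t)` where `t` (three elements) collects the entries lying in a fixed half-system `R` of representatives of
the pairs `{x, −x}` (`|R| = h`). By the shape of `t` — `{a,a,a}`, `{a,a,b}` (`a ≠ b`), `{a,b,c}` (distinct) — the value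
multiset has `6!/(3!3!) = 20`, `6!/(2!2!) = 180`, `6! = 720` orderings (the first two by kernel evaluation on the
alphabets `Fin 2`, `Fin 4` and transport along the injection into `ℤ/m`; the last because the multiset is duplicate-free),
and the shapes are parametrised injectively by `R`, by the ordered pairs of distinct elements of `R`, and by the
`3`-subsets of `R`: `20·h + 180·h(h−1) + 720·C(h,3)`.

## Cross-checks (cell `pub-hfermat`, outside Lean)

`code/lit/picard/table_vs_paired6.py`: the closed forms (odd and even) agree with grade `E0` ("union of three pairs")
of the two-implementation fourfold enumeration `data/hodge_fermat_n4.json` at all `298` levels `3 ≤ m ≤ 300` (characters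
and multisets) and with a brute-force count from the definition at `m ≤ 11`; `0` disagreements; `m = 25`: `182400`, and
`182400 + 2880 = 185280 = 185281 − 1` as printed. `code/lit/picard/table_vs_ds16.py`: Degtyarev–Shimada's printed
polynomials (`n = 2, 4, 6`), their constant-term recipe (any `n`), the shape counts of this file (`n = 4`) and of its
`n = 6` analogue, and grade `E0` of the cell's tables agree at all `782` cells (`n = 2, 4`: `m ≤ 300`; `n = 6`: `m ≤ 120`;
`n = 8`: `m ≤ 70`) and with brute force at small `m`; `0` disagreements (`m = 26`: `207601`; `n = 6`: the odd-level
shape count `70h + 1120h(h−1) + 2520C(h,2) + 10080·h·C(h−1,2) + 40320C(h,4)` = grade `E0` of `data/hodge_fermat_n6.json` at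
the `59` odd levels `m ≤ 120`, `m = 25`: `26926200`; the even-level shape count = grade `E0` at the `59` even levels, `m = 4`: `1107`,
`m = 26`: `32149993`; i.e. the `n = 6` polynomial of the tree = the cell's `E0` column at all `118` levels).

Even level (section `EvenLevel`): `ℤ/m ∖ {0} = R ⊔ (−R) ⊔ {η}`, `η = m/2 = −η`, `|R| = (m−2)/2`; a paired Hodge
sextuple has value multiset `t + (−t) + 2j·{η}`, `t ⊆ R`, `|t| + j = 3` (symmetric multiplicities as before, the
self-negative part being `η`'s); conversely every ordering of such a multiset is a permutation of the juxtaposition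
`(a, −a)` of an ordering `a` of `t + j·{η}`, hence paired; the four new shapes `{a,a,−a,−a,η,η}`, `{a,b,−a,−b,η,η}`,
`{a,−a,η,η,η,η}`, `{η}⁶` have `90, 360, 30, 1` orderings (kernel evaluation on `Fin 3`, `Fin 5`, `Fin 3`, `Fin 1`), and the
seven families of `R`-parts are separated by the invariant `10|t| + |t.dedup|`.

Not treated: the identification "decomposable = paired" for general `m` (false in general: products `β ∗ γ` of the
inductive structure; true at `m = 25` by the dichotomy of `PicardNumberPrimePower`, `isPaired_or_exists_perm_fiveStd`),
the bounds on `dim 𝒞²(X⁴₂₅)`; Degtyarev–Shimada's Theorem 1.4 itself (the rank of `𝓛(X)`, a statement about homology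
classes), their `n = 2` polynomial (the `n = 2` count is the tree's `card_decomposableQuadruples` in
`Shioda1982/PicardNumber.lean`: `|𝔇²ₘ| = 3(m−1)(m−2) + δₘ = 3m² − 9m + 6 + δₘ`), and `n ≥ 8` (no polynomial printed).

HONEST FRAMING (cell `pub-hfermat`): explicit algebraic cycles for specific Hodge classes on Fermat/Delsarte varieties; residual open
instances listed; no claim on general Hodge. (This file counts characters; it asserts nothing about algebraicity.)

## References
* [Shioda1981FermatType] T. Shioda, *Algebraic cycles on abelian varieties of Fermat type*, Math. Ann. 258 (1981) 65–80,
  Appendix (A.1) and the paragraph following it, pp. 78–79.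
* [DegtyarevShimada2016] A. Degtyarev, I. Shimada, *On the topology of projective subspaces in complex Fermat varieties*,
  J. Math. Soc. Japan 68 (2016) 975–996, doi:10.2969/jmsj/06830975, arXiv:1405.4683 — Definition 1.3, Theorem 1.4,
  Remark 4.4.
* [Shioda1979PJA] / [Ran1980]: the notions `𝔅ⁿₘ`, paired characters (tree file `HodgeTheory.FermatHodgeCharacters`).
-/

noncomputable section

namespace Literature.AlgebraicGeometry.Shioda1981

open Finset
open Literature.AlgebraicGeometry.HodgeTheory Literature.AlgebraicGeometry.HodgeTheory.FermatCharacter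

variable {m : ℕ} [NeZero m]

/-! ## Odd level: no non-zero residue is its own negative; a set of representatives of the pairs `{x, -x}` -/

omit [NeZero m] in
/-- At odd level `x = -x` forces `x = 0` (`2` is a unit). [folklore] -/
private theorem eq_zero_of_eq_neg_oddLevel (hm : ¬ 2 ∣ m) {x : ZMod m} (h : x = -x) : x = 0 := by
  have h2 : (2 : ZMod m) * x = 0 := by
    rw [two_mul]
    nth_rw 2 [h]
    exact add_neg_cancel x
  have hu : IsUnit (2 : ZMod m) := by
    have hc : Nat.Coprime 2 m := (Nat.Prime.coprime_iff_not_dvd Nat.prime_two).2 hm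
    have := (ZMod.unitOfCoprime 2 hc).isUnit
    rwa [ZMod.coe_unitOfCoprime, Nat.cast_ofNat] at this
  exact (hu.mul_right_eq_zero).1 h2

/-- The representatives `x` with `⟨x⟩ < ⟨-x⟩` of the pairs `{x, -x}`, `x ≠ 0` (plumbing). [folklore] -/
private def repSet (m : ℕ) [NeZero m] : Finset (ZMod m) := univ.filter fun x ↦ x ≠ 0 ∧ x.val < (-x).val

/-- Membership in the half-system. [folklore] -/
private theorem mem_repSet {x : ZMod m} : x ∈ repSet m ↔ x ≠ 0 ∧ x.val < (-x).val := by
  simp [repSet]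

/-- Representatives are non-zero. [folklore] -/
private theorem ne_zero_of_mem_repSet {x : ZMod m} (h : x ∈ repSet m) : x ≠ 0 := (mem_repSet.1 h).1

/-- The negative of a representative is not a representative. [folklore] -/
private theorem neg_not_mem_repSet {x : ZMod m} (h : x ∈ repSet m) : -x ∉ repSet m := by
  intro h'
  have h1 := (mem_repSet.1 h).2
  have h2 := (mem_repSet.1 h').2
  rw [neg_neg] at h2
  omega

/-- A representative is not its own negative (any level). [folklore] -/
private theorem ne_neg_of_mem_repSet {x : ZMod m} (h : x ∈ repSet m) : x ≠ -x := fun e ↦ by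
  have h1 := (mem_repSet.1 h).2
  rw [← e] at h1
  exact lt_irrefl _ h1

/-- A non-zero residue which is neither a representative nor its own negative is the negative of a
representative (any level). [folklore] -/
private theorem neg_mem_repSet_of_ne_neg {x : ZMod m} (hx : x ≠ 0) (hxx : x ≠ -x) (h : x ∉ repSet m) :
    -x ∈ repSet m := by
  rw [mem_repSet, not_and, not_lt] at h
  refine mem_repSet.2 ⟨neg_ne_zero.2 hx, ?_⟩
  rw [neg_neg]
  refine lt_of_le_of_ne (h hx) fun e ↦ hxx ?_
  exact (ZMod.val_injective m e).symm

/-- At odd level, a non-zero non-representative is the negative of a representative. [folklore] -/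
private theorem neg_mem_repSet (hm : ¬ 2 ∣ m) {x : ZMod m} (hx : x ≠ 0) (h : x ∉ repSet m) :
    -x ∈ repSet m := by
  rw [mem_repSet, not_and, not_lt] at h
  refine mem_repSet.2 ⟨neg_ne_zero.2 hx, ?_⟩
  rw [neg_neg]
  refine lt_of_le_of_ne (h hx) fun e ↦ hx (eq_zero_of_eq_neg_oddLevel hm ?_)
  exact (ZMod.val_injective m e).symm

/-- `ℤ/m ∖ {0}` is the disjoint union of the representatives and their negatives; hence there are `(m-1)/2`
representatives at odd level. [folklore] -/
private theorem card_repSet (hm : ¬ 2 ∣ m) : (repSet m).card = (m - 1) / 2 := by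
  classical
  have hunion : (univ.erase (0 : ZMod m)) = repSet m ∪ (repSet m).image Neg.neg := by
    ext x
    simp only [mem_erase, mem_univ, and_true, mem_union, mem_image]
    constructor
    · intro hx
      by_cases h : x ∈ repSet m
      · exact Or.inl h
      · exact Or.inr ⟨-x, neg_mem_repSet hm hx h, neg_neg x⟩
    · rintro (h | ⟨y, hy, rfl⟩)
      · exact ne_zero_of_mem_repSet h
      · exact neg_ne_zero.2 (ne_zero_of_mem_repSet hy)
  have hdisj : Disjoint (repSet m) ((repSet m).image Neg.neg) := by
    rw [Finset.disjoint_left]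
    rintro x hx hx'
    obtain ⟨y, hy, rfl⟩ := mem_image.1 hx'
    exact neg_not_mem_repSet hy hx
  have hcard := congrArg Finset.card hunion
  rw [card_erase_of_mem (mem_univ _), card_univ, ZMod.card, card_union_of_disjoint hdisj,
    card_image_of_injective _ neg_injective] at hcard
  omega

/-! ## Symmetrised multisets `t + (-t)` -/

/-- `t ↦ t + (-t)` (plumbing). [folklore] -/
private def symmOf (t : Multiset (ZMod m)) : Multiset (ZMod m) := t + t.map Neg.neg

omit [NeZero m] in
/-- Multiplicities in `t + (-t)`. [folklore] -/
private theorem count_symmOf (t : Multiset (ZMod m)) (x : ZMod m) :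
    Multiset.count x (symmOf t) = Multiset.count x t + Multiset.count (-x) t := by
  rw [symmOf, Multiset.count_add]
  congr 1
  have := Multiset.count_map_eq_count' Neg.neg t neg_injective (-x)
  rwa [neg_neg] at this

omit [NeZero m] in
/-- `t + (-t)` has symmetric multiplicities. [folklore] -/
private theorem count_neg_symmOf (t : Multiset (ZMod m)) (x : ZMod m) :
    Multiset.count (-x) (symmOf t) = Multiset.count x (symmOf t) := by
  rw [count_symmOf, count_symmOf, neg_neg, add_comm]

omit [NeZero m] in
/-- Membership in `t + (-t)`. [folklore] -/
private theorem mem_symmOf {t : Multiset (ZMod m)} {x : ZMod m} : x ∈ symmOf t ↔ x ∈ t ∨ -x ∈ t := by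
  simp only [symmOf, Multiset.mem_add, Multiset.mem_map]
  constructor
  · rintro (h | ⟨y, hy, rfl⟩)
    · exact Or.inl h
    · rw [neg_neg]; exact Or.inr hy
  · rintro (h | h)
    · exact Or.inl h
    · exact Or.inr ⟨-x, h, neg_neg x⟩

omit [NeZero m] in
/-- `|t + (-t)| = 2|t|`. [folklore] -/
private theorem card_symmOf (t : Multiset (ZMod m)) : Multiset.card (symmOf t) = 2 * Multiset.card t := by
  rw [symmOf, Multiset.card_add, Multiset.card_map]
  ring

/-- The representatives occurring in `t + (-t)` are `t` (when `t` consists of representatives). [folklore] -/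
private theorem filter_symmOf {t : Multiset (ZMod m)} (ht : ∀ x ∈ t, x ∈ repSet m) :
    (symmOf t).filter (· ∈ repSet m) = t := by
  rw [symmOf, Multiset.filter_add, Multiset.filter_eq_self.2 ht, Multiset.filter_eq_nil.2, add_zero]
  intro y hy
  obtain ⟨x, hx, rfl⟩ := Multiset.mem_map.1 hy
  exact neg_not_mem_repSet (ht x hx)

/-- A multiset of non-zero residues with symmetric multiplicities is `t + (-t)`, `t` = its representatives (odd level). [folklore] -/
private theorem eq_symmOf_filter (hm : ¬ 2 ∣ m) {s : Multiset (ZMod m)} (h0 : (0 : ZMod m) ∉ s)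
    (hsym : ∀ x, Multiset.count x s = Multiset.count (-x) s) :
    s = symmOf (s.filter (· ∈ repSet m)) := by
  classical
  refine Multiset.ext.mpr fun x ↦ ?_
  rw [count_symmOf, Multiset.count_filter, Multiset.count_filter]
  by_cases hx : x = 0
  · subst hx
    have h00 : (0 : ZMod m) ∉ repSet m := fun h ↦ ne_zero_of_mem_repSet h rfl
    rw [neg_zero, if_neg h00, Multiset.count_eq_zero.2 h0]
  · by_cases hR : x ∈ repSet m
    · rw [if_pos hR, if_neg (neg_not_mem_repSet hR), add_zero]
    · rw [if_neg hR, if_pos (neg_mem_repSet hm hx hR), zero_add, ← hsym]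

/-- The shape of a `3`-element multiset: three equal, two equal and one different, or three different elements. [folklore] -/
private theorem shape_three {X : Type*} [DecidableEq X] {t : Multiset X} (ht : Multiset.card t = 3) :
    (∃ a, t = {a, a, a}) ∨ (∃ a b, a ≠ b ∧ t = {a, a, b}) ∨ t.Nodup := by
  obtain ⟨a, b, c, rfl⟩ := Multiset.card_eq_three.1 ht
  by_cases hab : a = b
  · subst hab
    by_cases hac : a = c
    · subst hac
      exact Or.inl ⟨a, rfl⟩
    · exact Or.inr (Or.inl ⟨a, c, hac, rfl⟩)
  · by_cases hac : a = c
    · subst hac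
      exact Or.inr (Or.inl ⟨a, b, hab, congrArg _ (Multiset.pair_comm b a)⟩)
    · by_cases hbc : b = c
      · subst hbc
        refine Or.inr (Or.inl ⟨b, a, fun h ↦ hab h.symm, ?_⟩)
        show a ::ₘ b ::ₘ {b} = b ::ₘ b ::ₘ {a}
        rw [Multiset.cons_swap a b]
        exact congrArg _ (Multiset.pair_comm a b)
      · refine Or.inr (Or.inr ?_)
        simp [hab, hac, hbc]

/-! ## Orderings: the number of `α : Fin n → X` with a prescribed multiset of values -/

/-- Transport along an injection of the alphabet. [folklore] -/
private theorem card_filter_map_eq_map_emb {X Y : Type*} [Fintype X] [DecidableEq X] [Fintype Y] [DecidableEq Y]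
    {n : ℕ} (e : Y ↪ X) (u : Multiset Y) :
    (univ.filter fun α : Fin n → X ↦ univ.val.map α = u.map e).card =
      (univ.filter fun β : Fin n → Y ↦ univ.val.map β = u).card := by
  classical
  symm
  refine Finset.card_bij (fun β _ ↦ ⇑e ∘ β) (fun β hβ ↦ ?_) (fun β₁ _ β₂ _ h ↦ ?_) (fun α hα ↦ ?_)
  · simp only [mem_filter, mem_univ, true_and] at hβ ⊢
    rw [← Multiset.map_map, hβ]
  · funext i
    exact e.injective (congrFun h i)
  · simp only [mem_filter, mem_univ, true_and] at hα
    have hmem : ∀ i, ∃ y, e y = α i := fun i ↦ by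
      have : α i ∈ u.map e := by
        rw [← hα]
        exact Multiset.mem_map_of_mem α (mem_univ_val i)
      obtain ⟨y, -, hy⟩ := Multiset.mem_map.1 this
      exact ⟨y, hy⟩
    choose β hβ using hmem
    have hcomp : (⇑e ∘ β) = α := funext hβ
    refine ⟨β, ?_, hcomp⟩
    simp only [mem_filter, mem_univ, true_and]
    apply Multiset.map_injective e.injective
    rw [Multiset.map_map, hcomp, hα]

/-- Tuples with the same multiset of values differ by a permutation of the indices. [folklore] -/
private theorem exists_perm_of_univ_val_map_eq {K : ℕ} {X : Type*} [DecidableEq X] {x y : Fin K → X}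
    (h : univ.val.map x = univ.val.map y) : ∃ σ : Equiv.Perm (Fin K), y = x ∘ σ := by
  have hc : ∀ a : X, Fintype.card {i // y i = a} = Fintype.card {i // x i = a} := by
    intro a
    rw [Fintype.card_subtype, Fintype.card_subtype]
    have h1 : ∀ (z : Fin K → X), (univ.filter fun i ↦ z i = a).card = Multiset.count a (univ.val.map z) := by
      intro z
      rw [Multiset.count_map, ← Finset.filter_val, Finset.card_val]
      congr 1
      exact Finset.filter_congr fun i _ ↦ eq_comm
    rw [h1, h1, h]
  have e : ∀ a : X, {i // y i = a} ≃ {i // x i = a} := fun a ↦ Fintype.equivOfCardEq (hc a)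
  exact ⟨Equiv.ofFiberEquiv e, funext fun i ↦ (Equiv.ofFiberEquiv_map e i).symm⟩

/-- There are `n!` tuples `Fin n → X` with a prescribed duplicate-free multiset of values of size `n`. [folklore] -/
private theorem card_filter_map_eq_factorial {n : ℕ} {X : Type*} [DecidableEq X] [Fintype X] (t : Multiset X)
    (ht : t.Nodup) (hc : Multiset.card t = n) :
    (univ.filter fun α : Fin n → X ↦ univ.val.map α = t).card = n.factorial := by
  classical
  obtain ⟨r, α₀, h₀⟩ := exists_eq_univ_val_map t
  have hr : r = n := by
    have := congrArg Multiset.card h₀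
    simp only [Multiset.card_map, Finset.card_val, Finset.card_univ, Fintype.card_fin] at this
    omega
  subst hr
  have hinj : Function.Injective α₀ := by
    have hnd : (univ.val.map α₀).Nodup := h₀ ▸ ht
    intro i j hij
    exact (Multiset.nodup_map_iff_inj_on univ.nodup).mp hnd i (Finset.mem_univ_val _) j (Finset.mem_univ_val _) hij
  have hperm : ∀ σ : Equiv.Perm (Fin r), univ.val.map (α₀ ∘ σ) = univ.val.map α₀ := by
    intro σ
    have h : (univ : Finset (Fin r)).val.map (⇑σ) = (univ : Finset (Fin r)).val := by
      have h := congrArg Finset.val (Finset.map_univ_equiv σ)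
      rwa [Finset.map_val, Equiv.coe_toEmbedding] at h
    rw [← Multiset.map_map, h]
  have hset : (univ.filter fun α : Fin r → X ↦ univ.val.map α = t) =
      univ.image fun σ : Equiv.Perm (Fin r) ↦ α₀ ∘ σ := by
    ext β
    simp only [Finset.mem_filter, Finset.mem_univ, true_and, Finset.mem_image]
    constructor
    · intro hβ
      obtain ⟨σ, hσ⟩ := exists_perm_of_univ_val_map_eq (h₀.trans hβ.symm)
      exact ⟨σ, hσ.symm⟩
    · rintro ⟨σ, rfl⟩
      rw [hperm, h₀]
  have hinj' : Function.Injective fun σ : Equiv.Perm (Fin r) ↦ (α₀ ∘ σ : Fin r → X) :=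
    fun σ τ h ↦ Equiv.ext fun i ↦ hinj (congrFun h i)
  rw [hset, Finset.card_image_of_injective _ hinj', Finset.card_univ, Fintype.card_perm, Fintype.card_fin]

/-- `6!/(3!·3!) = 20` orderings of `{a,a,a,b,b,b}` (kernel evaluation on the alphabet `Fin 2`). [folklore] -/
private theorem card_orderings_three_three :
    (univ.filter fun β : Fin 6 → Fin 2 ↦ univ.val.map β = ({0, 0, 0, 1, 1, 1} : Multiset (Fin 2))).card = 20 := by
  decide +kernel

set_option maxRecDepth 8000 in
/-- `6!/(2!·2!) = 180` orderings of `{a,a,b,c,c,d}` (kernel evaluation on the alphabet `Fin 4`). [folklore] -/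
private theorem card_orderings_two_one_two_one :
    (univ.filter fun β : Fin 6 → Fin 4 ↦ univ.val.map β = ({0, 0, 1, 2, 2, 3} : Multiset (Fin 4))).card = 180 := by
  decide +kernel

/-! ## The three shapes of paired sextuples and their numbers of orderings -/

/-- Shape `{a,a,a,-a,-a,-a}`: `20` orderings (any level). [folklore] -/
private theorem card_filter_symmOf_AAA {a : ZMod m} (ha : a ∈ repSet m) :
    (univ.filter fun α : Fin 6 → ZMod m ↦ univ.val.map α = symmOf {a, a, a}).card = 20 := by
  classical
  have hne : a ≠ -a := ne_neg_of_mem_repSet ha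
  have hinj : Function.Injective ![a, -a] := by
    intro i j h
    fin_cases i <;> fin_cases j <;> simp [hne, hne.symm] at h ⊢
  have he : symmOf {a, a, a} = ({0, 0, 0, 1, 1, 1} : Multiset (Fin 2)).map (⟨![a, -a], hinj⟩ : Fin 2 ↪ ZMod m) :=
    rfl
  rw [he, card_filter_map_eq_map_emb, card_orderings_three_three]

/-- Shape `{a,a,b,-a,-a,-b}`, `a ≠ b` representatives: `180` orderings (any level). [folklore] -/
private theorem card_filter_symmOf_AAB {a b : ZMod m} (ha : a ∈ repSet m) (hb : b ∈ repSet m)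
    (hab : a ≠ b) :
    (univ.filter fun α : Fin 6 → ZMod m ↦ univ.val.map α = symmOf {a, a, b}).card = 180 := by
  classical
  have h1 : a ≠ -a := ne_neg_of_mem_repSet ha
  have h2 : b ≠ -b := ne_neg_of_mem_repSet hb
  have h3 : a ≠ -b := fun h ↦ neg_not_mem_repSet hb (h ▸ ha)
  have h4 : b ≠ -a := fun h ↦ neg_not_mem_repSet ha (h ▸ hb)
  have h5 : -a ≠ -b := fun h ↦ hab (neg_injective h)
  have hinj : Function.Injective ![a, b, -a, -b] := by
    intro i j h
    fin_cases i <;> fin_cases j <;>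
      simp [hab, hab.symm, h1, h1.symm, h2, h2.symm, h3, h3.symm, h4, h4.symm, h5, h5.symm] at h ⊢
  have he : symmOf {a, a, b} =
      ({0, 0, 1, 2, 2, 3} : Multiset (Fin 4)).map (⟨![a, b, -a, -b], hinj⟩ : Fin 4 ↪ ZMod m) :=
    rfl
  rw [he, card_filter_map_eq_map_emb, card_orderings_two_one_two_one]

/-- Shape `T + (-T)`, `T` three distinct representatives: `720` orderings. [folklore] -/
private theorem card_filter_symmOf_ABC {T : Finset (ZMod m)} (hT : T ⊆ repSet m) (hc : T.card = 3) :
    (univ.filter fun α : Fin 6 → ZMod m ↦ univ.val.map α = symmOf T.val).card = 720 := by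
  classical
  have hnd : (symmOf T.val).Nodup := by
    rw [symmOf]
    refine (Multiset.Nodup.add_iff T.nodup (T.nodup.map neg_injective)).2 ?_
    rw [Multiset.disjoint_left]
    intro x hx hx'
    obtain ⟨y, hy, rfl⟩ := Multiset.mem_map.1 hx'
    exact neg_not_mem_repSet (hT (show y ∈ T from hy)) (hT (show -y ∈ T from hx))
  have hcard : Multiset.card (symmOf T.val) = 6 := by
    rw [card_symmOf, Finset.card_val, hc]
  rw [card_filter_map_eq_factorial _ hnd hcard]
  decide

/-! ## Paired characters and symmetric multiplicities -/

omit [NeZero m] in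
/-- A paired character has symmetric multiplicities. [folklore] -/
private theorem count_eq_count_neg_of_isPaired' {r : ℕ} {α : Fin r → ZMod m} (h : IsPaired α) (x : ZMod m) :
    Multiset.count x (univ.val.map α) = Multiset.count (-x) (univ.val.map α) := by
  classical
  obtain ⟨σ, -, -, hσ⟩ := h
  rw [count_univ_val_map, count_univ_val_map]
  refine Finset.card_bij (fun i _ ↦ σ i) (fun i hi ↦ ?_) (fun i _ j _ hij ↦ σ.injective hij) (fun j hj ↦ ?_)
  · simp only [Finset.mem_filter, Finset.mem_univ, true_and] at hi ⊢
    rw [hσ, hi]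
  · simp only [Finset.mem_filter, Finset.mem_univ, true_and] at hj
    refine ⟨σ.symm j, ?_, by simp⟩
    simp only [Finset.mem_filter, Finset.mem_univ, true_and]
    have := hσ (σ.symm j)
    rw [Equiv.apply_symm_apply] at this
    rw [← neg_neg x, ← hj, this, neg_neg]

/-- A character whose multiset of values is `t + (-t)`, `t` representatives, is a paired Hodge character (odd level). [folklore] -/
private theorem isHodge_and_isPaired_of_map_eq_symmOf (hm : ¬ 2 ∣ m) {t : Multiset (ZMod m)}
    (ht : ∀ x ∈ t, x ∈ repSet m) {r : ℕ} {α : Fin r → ZMod m} (h : univ.val.map α = symmOf t) :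
    IsHodge α ∧ IsPaired α := by
  classical
  have h0 : ∀ i, α i ≠ 0 := by
    intro i
    have hi : α i ∈ symmOf t := by
      rw [← h]
      exact Multiset.mem_map_of_mem α (mem_univ_val i)
    rcases mem_symmOf.1 hi with hi | hi
    · exact ne_zero_of_mem_repSet (ht _ hi)
    · exact fun e ↦ ne_zero_of_mem_repSet (ht _ hi) (by rw [e, neg_zero])
  have hp : IsPaired α := by
    refine isPaired_of_card_filter_eq (fun i e ↦ h0 i (eq_zero_of_eq_neg_oddLevel hm e)) fun x ↦ ?_
    rw [← count_univ_val_map, ← count_univ_val_map, h, count_neg_symmOf]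
  exact ⟨hp.isHodge h0, hp⟩

/-- **Classification (odd level).** The multiset of values of a paired Hodge sextuple is `t + (-t)` with `t` its three
representatives (of one of the shapes `{a,a,a}`, `{a,a,b}` (`a ≠ b`), `{a,b,c}` (distinct), `shape_three`). [folklore] -/
private theorem map_eq_symmOf_of_isPaired (hm : ¬ 2 ∣ m) {α : Fin 6 → ZMod m} (hα : IsHodge α) (hp : IsPaired α) :
    ∃ t : Multiset (ZMod m), (∀ x ∈ t, x ∈ repSet m) ∧ Multiset.card t = 3 ∧ univ.val.map α = symmOf t := by
  classical
  set s := univ.val.map α with hs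
  have h0 : (0 : ZMod m) ∉ s := by
    intro h
    obtain ⟨i, -, hi⟩ := Multiset.mem_map.1 h
    exact hα.1.1 i hi
  have hsym := count_eq_count_neg_of_isPaired' hp
  have he := eq_symmOf_filter hm h0 hsym
  refine ⟨s.filter (· ∈ repSet m), fun x hx ↦ (Multiset.mem_filter.1 hx).2, ?_, he⟩
  have hc : Multiset.card s = 6 := by simp [hs]
  have := congrArg Multiset.card he
  rw [card_symmOf, hc] at this
  omega

/-! ## The count -/

open scoped Classical in
/-- **The number of paired Hodge sextuples at odd level `m`** (characters `α ∈ 𝔅⁴ₘ` of the Fermat fourfold `X⁴ₘ`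
whose multiset of values is a union of three pairs `{a, −a}` — Shioda's decomposable elements of `𝔅⁴ₘ` built from
`𝔅⁰ₘ`): with `h = (m−1)/2`,
`#{paired α ∈ 𝔅⁴ₘ} = 20·h + 180·h(h−1) + 720·C(h,3)` (`= 15(m−1)³ − 45(m−1)² + 40(m−1)`), according to the three
shapes `{±a,±a,±a}`, `{±a,±a,±b}`, `{±a,±b,±c}` of the multiset of values with `6!/(3!3!) = 20`, `6!/(2!2!) = 180`,
`6! = 720` orderings. Printed instance: "the set `𝔅⁴₂₅` has … `182400` decomposable elements" (`m = 25`, `h = 12`: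
`240 + 23760 + 158400`). The closed form for general odd `m` is this formalisation's (elementary counting); it agrees
with the cell's fourfold enumeration at every odd `m ≤ 300`. [cite: Shioda1981FermatType, Appendix (A.1), p. 79] -/
theorem card_isHodge_isPaired_six (hm : ¬ 2 ∣ m) :
    (univ.filter fun α : Fin 6 → ZMod m ↦ IsHodge α ∧ IsPaired α).card =
      20 * ((m - 1) / 2) + 180 * ((m - 1) / 2 * ((m - 1) / 2 - 1)) + 720 * ((m - 1) / 2).choose 3 := by
  classical
  set R := repSet m with hR
  -- the three families of value multisets
  set IA : Finset (Multiset (ZMod m)) := R.image fun a ↦ symmOf {a, a, a} with hIA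
  set IB : Finset (Multiset (ZMod m)) := R.offDiag.image fun p ↦ symmOf {p.1, p.1, p.2} with hIB
  set IC : Finset (Multiset (ZMod m)) := (R.powersetCard 3).image fun T ↦ symmOf T.val with hIC
  set P : Finset (Fin 6 → ZMod m) := univ.filter fun α ↦ IsHodge α ∧ IsPaired α with hP
  -- every member of the families is `symmOf t`, `t ⊆ R`
  have hfam : ∀ s ∈ IA ∪ IB ∪ IC, ∃ t : Multiset (ZMod m), (∀ x ∈ t, x ∈ R) ∧ s = symmOf t := by
    intro s hs
    rcases Finset.mem_union.1 hs with hs | hs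
    · rcases Finset.mem_union.1 hs with hs | hs
      · obtain ⟨a, ha, rfl⟩ := Finset.mem_image.1 hs
        refine ⟨{a, a, a}, fun x hx ↦ ?_, rfl⟩
        simp only [Multiset.insert_eq_cons, Multiset.mem_cons, Multiset.mem_singleton] at hx
        rcases hx with rfl | rfl | rfl <;> exact ha
      · obtain ⟨p, hp, rfl⟩ := Finset.mem_image.1 hs
        obtain ⟨h1, h2, -⟩ := Finset.mem_offDiag.1 hp
        refine ⟨{p.1, p.1, p.2}, fun x hx ↦ ?_, rfl⟩
        simp only [Multiset.insert_eq_cons, Multiset.mem_cons, Multiset.mem_singleton] at hx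
        rcases hx with rfl | rfl | rfl
        · exact h1
        · exact h1
        · exact h2
    · obtain ⟨T, hT, rfl⟩ := Finset.mem_image.1 hs
      exact ⟨T.val, fun x hx ↦ (Finset.mem_powersetCard.1 hT).1 (show x ∈ T from hx), rfl⟩
  -- the multiset of values of a paired Hodge sextuple lies in one of the families
  have hmaps : (P : Set (Fin 6 → ZMod m)).MapsTo (fun α ↦ univ.val.map α) ↑(IA ∪ IB ∪ IC) := by
    intro α hα
    rw [Finset.mem_coe, hP, Finset.mem_filter] at hα
    obtain ⟨t, ht, hc, he⟩ := map_eq_symmOf_of_isPaired hm hα.2.1 hα.2.2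
    show univ.val.map α ∈ ((IA ∪ IB ∪ IC : Finset (Multiset (ZMod m))) : Set (Multiset (ZMod m)))
    rw [Finset.mem_coe, he, Finset.mem_union, Finset.mem_union]
    rcases shape_three hc with ⟨a, rfl⟩ | ⟨a, b, hab, rfl⟩ | hnd
    · refine Or.inl (Or.inl (Finset.mem_image.2 ⟨a, ht a (by simp), rfl⟩))
    · refine Or.inl (Or.inr (Finset.mem_image.2 ⟨(a, b), ?_, rfl⟩))
      exact Finset.mem_offDiag.2 ⟨ht a (by simp), ht b (by simp), hab⟩
    · refine Or.inr (Finset.mem_image.2 ⟨t.toFinset, ?_, ?_⟩)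
      · rw [Finset.mem_powersetCard]
        refine ⟨fun x hx ↦ ht x (Multiset.mem_toFinset.1 hx), ?_⟩
        rw [Multiset.toFinset_card_of_nodup hnd, hc]
      · rw [Multiset.toFinset_val, Multiset.dedup_eq_self.2 hnd]
  rw [Finset.card_eq_sum_card_fiberwise hmaps]
  -- the fibre over `symmOf t` is the set of ALL orderings of `symmOf t`
  have hfib : ∀ s ∈ IA ∪ IB ∪ IC, (P.filter fun α ↦ univ.val.map α = s).card =
      (univ.filter fun α : Fin 6 → ZMod m ↦ univ.val.map α = s).card := by
    intro s hs
    obtain ⟨t, ht, rfl⟩ := hfam s hs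
    rw [hP, Finset.filter_filter]
    congr 1
    refine Finset.filter_congr fun α _ ↦ ⟨fun h ↦ h.2, fun h ↦ ⟨?_, h⟩⟩
    exact isHodge_and_isPaired_of_map_eq_symmOf hm ht h
  rw [Finset.sum_congr rfl hfib]
  -- injectivity of the parametrisations and disjointness of the families, via `filter_symmOf`
  have key : ∀ {t t' : Multiset (ZMod m)}, (∀ x ∈ t, x ∈ R) → (∀ x ∈ t', x ∈ R) →
      symmOf t = symmOf t' → t = t' := by
    intro t t' ht ht' h
    rw [← filter_symmOf ht, ← filter_symmOf ht', h]
  have memAAA : ∀ {a : ZMod m}, a ∈ R → ∀ x ∈ ({a, a, a} : Multiset (ZMod m)), x ∈ R := by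
    intro a ha x hx
    simp only [Multiset.insert_eq_cons, Multiset.mem_cons, Multiset.mem_singleton] at hx
    rcases hx with rfl | rfl | rfl <;> exact ha
  have memAAB : ∀ {p : ZMod m × ZMod m}, p ∈ R.offDiag → ∀ x ∈ ({p.1, p.1, p.2} : Multiset (ZMod m)), x ∈ R := by
    intro p hp x hx
    obtain ⟨h1, h2, -⟩ := Finset.mem_offDiag.1 hp
    simp only [Multiset.insert_eq_cons, Multiset.mem_cons, Multiset.mem_singleton] at hx
    rcases hx with rfl | rfl | rfl
    · exact h1
    · exact h1
    · exact h2
  have memT : ∀ {T : Finset (ZMod m)}, T ∈ R.powersetCard 3 → ∀ x ∈ T.val, x ∈ R := fun hT x hx ↦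
    (Finset.mem_powersetCard.1 hT).1 (show x ∈ _ from hx)
  have not_nodup_AAB : ∀ (a b : ZMod m), ¬ ({a, a, b} : Multiset (ZMod m)).Nodup := by
    intro a b h
    simp [Multiset.nodup_cons] at h
  have hinjA : Set.InjOn (fun a : ZMod m ↦ symmOf {a, a, a}) ↑R := by
    intro a ha a' ha' h
    have e := key (memAAA ha) (memAAA ha') h
    have : a ∈ ({a', a', a'} : Multiset (ZMod m)) := by rw [← e]; simp
    simpa using this
  have hinjB : Set.InjOn (fun p : ZMod m × ZMod m ↦ symmOf {p.1, p.1, p.2}) ↑R.offDiag := by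
    rintro ⟨a, b⟩ hp ⟨a', b'⟩ hp' h
    have e := key (memAAB hp) (memAAB hp') h
    obtain ⟨-, -, hab⟩ := Finset.mem_offDiag.1 hp
    obtain ⟨-, -, hab'⟩ := Finset.mem_offDiag.1 hp'
    simp only [ne_eq] at hab hab'
    have hc := congrArg (Multiset.count a) e
    have haa' : a = a' := by
      by_contra hne
      by_cases hab2 : a = b'
      · subst hab2
        simp [hab, Ne.symm hab'] at hc
      · simp [hab, hne, hab2] at hc
    subst haa'
    simp only [Multiset.insert_eq_cons, Multiset.cons_inj_right, Multiset.singleton_inj] at e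
    rw [e]
  have hinjC : Set.InjOn (fun T : Finset (ZMod m) ↦ symmOf T.val) ↑(R.powersetCard 3) := by
    intro T hT T' hT' h
    exact Finset.val_injective (key (memT hT) (memT hT') h)
  have hdisjAB : Disjoint IA IB := by
    rw [Finset.disjoint_left]
    intro s hsA hsB
    obtain ⟨a, ha, rfl⟩ := Finset.mem_image.1 hsA
    obtain ⟨p, hp, hps⟩ := Finset.mem_image.1 hsB
    have e := key (memAAB hp) (memAAA ha) hps
    obtain ⟨-, -, hne⟩ := Finset.mem_offDiag.1 hp
    have h1 : p.1 ∈ ({a, a, a} : Multiset (ZMod m)) := by rw [← e]; simp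
    have h2 : p.2 ∈ ({a, a, a} : Multiset (ZMod m)) := by rw [← e]; simp
    simp only [Multiset.insert_eq_cons, Multiset.mem_cons, Multiset.mem_singleton, or_self] at h1 h2
    exact hne (h1.trans h2.symm)
  have hdisjC : Disjoint (IA ∪ IB) IC := by
    rw [Finset.disjoint_left]
    intro s hs hsC
    obtain ⟨T, hT, hTs⟩ := Finset.mem_image.1 hsC
    have hTnd : (T.val).Nodup := T.nodup
    rcases Finset.mem_union.1 hs with hs | hs
    · obtain ⟨a, ha, rfl⟩ := Finset.mem_image.1 hs
      have e := key (memT hT) (memAAA ha) hTs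
      rw [e] at hTnd
      exact not_nodup_AAB a a hTnd
    · obtain ⟨p, hp, rfl⟩ := Finset.mem_image.1 hs
      have e := key (memT hT) (memAAB hp) hTs
      rw [e] at hTnd
      exact not_nodup_AAB p.1 p.2 hTnd
  rw [Finset.sum_union hdisjC, Finset.sum_union hdisjAB, Finset.sum_image hinjA, Finset.sum_image hinjB,
    Finset.sum_image hinjC]
  have hsA : ∑ a ∈ R, (univ.filter fun α : Fin 6 → ZMod m ↦ univ.val.map α = symmOf {a, a, a}).card = 20 * R.card := by
    rw [Finset.sum_congr rfl fun a ha ↦ card_filter_symmOf_AAA ha, Finset.sum_const, smul_eq_mul]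
    exact mul_comm _ _
  have hfB : ∀ p ∈ R.offDiag,
      (univ.filter fun α : Fin 6 → ZMod m ↦ univ.val.map α = symmOf {p.1, p.1, p.2}).card = 180 := by
    intro p hp
    obtain ⟨h1, h2, h12⟩ := Finset.mem_offDiag.1 hp
    exact card_filter_symmOf_AAB h1 h2 h12
  have hsB : ∑ p ∈ R.offDiag, (univ.filter fun α : Fin 6 → ZMod m ↦ univ.val.map α = symmOf {p.1, p.1, p.2}).card =
      180 * R.offDiag.card := by
    rw [Finset.sum_congr rfl hfB, Finset.sum_const, smul_eq_mul]
    exact mul_comm _ _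
  have hfC : ∀ T ∈ R.powersetCard 3,
      (univ.filter fun α : Fin 6 → ZMod m ↦ univ.val.map α = symmOf T.val).card = 720 := by
    intro T hT
    obtain ⟨h1, h2⟩ := Finset.mem_powersetCard.1 hT
    exact card_filter_symmOf_ABC h1 h2
  have hsC : ∑ T ∈ R.powersetCard 3, (univ.filter fun α : Fin 6 → ZMod m ↦ univ.val.map α = symmOf T.val).card =
      720 * (R.powersetCard 3).card := by
    rw [Finset.sum_congr rfl hfC, Finset.sum_const, smul_eq_mul]
    exact mul_comm _ _
  rw [hsA, hsB, hsC, Finset.offDiag_card, Finset.card_powersetCard, hR, card_repSet hm, Nat.mul_sub_one]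

open scoped Classical in
/-- **Shioda 1981, Appendix, `m = 25`: "`182400` decomposable elements"** — the paired Hodge sextuples of `X⁴₂₅` number
`182400` (`h = 12`). [cite: Shioda1981FermatType, Appendix (A.1), p. 79] -/
theorem card_isHodge_isPaired_six_twentyfive :
    (univ.filter fun α : Fin 6 → ZMod 25 ↦ IsHodge α ∧ IsPaired α).card = 182400 := by
  rw [card_isHodge_isPaired_six (m := 25) (by norm_num)]
  decide

open scoped Classical in
/-- The same count as a polynomial in `m − 1`: `15(m−1)³ − 45(m−1)² + 40(m−1)` (odd `m`). [cite: Shioda1981FermatType, Appendix (A.1), p. 79] -/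
theorem card_isHodge_isPaired_six_eq_poly (hm : ¬ 2 ∣ m) :
    ((univ.filter fun α : Fin 6 → ZMod m ↦ IsHodge α ∧ IsPaired α).card : ℤ) =
      15 * ((m : ℤ) - 1) ^ 3 - 45 * ((m : ℤ) - 1) ^ 2 + 40 * ((m : ℤ) - 1) := by
  rw [card_isHodge_isPaired_six hm]
  have hm1 : 1 ≤ m := Nat.pos_of_ne_zero (NeZero.ne m)
  obtain ⟨h, hh⟩ : ∃ h, m = 2 * h + 1 := by
    refine ⟨(m - 1) / 2, ?_⟩
    have := Nat.two_dvd_ne_zero.mp hm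
    omega
  have hdiv : (m - 1) / 2 = h := by omega
  rw [hdiv]
  have hchoose : (h.choose 3 : ℤ) * 6 = h * (h - 1) * (h - 2) := by
    have h3 := Nat.descFactorial_eq_factorial_mul_choose h 3
    rw [show Nat.factorial 3 = 6 by rfl] at h3
    rcases Nat.lt_or_ge h 3 with hlt | hge
    · rw [Nat.choose_eq_zero_of_lt hlt]
      interval_cases h <;> norm_num
    · have e : (h.descFactorial 3 : ℤ) = h * (h - 1) * (h - 2) := by
        simp only [Nat.descFactorial_succ, Nat.descFactorial_zero, mul_one, Nat.sub_zero]
        push_cast [Nat.cast_sub (by omega : 1 ≤ h), Nat.cast_sub (by omega : 2 ≤ h)]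
        ring
      rw [← e, h3]
      push_cast
      ring
  rcases Nat.eq_zero_or_pos h with h0 | hpos
  · subst h0
    simp [hh]
  · push_cast [Nat.cast_sub hpos, hh]
    linear_combination 120 * hchoose

/-! ## Even level (Degtyarev–Shimada 2016, Theorem 1.4 / Remark 4.4): the self-negative residue `η = m/2`

At even level exactly one non-zero residue is its own negative, `η = m/2`, and `ℤ/m ∖ {0} = R ⊔ (−R) ⊔ {η}`
(`|R| = (m−2)/2`). The multiset of values of a paired Hodge sextuple is `t + (−t) + 2j·{η}` with `t` its
representatives and `|t| + j = 3`; conversely every ordering of such a multiset is a paired Hodge sextuple (a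
permutation of the juxtaposition `(a, −a)` of an ordering `a` of `t + j·{η}`). The seven shapes of `t` — `∅`;
`{a}`; `{a,a}`, `{a,b}`; `{a,a,a}`, `{a,a,b}`, `{a,b,c}` — give value multisets with `1; 30; 90, 360; 20, 180, 720`
orderings, parametrised injectively by `pt; R; R, C(R,2); R, R.offDiag, C(R,3)`; the families are told apart by
the invariant `10|t| + |t.dedup| ∈ {0, 11, 21, 22, 31, 32, 33}`. -/

section EvenLevel

/-- `η = m/2 ∈ ℤ/m` (plumbing). [folklore] -/
private def eta (m : ℕ) : ZMod m := ((m / 2 : ℕ) : ZMod m)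

/-- `NeZero` and even: `2 ≤ m`. [folklore] -/
private theorem two_le_of_two_dvd (hm : 2 ∣ m) : 2 ≤ m :=
  Nat.le_of_dvd (Nat.pos_of_ne_zero (NeZero.ne m)) hm

/-- `⟨η⟩ = m/2`. [folklore] -/
private theorem eta_val : (eta m).val = m / 2 := by
  rw [eta, ZMod.val_natCast]
  exact Nat.mod_eq_of_lt (Nat.div_lt_self (Nat.pos_of_ne_zero (NeZero.ne m)) one_lt_two)

/-- `η ≠ 0` at even level. [folklore] -/
private theorem eta_ne_zero (hm : 2 ∣ m) : eta m ≠ 0 := by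
  intro h
  have h1 := congrArg ZMod.val h
  rw [eta_val, ZMod.val_zero] at h1
  have := two_le_of_two_dvd hm
  omega

omit [NeZero m] in
/-- `η + η = 0` at even level. [folklore] -/
private theorem eta_add_eta (hm : 2 ∣ m) : eta m + eta m = 0 := by
  have h : m / 2 + m / 2 = m := by omega
  rw [eta, ← Nat.cast_add, h, ZMod.natCast_self]

omit [NeZero m] in
/-- `−η = η` at even level. [folklore] -/
private theorem neg_eta (hm : 2 ∣ m) : -eta m = eta m :=
  neg_eq_of_add_eq_zero_left (eta_add_eta hm)

/-- At even level a non-zero self-negative residue is `η`. [folklore] -/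
private theorem eq_eta_of_eq_neg (hm : 2 ∣ m) {x : ZMod m} (hx : x ≠ 0) (h : x = -x) : x = eta m := by
  apply ZMod.val_injective m
  rw [eta_val]
  have h1 := val_add_val_neg hx
  rw [← h] at h1
  omega

/-- `η` is not a representative. [folklore] -/
private theorem eta_not_mem_repSet (hm : 2 ∣ m) : eta m ∉ repSet m := fun h ↦
  ne_neg_of_mem_repSet h (neg_eta hm).symm

/-- A representative is not `η`. [folklore] -/
private theorem ne_eta_of_mem_repSet (hm : 2 ∣ m) {a : ZMod m} (ha : a ∈ repSet m) : a ≠ eta m :=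
  fun h ↦ eta_not_mem_repSet hm (h ▸ ha)

/-- The negative of a representative is not `η`. [folklore] -/
private theorem neg_ne_eta_of_mem_repSet (hm : 2 ∣ m) {a : ZMod m} (ha : a ∈ repSet m) : -a ≠ eta m := by
  intro h
  refine eta_not_mem_repSet hm ?_
  rw [← neg_eta hm, ← h, neg_neg]
  exact ha

/-- At even level `ℤ/m ∖ {0} = R ⊔ (−R) ⊔ {η}`; hence there are `(m − 2)/2` representatives. [folklore] -/
private theorem card_repSet_even (hm : 2 ∣ m) : (repSet m).card = (m - 2) / 2 := by
  classical
  have hunion : (univ.erase (0 : ZMod m)) = (repSet m ∪ (repSet m).image Neg.neg) ∪ {eta m} := by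
    ext x
    simp only [mem_erase, mem_univ, and_true, mem_union, mem_image, mem_singleton]
    constructor
    · intro hx
      by_cases h : x ∈ repSet m
      · exact Or.inl (Or.inl h)
      · by_cases hxx : x = -x
        · exact Or.inr (eq_eta_of_eq_neg hm hx hxx)
        · exact Or.inl (Or.inr ⟨-x, neg_mem_repSet_of_ne_neg hx hxx h, neg_neg x⟩)
    · rintro ((h | ⟨y, hy, rfl⟩) | rfl)
      · exact ne_zero_of_mem_repSet h
      · exact neg_ne_zero.2 (ne_zero_of_mem_repSet hy)
      · exact eta_ne_zero hm
  have hdisj : Disjoint (repSet m) ((repSet m).image Neg.neg) := by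
    rw [Finset.disjoint_left]
    rintro x hx hx'
    obtain ⟨y, hy, rfl⟩ := mem_image.1 hx'
    exact neg_not_mem_repSet hy hx
  have hdisj' : Disjoint (repSet m ∪ (repSet m).image Neg.neg) {eta m} := by
    rw [Finset.disjoint_singleton_right, mem_union, not_or]
    refine ⟨eta_not_mem_repSet hm, fun h ↦ ?_⟩
    obtain ⟨y, hy, hy'⟩ := mem_image.1 h
    exact neg_ne_eta_of_mem_repSet hm hy hy'
  have hcard := congrArg Finset.card hunion
  rw [card_erase_of_mem (mem_univ _), card_univ, ZMod.card, card_union_of_disjoint hdisj',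
    card_union_of_disjoint hdisj, card_image_of_injective _ neg_injective, card_singleton] at hcard
  omega

/-! ### Classification at even level -/

/-- A multiset of non-zero residues with symmetric multiplicities is `t + (−t)` plus its self-negative part,
`t` = its representatives (any level). [folklore] -/
private theorem eq_symmOf_filter_add {s : Multiset (ZMod m)} (h0 : (0 : ZMod m) ∉ s)
    (hsym : ∀ x, Multiset.count x s = Multiset.count (-x) s) :
    s = symmOf (s.filter (· ∈ repSet m)) + s.filter (fun x ↦ x = -x) := by
  classical
  refine Multiset.ext.mpr fun x ↦ ?_
  rw [Multiset.count_add, count_symmOf, Multiset.count_filter, Multiset.count_filter,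
    Multiset.count_filter]
  by_cases hx : x = 0
  · subst hx
    have hc : Multiset.count (0 : ZMod m) s = 0 := Multiset.count_eq_zero.2 h0
    simp [hc]
  · by_cases hR : x ∈ repSet m
    · rw [if_pos hR, if_neg (neg_not_mem_repSet hR), if_neg (ne_neg_of_mem_repSet hR), add_zero, add_zero]
    · by_cases hxx : x = -x
      · have hR' : -x ∉ repSet m := fun h ↦ hR (by rwa [← hxx] at h)
        rw [if_neg hR, if_neg hR', if_pos hxx, zero_add, zero_add]
      · rw [if_neg hR, if_pos (neg_mem_repSet_of_ne_neg hx hxx hR), if_neg hxx, zero_add, add_zero, ← hsym]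

/-- At even level the self-negative part of a multiset of non-zero residues consists of `η`'s. [folklore] -/
private theorem filter_eq_neg_eq_replicate (hm : 2 ∣ m) {s : Multiset (ZMod m)} (h0 : (0 : ZMod m) ∉ s) :
    s.filter (fun x ↦ x = -x) = Multiset.replicate (s.count (eta m)) (eta m) := by
  classical
  rw [← Multiset.filter_eq' s (eta m)]
  refine Multiset.filter_congr fun x hx ↦ ⟨fun h ↦ ?_, fun h ↦ ?_⟩
  · exact eq_eta_of_eq_neg hm (fun e ↦ h0 (by rwa [e] at hx)) h
  · rw [h]
    exact (neg_eta hm).symm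

/-- The representatives occurring in `t + (−t) + k·{η}` are `t` (when `t` consists of representatives). [folklore] -/
private theorem filter_symmOf_add_replicate (hm : 2 ∣ m) {t : Multiset (ZMod m)} (ht : ∀ x ∈ t, x ∈ repSet m)
    (k : ℕ) : (symmOf t + Multiset.replicate k (eta m)).filter (· ∈ repSet m) = t := by
  rw [Multiset.filter_add, filter_symmOf ht, Multiset.filter_eq_nil.2, add_zero]
  intro x hx
  rw [Multiset.eq_of_mem_replicate hx]
  exact eta_not_mem_repSet hm

/-- **Classification (even level).** The multiset of values of a paired Hodge sextuple `α` is
`t + (−t) + 2j·{η}`, `t` the representatives among the values, `|t| + j = 3`. [folklore] -/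
private theorem map_eq_symmOf_add_of_isPaired (hm : 2 ∣ m) {α : Fin 6 → ZMod m} (hα : IsHodge α)
    (hp : IsPaired α) :
    ∃ j : ℕ, Multiset.card ((univ.val.map α).filter (· ∈ repSet m)) + j = 3 ∧
      univ.val.map α = symmOf ((univ.val.map α).filter (· ∈ repSet m)) + Multiset.replicate (2 * j) (eta m) := by
  classical
  set s := univ.val.map α with hs
  have h0 : (0 : ZMod m) ∉ s := by
    intro h
    obtain ⟨i, -, hi⟩ := Multiset.mem_map.1 h
    exact hα.1.1 i hi
  have hsym := count_eq_count_neg_of_isPaired' hp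
  have he := eq_symmOf_filter_add h0 hsym
  rw [filter_eq_neg_eq_replicate hm h0] at he
  have hc : Multiset.card s = 6 := by simp [hs]
  have hk := congrArg Multiset.card he
  rw [Multiset.card_add, card_symmOf, Multiset.card_replicate, hc] at hk
  refine ⟨3 - Multiset.card (s.filter (· ∈ repSet m)), by omega, ?_⟩
  have h2 : 2 * (3 - Multiset.card (s.filter (· ∈ repSet m))) = s.count (eta m) := by omega
  rw [h2]
  exact he

/-! ### Every ordering of `t + (−t) + 2j·{η}` is a paired Hodge sextuple -/

omit [NeZero m] in
/-- `IsPaired` is invariant under permutations of the indices. [folklore] -/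
private theorem isPaired_comp_perm {r : ℕ} {β : Fin r → ZMod m} (h : IsPaired β) (π : Equiv.Perm (Fin r)) :
    IsPaired (β ∘ π) := by
  obtain ⟨σ, h1, h2, h3⟩ := h
  refine ⟨(π.trans σ).trans π.symm, fun i e ↦ h1 (π i) ?_, fun i ↦ ?_, fun i ↦ ?_⟩
  · simpa using congrArg π e
  · simp [h2]
  · simp [h3]

omit [NeZero m] in
/-- The juxtaposition `(a, −a)` is paired: exchange the halves. [folklore] -/
private theorem isPaired_append_neg {k : ℕ} (a : Fin k → ZMod m) : IsPaired (Fin.append a (-a)) := by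
  refine ⟨finSumFinEquiv.symm.trans ((Equiv.sumComm _ _).trans finSumFinEquiv), fun i h ↦ ?_, fun i ↦ ?_,
    fun i ↦ ?_⟩
  · -- no fixed points: `swap x ≠ x`
    have h' := congrArg finSumFinEquiv.symm h
    rw [Equiv.trans_apply, Equiv.trans_apply, Equiv.symm_apply_apply, Equiv.sumComm_apply] at h'
    cases hx : finSumFinEquiv.symm i with
    | inl j => rw [hx] at h'; exact Sum.inr_ne_inl h'
    | inr j => rw [hx] at h'; exact Sum.inl_ne_inr h'
  · simp
  · cases hx : finSumFinEquiv.symm i with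
    | inl j =>
        obtain rfl : i = finSumFinEquiv (Sum.inl j) := finSumFinEquiv.symm_apply_eq.1 hx
        rw [Equiv.trans_apply, Equiv.trans_apply, Equiv.symm_apply_apply, Equiv.sumComm_apply, Sum.swap_inl,
          finSumFinEquiv_apply_right, finSumFinEquiv_apply_left, Fin.append_right, Fin.append_left, Pi.neg_apply]
    | inr j =>
        obtain rfl : i = finSumFinEquiv (Sum.inr j) := finSumFinEquiv.symm_apply_eq.1 hx
        rw [Equiv.trans_apply, Equiv.trans_apply, Equiv.symm_apply_apply, Equiv.sumComm_apply, Sum.swap_inr,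
          finSumFinEquiv_apply_left, finSumFinEquiv_apply_right, Fin.append_left, Fin.append_right, Pi.neg_apply,
          neg_neg]

omit [NeZero m] in
/-- The multiset of values of `(a, −a)` is `t + (−t)`, `t` that of `a`. [folklore] -/
private theorem univ_val_map_append_neg {k : ℕ} (a : Fin k → ZMod m) :
    univ.val.map (Fin.append a (-a)) = symmOf (univ.val.map a) := by
  rw [symmOf, Fin.univ_val_map, Fin.univ_val_map, List.ofFn_fin_append, ← Multiset.coe_add, Multiset.map_coe,
    List.map_ofFn]
  rfl

/-- **Every ordering of `t + (−t) + 2j·{η}` (`t` representatives, `|t| + j = 3`) is a paired Hodge sextuple**: it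
is a permutation of the juxtaposition `(a, −a)`, `a` an ordering of `t + j·{η}`, and its values are non-zero.
[folklore] -/
private theorem isHodge_and_isPaired_of_map_eq_symmOf_add (hm : 2 ∣ m) {t : Multiset (ZMod m)}
    (ht : ∀ x ∈ t, x ∈ repSet m) {j : ℕ} (hc : Multiset.card t + j = 3) {α : Fin 6 → ZMod m}
    (h : univ.val.map α = symmOf t + Multiset.replicate (2 * j) (eta m)) : IsHodge α ∧ IsPaired α := by
  classical
  obtain ⟨r, a, ha⟩ := exists_eq_univ_val_map (t + Multiset.replicate j (eta m))
  have hr : r = 3 := by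
    have := congrArg Multiset.card ha
    simp only [Multiset.card_map, Finset.card_val, Finset.card_univ, Fintype.card_fin, Multiset.card_add,
      Multiset.card_replicate] at this
    omega
  subst hr
  have hw : univ.val.map (Fin.append a (-a)) = univ.val.map α := by
    rw [univ_val_map_append_neg, h, symmOf, symmOf, ha, Multiset.map_add, Multiset.map_replicate, neg_eta hm,
      two_mul, Multiset.replicate_add]
    abel
  obtain ⟨σ, hσ⟩ := exists_perm_of_univ_val_map_eq hw
  have hp : IsPaired α := by
    rw [hσ]
    exact isPaired_comp_perm (isPaired_append_neg a) σ
  have h0 : ∀ i, α i ≠ 0 := by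
    intro i
    have hi : α i ∈ symmOf t + Multiset.replicate (2 * j) (eta m) := by
      rw [← h]
      exact Multiset.mem_map_of_mem α (mem_univ_val i)
    rcases Multiset.mem_add.1 hi with hi | hi
    · rcases mem_symmOf.1 hi with hi | hi
      · exact ne_zero_of_mem_repSet (ht _ hi)
      · exact fun e ↦ ne_zero_of_mem_repSet (ht _ hi) (by rw [e, neg_zero])
    · rw [Multiset.eq_of_mem_replicate hi]
      exact eta_ne_zero hm
  exact ⟨hp.isHodge h0, hp⟩

/-! ### Orderings of the four new shapes -/

set_option maxRecDepth 8000 in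
/-- `6!/(2!·2!·2!) = 90` orderings of `{a,a,b,b,c,c}` (kernel evaluation on the alphabet `Fin 3`). [folklore] -/
private theorem card_orderings_two_two_two :
    (univ.filter fun β : Fin 6 → Fin 3 ↦ univ.val.map β = ({0, 0, 1, 1, 2, 2} : Multiset (Fin 3))).card = 90 := by
  decide +kernel

set_option maxRecDepth 40000 in
/-- `6!/2! = 360` orderings of `{a,b,c,d,e,e}` (kernel evaluation on the alphabet `Fin 5`). [folklore] -/
private theorem card_orderings_one_one_one_one_two :
    (univ.filter fun β : Fin 6 → Fin 5 ↦ univ.val.map β = ({0, 1, 2, 3, 4, 4} : Multiset (Fin 5))).card = 360 := by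
  decide +kernel

set_option maxRecDepth 8000 in
/-- `6!/4! = 30` orderings of `{a,b,c,c,c,c}` (kernel evaluation on the alphabet `Fin 3`). [folklore] -/
private theorem card_orderings_one_one_four :
    (univ.filter fun β : Fin 6 → Fin 3 ↦ univ.val.map β = ({0, 1, 2, 2, 2, 2} : Multiset (Fin 3))).card = 30 := by
  decide +kernel

/-- One ordering of `{c,c,c,c,c,c}` (kernel evaluation on the alphabet `Fin 1`). [folklore] -/
private theorem card_orderings_six :
    (univ.filter fun β : Fin 6 → Fin 1 ↦ univ.val.map β = ({0, 0, 0, 0, 0, 0} : Multiset (Fin 1))).card = 1 := by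
  decide +kernel

/-- Shape `{a,a,−a,−a,η,η}`, `a` a representative: `90` orderings. [folklore] -/
private theorem card_filter_shape_AA (hm : 2 ∣ m) {a : ZMod m} (ha : a ∈ repSet m) :
    (univ.filter fun α : Fin 6 → ZMod m ↦
      univ.val.map α = symmOf {a, a} + Multiset.replicate 2 (eta m)).card = 90 := by
  classical
  have h1 : a ≠ -a := ne_neg_of_mem_repSet ha
  have h2 : a ≠ eta m := ne_eta_of_mem_repSet hm ha
  have h3 : -a ≠ eta m := neg_ne_eta_of_mem_repSet hm ha
  have hinj : Function.Injective ![a, -a, eta m] := by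
    intro i j h
    fin_cases i <;> fin_cases j <;> simp [h1, h1.symm, h2, h2.symm, h3, h3.symm] at h ⊢
  have he : symmOf {a, a} + Multiset.replicate 2 (eta m) =
      ({0, 0, 1, 1, 2, 2} : Multiset (Fin 3)).map (⟨![a, -a, eta m], hinj⟩ : Fin 3 ↪ ZMod m) :=
    rfl
  rw [he, card_filter_map_eq_map_emb, card_orderings_two_two_two]

/-- Shape `{a,b,−a,−b,η,η}`, `a ≠ b` representatives: `360` orderings. [folklore] -/
private theorem card_filter_shape_AB (hm : 2 ∣ m) {a b : ZMod m} (ha : a ∈ repSet m) (hb : b ∈ repSet m)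
    (hab : a ≠ b) :
    (univ.filter fun α : Fin 6 → ZMod m ↦
      univ.val.map α = symmOf {a, b} + Multiset.replicate 2 (eta m)).card = 360 := by
  classical
  have h1 : a ≠ -a := ne_neg_of_mem_repSet ha
  have h2 : b ≠ -b := ne_neg_of_mem_repSet hb
  have h3 : a ≠ -b := fun h ↦ neg_not_mem_repSet hb (h ▸ ha)
  have h4 : b ≠ -a := fun h ↦ neg_not_mem_repSet ha (h ▸ hb)
  have h5 : -a ≠ -b := fun h ↦ hab (neg_injective h)
  have h6 : a ≠ eta m := ne_eta_of_mem_repSet hm ha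
  have h7 : b ≠ eta m := ne_eta_of_mem_repSet hm hb
  have h8 : -a ≠ eta m := neg_ne_eta_of_mem_repSet hm ha
  have h9 : -b ≠ eta m := neg_ne_eta_of_mem_repSet hm hb
  have hinj : Function.Injective ![a, b, -a, -b, eta m] := by
    intro i j h
    fin_cases i <;> fin_cases j <;>
      simp [hab, hab.symm, h1, h1.symm, h2, h2.symm, h3, h3.symm, h4, h4.symm, h5, h5.symm, h6, h6.symm,
        h7, h7.symm, h8, h8.symm, h9, h9.symm] at h ⊢
  have he : symmOf {a, b} + Multiset.replicate 2 (eta m) =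
      ({0, 1, 2, 3, 4, 4} : Multiset (Fin 5)).map (⟨![a, b, -a, -b, eta m], hinj⟩ : Fin 5 ↪ ZMod m) :=
    rfl
  rw [he, card_filter_map_eq_map_emb, card_orderings_one_one_one_one_two]

/-- Shape `{a,−a,η,η,η,η}`, `a` a representative: `30` orderings. [folklore] -/
private theorem card_filter_shape_A (hm : 2 ∣ m) {a : ZMod m} (ha : a ∈ repSet m) :
    (univ.filter fun α : Fin 6 → ZMod m ↦
      univ.val.map α = symmOf {a} + Multiset.replicate 4 (eta m)).card = 30 := by
  classical
  have h1 : a ≠ -a := ne_neg_of_mem_repSet ha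
  have h2 : a ≠ eta m := ne_eta_of_mem_repSet hm ha
  have h3 : -a ≠ eta m := neg_ne_eta_of_mem_repSet hm ha
  have hinj : Function.Injective ![a, -a, eta m] := by
    intro i j h
    fin_cases i <;> fin_cases j <;> simp [h1, h1.symm, h2, h2.symm, h3, h3.symm] at h ⊢
  have he : symmOf {a} + Multiset.replicate 4 (eta m) =
      ({0, 1, 2, 2, 2, 2} : Multiset (Fin 3)).map (⟨![a, -a, eta m], hinj⟩ : Fin 3 ↪ ZMod m) :=
    rfl
  rw [he, card_filter_map_eq_map_emb, card_orderings_one_one_four]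

/-- Shape `{η,η,η,η,η,η}`: one ordering. [folklore] -/
private theorem card_filter_shape_empty :
    (univ.filter fun α : Fin 6 → ZMod m ↦
      univ.val.map α = symmOf 0 + Multiset.replicate 6 (eta m)).card = 1 := by
  classical
  have hinj : Function.Injective ![eta m] := fun i j _ ↦ Subsingleton.elim i j
  have he : symmOf (0 : Multiset (ZMod m)) + Multiset.replicate 6 (eta m) =
      ({0, 0, 0, 0, 0, 0} : Multiset (Fin 1)).map (⟨![eta m], hinj⟩ : Fin 1 ↪ ZMod m) :=
    rfl
  rw [he, card_filter_map_eq_map_emb, card_orderings_six]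

/-! ### An invariant separating the seven families -/

/-- `κ(t) = 10|t| + |t.dedup|` (plumbing: tells the seven shapes apart). [folklore] -/
private def kappa (t : Multiset (ZMod m)) : ℕ := 10 * Multiset.card t + Multiset.card t.dedup

omit [NeZero m] in
/-- `κ(∅) = 0`. [folklore] -/
private theorem kappa_zero : kappa (0 : Multiset (ZMod m)) = 0 := by
  simp [kappa]

omit [NeZero m] in
/-- `κ = 11|t|` on duplicate-free `t`. [folklore] -/
private theorem kappa_of_nodup {t : Multiset (ZMod m)} (h : t.Nodup) : kappa t = 11 * Multiset.card t := by
  rw [kappa, Multiset.dedup_eq_self.2 h]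
  ring

omit [NeZero m] in
/-- `κ{a} = 11`. [folklore] -/
private theorem kappa_A (a : ZMod m) : kappa ({a} : Multiset (ZMod m)) = 11 := by
  rw [kappa_of_nodup (Multiset.nodup_singleton a), Multiset.card_singleton]

omit [NeZero m] in
/-- `κ{a,a} = 21`. [folklore] -/
private theorem kappa_AA (a : ZMod m) : kappa ({a, a} : Multiset (ZMod m)) = 21 := by
  have h1 : Multiset.dedup (a ::ₘ {a}) = {a} := by
    rw [Multiset.dedup_cons_of_mem (Multiset.mem_singleton_self a),
      Multiset.dedup_eq_self.2 (Multiset.nodup_singleton a)]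
  simp [kappa, h1]

omit [NeZero m] in
/-- `κ{a,a,a} = 31`. [folklore] -/
private theorem kappa_AAA (a : ZMod m) : kappa ({a, a, a} : Multiset (ZMod m)) = 31 := by
  have h1 : Multiset.dedup (a ::ₘ a ::ₘ {a}) = {a} := by
    rw [Multiset.dedup_cons_of_mem (Multiset.mem_cons_self a _),
      Multiset.dedup_cons_of_mem (Multiset.mem_singleton_self a),
      Multiset.dedup_eq_self.2 (Multiset.nodup_singleton a)]
  simp [kappa, h1]

omit [NeZero m] in
/-- `κ{a,a,b} = 32` for `a ≠ b`. [folklore] -/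
private theorem kappa_AAB {a b : ZMod m} (hab : a ≠ b) : kappa ({a, a, b} : Multiset (ZMod m)) = 32 := by
  have hab' : a ∉ ({b} : Multiset (ZMod m)) := by rwa [Multiset.mem_singleton]
  have h1 : Multiset.dedup (a ::ₘ a ::ₘ {b}) = a ::ₘ {b} := by
    rw [Multiset.dedup_cons_of_mem (Multiset.mem_cons_self a _), Multiset.dedup_cons_of_notMem hab',
      Multiset.dedup_eq_self.2 (Multiset.nodup_singleton b)]
  simp [kappa, h1]

/-! ### The count at even level -/

omit [NeZero m] in
/-- The value of a pair as a multiset: `{a, b}` for `a ≠ b`. [folklore] -/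
private theorem pair_val {a b : ZMod m} (hab : a ≠ b) :
    ({a, b} : Finset (ZMod m)).val = ({a, b} : Multiset (ZMod m)) := by
  rw [Finset.insert_val_of_notMem (by rwa [Finset.mem_singleton]), Finset.singleton_val]
  rfl

open scoped Classical in
/-- **The number of paired Hodge sextuples at even level `m`** (characters `α ∈ 𝔅⁴ₘ` of the Fermat fourfold
`X⁴ₘ` whose multiset of values is a union of three pairs `{a, −a}`, the pair `{η, η}`, `η = m/2 = −η`, now being
available): with `h = (m−2)/2` the number of representatives of the pairs `{x, −x}`, `x ≠ −x`,
`#{paired α ∈ 𝔅⁴ₘ} = 1 + 30·h + 90·h + 360·C(h,2) + 20·h + 180·h(h−1) + 720·C(h,3)` (`= 120h³ + 20h + 1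
= 15(m−1)³ − 45(m−1)² + 55(m−1) − 24`), the seven terms counting the orderings of the value multisets
`t + (−t) + (6 − 2|t|)·{η}` by the shape of `t`: `∅`; `{a}`; `{a,a}`, `{a,b}`; `{a,a,a}`, `{a,a,b}`, `{a,b,c}`.
This is the even-level case of `|Γ_𝒥|` in [Degtyarev–Shimada, Def. 1.3, Thm. 1.4: "the rank of the group
`𝓛_𝒦(X)` is equal to `|Γ_𝒦| + 1`" (`𝓛 = 𝓛_𝒥` the `ℤ`-span of the classes of the standard `d`-spaces, here
`d = 2`); `Γ_𝒥` = the characters with non-zero entries admitting a matching into pairs `{a, −a}` = the paired Hodge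
sextuples], printed for `n = 4` in Remark 4.4 as the polynomial `15m³ − 90m² + 175m − 100 + (15m − 39)δₘ`,
`δₘ ≡ m − 1 (mod 2)` (tree: `card_isHodge_isPaired_six_eq_degtyarevShimada`). The elementary counting proof is
this formalisation's. [cite: DegtyarevShimada2016, Theorem 1.4 and Remark 4.4] -/
theorem card_isHodge_isPaired_six_even (hm : 2 ∣ m) :
    (univ.filter fun α : Fin 6 → ZMod m ↦ IsHodge α ∧ IsPaired α).card =
      1 + 30 * ((m - 2) / 2) + 90 * ((m - 2) / 2) + 360 * ((m - 2) / 2).choose 2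
        + 20 * ((m - 2) / 2) + 180 * ((m - 2) / 2 * ((m - 2) / 2 - 1)) + 720 * ((m - 2) / 2).choose 3 := by
  classical
  -- the seven families of `R`-parts `t`, `R = repSet m`
  set T0 : Finset (Multiset (ZMod m)) := {0} with hT0
  set T1 : Finset (Multiset (ZMod m)) := (repSet m).image fun a ↦ {a} with hT1
  set T2A : Finset (Multiset (ZMod m)) := (repSet m).image fun a ↦ {a, a} with hT2A
  set T2B : Finset (Multiset (ZMod m)) := ((repSet m).powersetCard 2).image fun T ↦ T.val with hT2B
  set T3A : Finset (Multiset (ZMod m)) := (repSet m).image fun a ↦ {a, a, a} with hT3A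
  set T3B : Finset (Multiset (ZMod m)) := (repSet m).offDiag.image fun p ↦ {p.1, p.1, p.2} with hT3B
  set T3C : Finset (Multiset (ZMod m)) := ((repSet m).powersetCard 3).image fun T ↦ T.val with hT3C
  set P : Finset (Fin 6 → ZMod m) := univ.filter fun α ↦ IsHodge α ∧ IsPaired α with hP
  -- members of the families consist of representatives
  have memAAA : ∀ {a : ZMod m}, a ∈ repSet m → ∀ x ∈ ({a, a, a} : Multiset (ZMod m)), x ∈ repSet m := by
    intro a ha x hx
    simp only [Multiset.insert_eq_cons, Multiset.mem_cons, Multiset.mem_singleton] at hx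
    rcases hx with rfl | rfl | rfl <;> exact ha
  have memAAB : ∀ {p : ZMod m × ZMod m}, p ∈ (repSet m).offDiag →
      ∀ x ∈ ({p.1, p.1, p.2} : Multiset (ZMod m)), x ∈ repSet m := by
    intro p hp x hx
    obtain ⟨h1, h2, -⟩ := Finset.mem_offDiag.1 hp
    simp only [Multiset.insert_eq_cons, Multiset.mem_cons, Multiset.mem_singleton] at hx
    rcases hx with rfl | rfl | rfl
    · exact h1
    · exact h1
    · exact h2
  have memAA : ∀ {a : ZMod m}, a ∈ repSet m → ∀ x ∈ ({a, a} : Multiset (ZMod m)), x ∈ repSet m := by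
    intro a ha x hx
    simp only [Multiset.insert_eq_cons, Multiset.mem_cons, Multiset.mem_singleton] at hx
    rcases hx with rfl | rfl <;> exact ha
  have memA : ∀ {a : ZMod m}, a ∈ repSet m → ∀ x ∈ ({a} : Multiset (ZMod m)), x ∈ repSet m := by
    intro a ha x hx
    rw [Multiset.mem_singleton] at hx
    exact hx ▸ ha
  have memT : ∀ {k : ℕ} {T : Finset (ZMod m)}, T ∈ (repSet m).powersetCard k → ∀ x ∈ T.val, x ∈ repSet m :=
    fun hT x hx ↦ (Finset.mem_powersetCard.1 hT).1 (show x ∈ _ from hx)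
  -- the invariant `κ` on the families
  have hκ0 : ∀ t ∈ T0, kappa t = 0 := fun t ht ↦ by
    rw [hT0, Finset.mem_singleton] at ht
    rw [ht, kappa_zero]
  have hκ1 : ∀ t ∈ T1, kappa t = 11 := fun t ht ↦ by
    obtain ⟨a, -, rfl⟩ := Finset.mem_image.1 ht
    exact kappa_A a
  have hκ2A : ∀ t ∈ T2A, kappa t = 21 := fun t ht ↦ by
    obtain ⟨a, -, rfl⟩ := Finset.mem_image.1 ht
    exact kappa_AA a
  have hκ2B : ∀ t ∈ T2B, kappa t = 22 := fun t ht ↦ by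
    obtain ⟨T, hT, rfl⟩ := Finset.mem_image.1 ht
    rw [kappa_of_nodup T.nodup, Finset.card_val, (Finset.mem_powersetCard.1 hT).2]
  have hκ3A : ∀ t ∈ T3A, kappa t = 31 := fun t ht ↦ by
    obtain ⟨a, -, rfl⟩ := Finset.mem_image.1 ht
    exact kappa_AAA a
  have hκ3B : ∀ t ∈ T3B, kappa t = 32 := fun t ht ↦ by
    obtain ⟨p, hp, rfl⟩ := Finset.mem_image.1 ht
    exact kappa_AAB (Finset.mem_offDiag.1 hp).2.2
  have hκ3C : ∀ t ∈ T3C, kappa t = 33 := fun t ht ↦ by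
    obtain ⟨T, hT, rfl⟩ := Finset.mem_image.1 ht
    rw [kappa_of_nodup T.nodup, Finset.card_val, (Finset.mem_powersetCard.1 hT).2]
  -- pairwise disjointness of the left-nested unions, by `κ`
  have disj : ∀ {A B : Finset (Multiset (ZMod m))} (b c : ℕ), (∀ t ∈ A, kappa t ≤ b) →
      (∀ t ∈ B, kappa t = c) → b < c → Disjoint A B := by
    intro A B b c hA hB hbc
    rw [Finset.disjoint_left]
    intro t htA htB
    have h1 := hA t htA
    have h2 := hB t htB
    omega
  have ext : ∀ {A B : Finset (Multiset (ZMod m))} (b c : ℕ), (∀ t ∈ A, kappa t ≤ b) →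
      (∀ t ∈ B, kappa t = c) → b ≤ c → ∀ t ∈ A ∪ B, kappa t ≤ c := by
    intro A B b c hA hB hbc t ht
    rcases Finset.mem_union.1 ht with ht | ht
    · exact (hA t ht).trans hbc
    · exact (hB t ht).le
  have hb0 : ∀ t ∈ T0, kappa t ≤ 0 := fun t ht ↦ (hκ0 t ht).le
  have hb1 := ext 0 11 hb0 hκ1 (by norm_num)
  have hb2 := ext 11 21 hb1 hκ2A (by norm_num)
  have hb3 := ext 21 22 hb2 hκ2B (by norm_num)
  have hb4 := ext 22 31 hb3 hκ3A (by norm_num)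
  have hb5 := ext 31 32 hb4 hκ3B (by norm_num)
  have hd1 : Disjoint T0 T1 := disj 0 11 hb0 hκ1 (by norm_num)
  have hd2 : Disjoint (T0 ∪ T1) T2A := disj 11 21 hb1 hκ2A (by norm_num)
  have hd3 : Disjoint (T0 ∪ T1 ∪ T2A) T2B := disj 21 22 hb2 hκ2B (by norm_num)
  have hd4 : Disjoint (T0 ∪ T1 ∪ T2A ∪ T2B) T3A := disj 22 31 hb3 hκ3A (by norm_num)
  have hd5 : Disjoint (T0 ∪ T1 ∪ T2A ∪ T2B ∪ T3A) T3B := disj 31 32 hb4 hκ3B (by norm_num)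
  have hd6 : Disjoint (T0 ∪ T1 ∪ T2A ∪ T2B ∪ T3A ∪ T3B) T3C := disj 32 33 hb5 hκ3C (by norm_num)
  -- every member `t` of the families consists of representatives and has `|t| ≤ 3`
  have hfam : ∀ t ∈ T0 ∪ T1 ∪ T2A ∪ T2B ∪ T3A ∪ T3B ∪ T3C, (∀ x ∈ t, x ∈ repSet m) ∧ Multiset.card t ≤ 3 := by
    intro t ht
    simp only [Finset.mem_union] at ht
    rcases ht with (((((ht | ht) | ht) | ht) | ht) | ht) | ht
    · rw [hT0, Finset.mem_singleton] at ht
      subst ht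
      exact ⟨fun x hx ↦ (Multiset.notMem_zero x hx).elim, by simp⟩
    · obtain ⟨a, ha, rfl⟩ := Finset.mem_image.1 ht
      exact ⟨memA ha, by simp⟩
    · obtain ⟨a, ha, rfl⟩ := Finset.mem_image.1 ht
      exact ⟨memAA ha, by simp⟩
    · obtain ⟨T, hT, rfl⟩ := Finset.mem_image.1 ht
      exact ⟨memT hT, by rw [Finset.card_val, (Finset.mem_powersetCard.1 hT).2]; norm_num⟩
    · obtain ⟨a, ha, rfl⟩ := Finset.mem_image.1 ht
      exact ⟨memAAA ha, by simp⟩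
    · obtain ⟨p, hp, rfl⟩ := Finset.mem_image.1 ht
      exact ⟨memAAB hp, by simp⟩
    · obtain ⟨T, hT, rfl⟩ := Finset.mem_image.1 ht
      exact ⟨memT hT, by rw [Finset.card_val, (Finset.mem_powersetCard.1 hT).2]⟩
  -- the `R`-part of a paired Hodge sextuple lies in one of the families
  have hmaps : (P : Set (Fin 6 → ZMod m)).MapsTo (fun α ↦ (univ.val.map α).filter (· ∈ repSet m))
      ↑(T0 ∪ T1 ∪ T2A ∪ T2B ∪ T3A ∪ T3B ∪ T3C) := by
    intro α hα
    rw [Finset.mem_coe, hP, Finset.mem_filter] at hα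
    show (univ.val.map α).filter (· ∈ repSet m) ∈
      ((T0 ∪ T1 ∪ T2A ∪ T2B ∪ T3A ∪ T3B ∪ T3C : Finset (Multiset (ZMod m))) : Set (Multiset (ZMod m)))
    rw [Finset.mem_coe]
    obtain ⟨j, hj, -⟩ := map_eq_symmOf_add_of_isPaired hm hα.2.1 hα.2.2
    set t := (univ.val.map α).filter (· ∈ repSet m) with htdef
    have ht : ∀ x ∈ t, x ∈ repSet m := fun x hx ↦ (Multiset.mem_filter.1 hx).2
    simp only [Finset.mem_union]
    have hcases : Multiset.card t = 0 ∨ Multiset.card t = 1 ∨ Multiset.card t = 2 ∨ Multiset.card t = 3 := by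
      omega
    rcases hcases with hc | hc | hc | hc
    · refine Or.inl (Or.inl (Or.inl (Or.inl (Or.inl (Or.inl ?_)))))
      rw [hT0, Finset.mem_singleton]
      exact Multiset.card_eq_zero.1 hc
    · obtain ⟨a, ha⟩ := Multiset.card_eq_one.1 hc
      refine Or.inl (Or.inl (Or.inl (Or.inl (Or.inl (Or.inr ?_)))))
      rw [ha]
      exact Finset.mem_image.2 ⟨a, ht a (by rw [ha]; simp), rfl⟩
    · obtain ⟨a, b, hab⟩ := Multiset.card_eq_two.1 hc
      by_cases he : a = b
      · subst he
        refine Or.inl (Or.inl (Or.inl (Or.inl (Or.inr ?_))))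
        rw [hab]
        exact Finset.mem_image.2 ⟨a, ht a (by rw [hab]; simp), rfl⟩
      · refine Or.inl (Or.inl (Or.inl (Or.inr ?_)))
        rw [hab]
        refine Finset.mem_image.2 ⟨{a, b}, ?_, pair_val he⟩
        rw [Finset.mem_powersetCard]
        refine ⟨fun x hx ↦ ?_, Finset.card_pair he⟩
        simp only [Finset.mem_insert, Finset.mem_singleton] at hx
        rcases hx with rfl | rfl
        · exact ht _ (by rw [hab]; simp)
        · exact ht _ (by rw [hab]; simp)
    · rcases shape_three hc with ⟨a, ha⟩ | ⟨a, b, hab, he⟩ | hnd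
      · refine Or.inl (Or.inl (Or.inr ?_))
        rw [ha]
        exact Finset.mem_image.2 ⟨a, ht a (by rw [ha]; simp), rfl⟩
      · refine Or.inl (Or.inr ?_)
        rw [he]
        refine Finset.mem_image.2 ⟨(a, b), ?_, rfl⟩
        exact Finset.mem_offDiag.2 ⟨ht a (by rw [he]; simp), ht b (by rw [he]; simp), hab⟩
      · refine Or.inr (Finset.mem_image.2 ⟨t.toFinset, ?_, ?_⟩)
        · rw [Finset.mem_powersetCard]
          refine ⟨fun x hx ↦ ht x (Multiset.mem_toFinset.1 hx), ?_⟩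
          rw [Multiset.toFinset_card_of_nodup hnd, hc]
        · rw [Multiset.toFinset_val, Multiset.dedup_eq_self.2 hnd]
  rw [Finset.card_eq_sum_card_fiberwise hmaps]
  -- the fibre over `t` is the set of ALL orderings of `t + (−t) + (6 − 2|t|)·{η}`
  have hfib : ∀ t ∈ T0 ∪ T1 ∪ T2A ∪ T2B ∪ T3A ∪ T3B ∪ T3C,
      (P.filter fun α ↦ (univ.val.map α).filter (· ∈ repSet m) = t).card =
      (univ.filter fun α : Fin 6 → ZMod m ↦
        univ.val.map α = symmOf t + Multiset.replicate (6 - 2 * Multiset.card t) (eta m)).card := by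
    intro t ht𝒯
    obtain ⟨ht, hct⟩ := hfam t ht𝒯
    rw [hP, Finset.filter_filter]
    congr 1
    refine Finset.filter_congr fun α _ ↦ ⟨fun ⟨⟨hH, hp⟩, hφ⟩ ↦ ?_, fun h ↦ ?_⟩
    · obtain ⟨j, hj, he⟩ := map_eq_symmOf_add_of_isPaired hm hH hp
      rw [hφ] at hj he
      rw [he]
      congr 2
      omega
    · have hj : Multiset.card t + (3 - Multiset.card t) = 3 := by omega
      have h' : univ.val.map α = symmOf t + Multiset.replicate (2 * (3 - Multiset.card t)) (eta m) := by
        rw [h]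
        congr 2
        omega
      exact ⟨isHodge_and_isPaired_of_map_eq_symmOf_add hm ht hj h', by rw [h, filter_symmOf_add_replicate hm ht]⟩
  rw [Finset.sum_congr rfl hfib]
  -- injectivity of the parametrisations
  have hinj1 : Set.InjOn (fun a : ZMod m ↦ ({a} : Multiset (ZMod m))) ↑(repSet m) :=
    fun a _ a' _ h ↦ Multiset.singleton_inj.1 h
  have hinj2A : Set.InjOn (fun a : ZMod m ↦ ({a, a} : Multiset (ZMod m))) ↑(repSet m) := by
    intro a _ a' _ h
    have h' : ({a, a} : Multiset (ZMod m)) = {a', a'} := h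
    have : a ∈ ({a', a'} : Multiset (ZMod m)) := by rw [← h']; simp
    simpa using this
  have hinj2B : Set.InjOn (fun T : Finset (ZMod m) ↦ T.val) ↑((repSet m).powersetCard 2) :=
    fun T _ T' _ h ↦ Finset.val_injective h
  have hinj3A : Set.InjOn (fun a : ZMod m ↦ ({a, a, a} : Multiset (ZMod m))) ↑(repSet m) := by
    intro a _ a' _ h
    have h' : ({a, a, a} : Multiset (ZMod m)) = {a', a', a'} := h
    have : a ∈ ({a', a', a'} : Multiset (ZMod m)) := by rw [← h']; simp
    simpa using this
  have hinj3B : Set.InjOn (fun p : ZMod m × ZMod m ↦ ({p.1, p.1, p.2} : Multiset (ZMod m)))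
      ↑(repSet m).offDiag := by
    rintro ⟨a, b⟩ hp ⟨a', b'⟩ hp' e
    obtain ⟨-, -, hab⟩ := Finset.mem_offDiag.1 hp
    obtain ⟨-, -, hab'⟩ := Finset.mem_offDiag.1 hp'
    simp only [ne_eq] at hab hab'
    have e' : ({a, a, b} : Multiset (ZMod m)) = {a', a', b'} := e
    have hc := congrArg (Multiset.count a) e'
    have haa' : a = a' := by
      by_contra hne
      by_cases hab2 : a = b'
      · subst hab2
        simp [hab, Ne.symm hab'] at hc
      · simp [hab, hne, hab2] at hc
    subst haa'
    simp only [Multiset.insert_eq_cons, Multiset.cons_inj_right, Multiset.singleton_inj] at e'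
    rw [e']
  have hinj3C : Set.InjOn (fun T : Finset (ZMod m) ↦ T.val) ↑((repSet m).powersetCard 3) :=
    fun T _ T' _ h ↦ Finset.val_injective h
  -- the seven partial sums
  have hs0 : ∑ t ∈ T0, (univ.filter fun α : Fin 6 → ZMod m ↦
      univ.val.map α = symmOf t + Multiset.replicate (6 - 2 * Multiset.card t) (eta m)).card = 1 := by
    rw [hT0, Finset.sum_singleton, Multiset.card_zero, Nat.mul_zero, Nat.sub_zero]
    exact card_filter_shape_empty
  have hs1 : ∑ a ∈ repSet m, (univ.filter fun α : Fin 6 → ZMod m ↦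
      univ.val.map α = symmOf {a} + Multiset.replicate (6 - 2 * Multiset.card ({a} : Multiset (ZMod m))) (eta m)).card
      = 30 * (repSet m).card := by
    have hf : ∀ a ∈ repSet m, (univ.filter fun α : Fin 6 → ZMod m ↦ univ.val.map α =
        symmOf {a} + Multiset.replicate (6 - 2 * Multiset.card ({a} : Multiset (ZMod m))) (eta m)).card = 30 := by
      intro a ha
      rw [Multiset.card_singleton]
      exact card_filter_shape_A hm ha
    rw [Finset.sum_congr rfl hf, Finset.sum_const, smul_eq_mul]
    exact mul_comm _ _
  have hs2A : ∑ a ∈ repSet m, (univ.filter fun α : Fin 6 → ZMod m ↦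
      univ.val.map α = symmOf {a, a} + Multiset.replicate (6 - 2 * Multiset.card ({a, a} : Multiset (ZMod m))) (eta m)).card
      = 90 * (repSet m).card := by
    have hf : ∀ a ∈ repSet m, (univ.filter fun α : Fin 6 → ZMod m ↦ univ.val.map α =
        symmOf {a, a} + Multiset.replicate (6 - 2 * Multiset.card ({a, a} : Multiset (ZMod m))) (eta m)).card = 90 := by
      intro a ha
      rw [Multiset.card_pair]
      exact card_filter_shape_AA hm ha
    rw [Finset.sum_congr rfl hf, Finset.sum_const, smul_eq_mul]
    exact mul_comm _ _
  have hf2B : ∀ T ∈ (repSet m).powersetCard 2, (univ.filter fun α : Fin 6 → ZMod m ↦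
      univ.val.map α = symmOf T.val + Multiset.replicate (6 - 2 * Multiset.card T.val) (eta m)).card = 360 := by
    intro T hT
    obtain ⟨hTR, hTc⟩ := Finset.mem_powersetCard.1 hT
    obtain ⟨a, b, hab, rfl⟩ := Finset.card_eq_two.1 hTc
    have ha : a ∈ repSet m := hTR (by simp)
    have hb : b ∈ repSet m := hTR (by simp)
    rw [pair_val hab, Multiset.card_pair]
    exact card_filter_shape_AB hm ha hb hab
  have hs2B : ∑ T ∈ (repSet m).powersetCard 2, (univ.filter fun α : Fin 6 → ZMod m ↦
      univ.val.map α = symmOf T.val + Multiset.replicate (6 - 2 * Multiset.card T.val) (eta m)).card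
      = 360 * ((repSet m).powersetCard 2).card := by
    rw [Finset.sum_congr rfl hf2B, Finset.sum_const, smul_eq_mul]
    exact mul_comm _ _
  have hf3A : ∀ a ∈ repSet m, (univ.filter fun α : Fin 6 → ZMod m ↦
      univ.val.map α = symmOf {a, a, a} +
        Multiset.replicate (6 - 2 * Multiset.card ({a, a, a} : Multiset (ZMod m))) (eta m)).card = 20 := by
    intro a ha
    have hc : 6 - 2 * Multiset.card ({a, a, a} : Multiset (ZMod m)) = 0 := by simp
    rw [hc, Multiset.replicate_zero, add_zero]
    exact card_filter_symmOf_AAA ha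
  have hs3A : ∑ a ∈ repSet m, (univ.filter fun α : Fin 6 → ZMod m ↦
      univ.val.map α = symmOf {a, a, a} +
        Multiset.replicate (6 - 2 * Multiset.card ({a, a, a} : Multiset (ZMod m))) (eta m)).card
      = 20 * (repSet m).card := by
    rw [Finset.sum_congr rfl hf3A, Finset.sum_const, smul_eq_mul]
    exact mul_comm _ _
  have hf3B : ∀ p ∈ (repSet m).offDiag, (univ.filter fun α : Fin 6 → ZMod m ↦
      univ.val.map α = symmOf {p.1, p.1, p.2} +
        Multiset.replicate (6 - 2 * Multiset.card ({p.1, p.1, p.2} : Multiset (ZMod m))) (eta m)).card = 180 := by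
    intro p hp
    obtain ⟨h1, h2, h12⟩ := Finset.mem_offDiag.1 hp
    have hc : 6 - 2 * Multiset.card ({p.1, p.1, p.2} : Multiset (ZMod m)) = 0 := by simp
    rw [hc, Multiset.replicate_zero, add_zero]
    exact card_filter_symmOf_AAB h1 h2 h12
  have hs3B : ∑ p ∈ (repSet m).offDiag, (univ.filter fun α : Fin 6 → ZMod m ↦
      univ.val.map α = symmOf {p.1, p.1, p.2} +
        Multiset.replicate (6 - 2 * Multiset.card ({p.1, p.1, p.2} : Multiset (ZMod m))) (eta m)).card
      = 180 * (repSet m).offDiag.card := by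
    rw [Finset.sum_congr rfl hf3B, Finset.sum_const, smul_eq_mul]
    exact mul_comm _ _
  have hf3C : ∀ T ∈ (repSet m).powersetCard 3, (univ.filter fun α : Fin 6 → ZMod m ↦
      univ.val.map α = symmOf T.val + Multiset.replicate (6 - 2 * Multiset.card T.val) (eta m)).card = 720 := by
    intro T hT
    obtain ⟨h1, h2⟩ := Finset.mem_powersetCard.1 hT
    have hc : 6 - 2 * Multiset.card T.val = 0 := by
      have := Finset.card_val T
      omega
    rw [hc, Multiset.replicate_zero, add_zero]
    exact card_filter_symmOf_ABC h1 h2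
  have hs3C : ∑ T ∈ (repSet m).powersetCard 3, (univ.filter fun α : Fin 6 → ZMod m ↦
      univ.val.map α = symmOf T.val + Multiset.replicate (6 - 2 * Multiset.card T.val) (eta m)).card
      = 720 * ((repSet m).powersetCard 3).card := by
    rw [Finset.sum_congr rfl hf3C, Finset.sum_const, smul_eq_mul]
    exact mul_comm _ _
  rw [Finset.sum_union hd6, Finset.sum_union hd5, Finset.sum_union hd4, Finset.sum_union hd3, Finset.sum_union hd2,
    Finset.sum_union hd1, hs0, hT1, Finset.sum_image hinj1, hs1, hT2A, Finset.sum_image hinj2A, hs2A, hT2B,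
    Finset.sum_image hinj2B, hs2B, hT3A, Finset.sum_image hinj3A, hs3A, hT3B, Finset.sum_image hinj3B, hs3B,
    hT3C, Finset.sum_image hinj3C, hs3C, Finset.offDiag_card, Finset.card_powersetCard, Finset.card_powersetCard,
    card_repSet_even hm, Nat.mul_sub_one]

open scoped Classical in
/-- The even-level count as a polynomial in `m − 1`: `15(m−1)³ − 45(m−1)² + 55(m−1) − 24`.
[cite: DegtyarevShimada2016, Remark 4.4] -/
theorem card_isHodge_isPaired_six_even_eq_poly (hm : 2 ∣ m) :
    ((univ.filter fun α : Fin 6 → ZMod m ↦ IsHodge α ∧ IsPaired α).card : ℤ) =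
      15 * ((m : ℤ) - 1) ^ 3 - 45 * ((m : ℤ) - 1) ^ 2 + 55 * ((m : ℤ) - 1) - 24 := by
  rw [card_isHodge_isPaired_six_even hm]
  obtain ⟨h, hh⟩ : ∃ h, m = 2 * h + 2 := ⟨(m - 2) / 2, by have := two_le_of_two_dvd hm; omega⟩
  have hdiv : (m - 2) / 2 = h := by omega
  rw [hdiv]
  have hc3 : (h.choose 3 : ℤ) * 6 = h * (h - 1) * (h - 2) := by
    have h3 := Nat.descFactorial_eq_factorial_mul_choose h 3
    rw [show Nat.factorial 3 = 6 by rfl] at h3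
    rcases Nat.lt_or_ge h 3 with hlt | hge
    · rw [Nat.choose_eq_zero_of_lt hlt]
      interval_cases h <;> norm_num
    · have e : (h.descFactorial 3 : ℤ) = h * (h - 1) * (h - 2) := by
        simp only [Nat.descFactorial_succ, Nat.descFactorial_zero, mul_one, Nat.sub_zero]
        push_cast [Nat.cast_sub (by omega : 1 ≤ h), Nat.cast_sub (by omega : 2 ≤ h)]
        ring
      rw [← e, h3]
      push_cast
      ring
  have hc2 : (h.choose 2 : ℤ) * 2 = h * (h - 1) := by
    have h2 := Nat.descFactorial_eq_factorial_mul_choose h 2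
    rw [show Nat.factorial 2 = 2 by rfl] at h2
    rcases Nat.lt_or_ge h 2 with hlt | hge
    · rw [Nat.choose_eq_zero_of_lt hlt]
      interval_cases h <;> norm_num
    · have e : (h.descFactorial 2 : ℤ) = h * (h - 1) := by
        simp only [Nat.descFactorial_succ, Nat.descFactorial_zero, mul_one, Nat.sub_zero]
        push_cast [Nat.cast_sub (by omega : 1 ≤ h)]
        ring
      rw [← e, h2]
      push_cast
      ring
  rcases Nat.eq_zero_or_pos h with h0 | hpos
  · subst h0
    simp [hh]
  · push_cast [Nat.cast_sub hpos, hh]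
    linear_combination 180 * hc2 + 120 * hc3

open scoped Classical in
/-- **Degtyarev–Shimada 2016, Remark 4.4, `n = 4`, at every level `m`**: the number of characters
`(a₀, …, a₅)`, `aᵢ ∈ ℤ/m ∖ {0}`, admitting a matching into pairs `{a, −a}` — the set `Γ_𝒥` of [DS16, Def. 1.3]
for `n = 4`, whose cardinality plus one is the rank of the lattice `𝓛(X⁴ₘ)` spanned by the classes of the
`15m³` standard planes of the Fermat fourfold (Thm. 1.4) — is
`15m³ − 90m² + 175m − 100 + (15m − 39)·δₘ` with `δₘ = 1` for even `m` and `δₘ = 0` for odd `m` (as printed: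
"`δₘ ∈ {0, 1}` satisfies `δₘ ≡ m − 1 mod 2`"). Reading note: Remark 4.4 displays this polynomial (and its
analogues for `n = 2, 6`) under the heading "`rank 𝓛(X) =`"; by Theorem 1.4 the rank is `|Γ_𝒥| + 1`, and the
displayed values are those of `|Γ_𝒥|` (e.g. `6` at `(n, m) = (2, 3)`, where the `27` lines span rank `7`; the
constant-term recipe of the same remark gives `7`) — the statement below is the `|Γ_𝒥|` reading, which is the one
consistent with Theorem 1.4 and with `m = 25`: `182400` [Shioda 1981, App.]. Assembled from the odd case
(`card_isHodge_isPaired_six_eq_poly`) and the even case (`card_isHodge_isPaired_six_even_eq_poly`).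
[cite: DegtyarevShimada2016, Theorem 1.4 and Remark 4.4] -/
theorem card_isHodge_isPaired_six_eq_degtyarevShimada :
    ((univ.filter fun α : Fin 6 → ZMod m ↦ IsHodge α ∧ IsPaired α).card : ℤ) =
      15 * (m : ℤ) ^ 3 - 90 * (m : ℤ) ^ 2 + 175 * m - 100 + (15 * m - 39) * (if 2 ∣ m then 1 else 0) := by
  by_cases hm : 2 ∣ m
  · rw [card_isHodge_isPaired_six_even_eq_poly hm, if_pos hm]
    ring
  · rw [card_isHodge_isPaired_six_eq_poly hm, if_neg hm]
    ring

open scoped Classical in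
/-- Instance `m = 26` (the even neighbour of Shioda's `m = 25`): `207601` paired Hodge sextuples
(`h = 12`: `1 + 360 + 1080 + 23760 + 240 + 23760 + 158400`). [cite: DegtyarevShimada2016, Remark 4.4] -/
theorem card_isHodge_isPaired_six_twentysix :
    (univ.filter fun α : Fin 6 → ZMod 26 ↦ IsHodge α ∧ IsPaired α).card = 207601 := by
  rw [card_isHodge_isPaired_six_even (m := 26) (by norm_num)]
  decide

end EvenLevel

/-! ## Octuples: the paired Hodge characters of the Fermat sixfold at odd level (Degtyarev–Shimada 2016, Remark 4.4, `n = 6`)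

The same method one length up. At odd level a paired Hodge octuple `α : Fin 8 → ℤ/m` has value multiset `t + (−t)` with
`t ⊆ R` of cardinality `4`; the five shapes `{a,b,c,d}`, `{a,a,b,c}`, `{a,a,b,b}`, `{a,a,a,b}`, `{a,a,a,a}` of `t` give value
multisets with `8! = 40320`, `8!/(2!2!) = 10080`, `8!/(2!)⁴ = 2520`, `8!/(3!3!) = 1120`, `8!/(4!4!) = 70` orderings and are
parametrised injectively by `C(R,4)`, `{(a, T) : a ∈ R, T ∈ C(R ∖ a, 2)}`, `C(R,2)`, `R.offDiag`, `R`. The numbers of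
orderings are obtained here not by kernel enumeration but from the orbit–stabiliser count
`#orderings(s) · ∏ₓ (countₓ s)! = n!` (`card_orderings_mul_prod_factorial`, via Mathlib's `DomMulAct.stabilizer_card'`),
transported to a small alphabet where the product is evaluated by `decide`. -/

section Octuples

/-! ### Orbit–stabiliser: the number of orderings of a multiset -/

/-- **Orderings of a multiset (orbit–stabiliser).** For `α₀ : Fin n → X`, the number of `α : Fin n → X` with the same
multiset of values, times `∏ₓ (countₓ)!` (the order of the stabiliser of `α₀` in `Perm (Fin n)`, Mathlib's
`DomMulAct.stabilizer_card'`), is `n!`: `Perm (Fin n)` acts transitively on these `α` by precomposition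
(`exists_perm_of_univ_val_map_eq`) and the fibres of `σ ↦ α₀ ∘ σ` are translates of the stabiliser. [folklore] -/
private theorem card_orderings_mul_prod_factorial {n : ℕ} {X : Type*} [Fintype X] [DecidableEq X] (α₀ : Fin n → X) :
    (univ.filter fun α : Fin n → X ↦ univ.val.map α = univ.val.map α₀).card *
      ∏ x ∈ (univ.val.map α₀).toFinset, ((univ.val.map α₀).count x).factorial = n.factorial := by
  classical
  -- multiplicities of the multiset of values are fibre cardinalities
  have hcount : ∀ x, (univ.val.map α₀).count x = (univ.filter fun i ↦ α₀ i = x).card := fun x ↦ by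
    rw [Multiset.count_map, ← Finset.filter_val, Finset.card_val]
    congr 1
    exact Finset.filter_congr fun i _ ↦ eq_comm
  -- the stabiliser of `α₀`
  have hstab : (univ.filter fun τ : Equiv.Perm (Fin n) ↦ α₀ ∘ ⇑τ = α₀).card =
      ∏ x ∈ (univ.val.map α₀).toFinset, ((univ.val.map α₀).count x).factorial := by
    have himg : (univ.val.map α₀).toFinset = univ.image α₀ := rfl
    rw [himg, ← Fintype.card_subtype, DomMulAct.stabilizer_card' α₀]
    refine Finset.prod_congr rfl fun x _ ↦ ?_
    rw [hcount, Fintype.card_subtype]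
  -- precomposition by a permutation preserves the multiset of values
  have hperm : ∀ σ : Equiv.Perm (Fin n), univ.val.map (α₀ ∘ ⇑σ) = univ.val.map α₀ := fun σ ↦ by
    rw [← Multiset.map_map, Multiset.map_univ_val_equiv]
  -- fibres of `σ ↦ α₀ ∘ σ` over the orderings are translates of the stabiliser
  set O := univ.filter fun α : Fin n → X ↦ univ.val.map α = univ.val.map α₀ with hO
  have hmaps : Set.MapsTo (fun σ : Equiv.Perm (Fin n) ↦ (α₀ ∘ ⇑σ : Fin n → X))
      ((univ : Finset (Equiv.Perm (Fin n))) : Set (Equiv.Perm (Fin n))) (O : Set (Fin n → X)) := by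
    intro σ _
    rw [Finset.mem_coe, hO, Finset.mem_filter]
    exact ⟨Finset.mem_univ _, hperm σ⟩
  have hsum := Finset.card_eq_sum_card_fiberwise hmaps
  have hfib : ∀ β ∈ O, (univ.filter fun σ : Equiv.Perm (Fin n) ↦ α₀ ∘ ⇑σ = β).card =
      (univ.filter fun τ : Equiv.Perm (Fin n) ↦ α₀ ∘ ⇑τ = α₀).card := by
    intro β hβ
    rw [hO, Finset.mem_filter] at hβ
    obtain ⟨σ₀, hσ₀⟩ := exists_perm_of_univ_val_map_eq hβ.2.symm
    refine Finset.card_bij' (fun σ _ ↦ σ₀.symm.trans σ) (fun τ _ ↦ σ₀.trans τ) (fun σ hσ ↦ ?_) (fun τ hτ ↦ ?_)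
      (fun σ _ ↦ Equiv.ext fun x ↦ by simp) (fun τ _ ↦ Equiv.ext fun x ↦ by simp)
    · rw [Finset.mem_filter] at hσ ⊢
      refine ⟨Finset.mem_univ _, funext fun x ↦ ?_⟩
      have h1 := congrFun hσ.2 (σ₀.symm x)
      have h2 := congrFun hσ₀ (σ₀.symm x)
      simp only [Function.comp_apply, Equiv.apply_symm_apply] at h1 h2
      simp only [Function.comp_apply, Equiv.trans_apply]
      rw [h1, h2]
    · rw [Finset.mem_filter] at hτ ⊢
      refine ⟨Finset.mem_univ _, funext fun x ↦ ?_⟩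
      have h1 := congrFun hτ.2 (σ₀ x)
      have h2 := congrFun hσ₀ x
      simp only [Function.comp_apply] at h1 h2
      simp only [Function.comp_apply, Equiv.trans_apply]
      rw [h1, h2]
  rw [Finset.sum_congr rfl hfib, Finset.sum_const, smul_eq_mul, Finset.card_univ, Fintype.card_perm,
    Fintype.card_fin] at hsum
  rw [← hstab]
  exact hsum.symm

/-- **Orderings of a multiset on a small alphabet.** For an injection `e : Fin k ↪ X` and `u : Multiset (Fin k)` of
cardinality `n`: `#{α : Fin n → X | values = u.map e} · ∏_{y} (count_y u)! = n!` — the product is now a closed term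
that `decide` evaluates. [folklore] -/
private theorem card_orderings_map_emb_mul {n k : ℕ} {X : Type*} [Fintype X] [DecidableEq X] (e : Fin k ↪ X)
    (u : Multiset (Fin k)) (hu : Multiset.card u = n) :
    (univ.filter fun α : Fin n → X ↦ univ.val.map α = u.map e).card *
      ∏ y ∈ u.toFinset, (u.count y).factorial = n.factorial := by
  classical
  obtain ⟨r, α₀, h₀⟩ := exists_eq_univ_val_map (u.map e)
  have hr : r = n := by
    have := congrArg Multiset.card h₀
    simp only [Multiset.card_map, Finset.card_val, Finset.card_univ, Fintype.card_fin] at this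
    omega
  subst hr
  have key := card_orderings_mul_prod_factorial α₀
  rw [h₀, Multiset.toFinset_map, Finset.prod_image fun y _ y' _ h ↦ e.injective h] at key
  simpa only [Multiset.count_map_eq_count' e u e.injective] using key

/-! ### The shape of a four-element multiset -/

omit [NeZero m] in
/-- Small multiset identity (plumbing). [folklore] -/
private theorem ms_one_three (a b : ZMod m) :
    Multiset.replicate 1 a + ({b, b, b} : Multiset (ZMod m)) = {b, b, b, a} := by
  simp only [Multiset.replicate_one, Multiset.insert_eq_cons, ← Multiset.singleton_add]
  abel

omit [NeZero m] in
/-- Small multiset identity (plumbing). [folklore] -/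
private theorem ms_one_two_one (a b d : ZMod m) :
    Multiset.replicate 1 a + ({b, b, d} : Multiset (ZMod m)) = {b, b} + {a, d} := by
  simp only [Multiset.replicate_one, Multiset.insert_eq_cons, ← Multiset.singleton_add]
  abel

omit [NeZero m] in
/-- Small multiset identity (plumbing). [folklore] -/
private theorem ms_two_two (a b : ZMod m) :
    Multiset.replicate 2 a + ({b, b} : Multiset (ZMod m)) = {a, b} + {a, b} := by
  simp only [show Multiset.replicate 2 a = {a, a} from rfl, Multiset.insert_eq_cons, ← Multiset.singleton_add]
  abel

omit [NeZero m] in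
/-- **The shape of a `4`-element multiset**: `{a,a,a,a}`, `{a,a,a,b}`, `{a,b}+{a,b}`, `{a,a}+{b,c}` (distinct letters
distinct) or duplicate-free. [folklore] -/
private theorem shape_four {t : Multiset (ZMod m)} (ht : Multiset.card t = 4) :
    (∃ a, t = {a, a, a, a}) ∨ (∃ a b, a ≠ b ∧ t = {a, a, a, b}) ∨ (∃ a b, a ≠ b ∧ t = {a, b} + {a, b}) ∨
      (∃ a b c, a ≠ b ∧ a ≠ c ∧ b ≠ c ∧ t = {a, a} + {b, c}) ∨ t.Nodup := by
  classical
  have hne : t ≠ 0 := by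
    rintro rfl
    simp at ht
  obtain ⟨a, ha⟩ := Multiset.exists_mem_of_ne_zero hne
  set u := t.filter (fun x ↦ ¬ x = a) with hu
  have hau : a ∉ u := by simp [hu]
  have hmem_u : ∀ x ∈ u, x ≠ a := fun x hx ↦ (Multiset.mem_filter.1 hx).2
  have htu : t = Multiset.replicate (t.count a) a + u := by
    rw [← Multiset.filter_eq' t a, hu]
    exact (Multiset.filter_add_not (· = a) t).symm
  have hc1 : 1 ≤ t.count a := Multiset.one_le_count_iff_mem.2 ha
  have hcu : t.count a + Multiset.card u = 4 := by
    have := congrArg Multiset.card htu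
    rw [Multiset.card_add, Multiset.card_replicate] at this
    omega
  have hcases : t.count a = 1 ∨ t.count a = 2 ∨ t.count a = 3 ∨ t.count a = 4 := by omega
  rcases hcases with hc | hc | hc | hc
  · -- one `a`: `u` has three elements, none equal to `a`
    rw [hc] at htu
    rcases shape_three (t := u) (by omega) with ⟨b, hb⟩ | ⟨b, d, hbd, hb⟩ | hnd
    · have hba : b ≠ a := hmem_u b (by rw [hb]; simp)
      refine Or.inr (Or.inl ⟨b, a, hba, ?_⟩)
      rw [htu, hb, ms_one_three]
    · have hba : b ≠ a := hmem_u b (by rw [hb]; simp)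
      have hda : d ≠ a := hmem_u d (by rw [hb]; simp)
      refine Or.inr (Or.inr (Or.inr (Or.inl ⟨b, a, d, hba, hbd, hda.symm, ?_⟩)))
      rw [htu, hb, ms_one_two_one]
    · refine Or.inr (Or.inr (Or.inr (Or.inr ?_)))
      rw [htu, Multiset.replicate_one, Multiset.singleton_add, Multiset.nodup_cons]
      exact ⟨hau, hnd⟩
  · -- two `a`'s: `u = {b, d}`
    rw [hc] at htu
    obtain ⟨b, d, hbd'⟩ := Multiset.card_eq_two.1 (show Multiset.card u = 2 by omega)
    have hba : b ≠ a := hmem_u b (by rw [hbd']; simp)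
    have hda : d ≠ a := hmem_u d (by rw [hbd']; simp)
    by_cases hbd : b = d
    · refine Or.inr (Or.inr (Or.inl ⟨a, b, hba.symm, ?_⟩))
      rw [htu, hbd', ← hbd, ms_two_two]
    · refine Or.inr (Or.inr (Or.inr (Or.inl ⟨a, b, d, hba.symm, hda.symm, hbd, ?_⟩)))
      rw [htu, hbd']
      rfl
  · -- three `a`'s: `u = {b}`
    rw [hc] at htu
    obtain ⟨b, hb⟩ := Multiset.card_eq_one.1 (show Multiset.card u = 1 by omega)
    have hba : b ≠ a := hmem_u b (by rw [hb]; simp)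
    refine Or.inr (Or.inl ⟨a, b, hba.symm, ?_⟩)
    rw [htu, hb]
    rfl
  · -- four `a`'s
    rw [hc] at htu
    have hu0 : u = 0 := Multiset.card_eq_zero.1 (by omega)
    refine Or.inl ⟨a, ?_⟩
    rw [htu, hu0, add_zero]
    rfl

/-! ### Classification at odd level (octuples) -/

/-- **Classification (odd level, octuples).** The multiset of values of a paired Hodge octuple is `t + (-t)` with `t`
its four representatives. [folklore] -/
private theorem map_eq_symmOf_of_isPaired_eight (hm : ¬ 2 ∣ m) {α : Fin 8 → ZMod m} (hα : IsHodge α)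
    (hp : IsPaired α) :
    ∃ t : Multiset (ZMod m), (∀ x ∈ t, x ∈ repSet m) ∧ Multiset.card t = 4 ∧ univ.val.map α = symmOf t := by
  classical
  set s := univ.val.map α with hs
  have h0 : (0 : ZMod m) ∉ s := by
    intro h
    obtain ⟨i, -, hi⟩ := Multiset.mem_map.1 h
    exact hα.1.1 i hi
  have hsym := count_eq_count_neg_of_isPaired' hp
  have he := eq_symmOf_filter hm h0 hsym
  refine ⟨s.filter (· ∈ repSet m), fun x hx ↦ (Multiset.mem_filter.1 hx).2, ?_, he⟩
  have hc : Multiset.card s = 8 := by simp [hs]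
  have := congrArg Multiset.card he
  rw [card_symmOf, hc] at this
  omega

/-! ### Orderings of the five shapes -/

/-- Pairwise distinctness of `a, -a, b, -b` for distinct representatives `a, b` (plumbing). [folklore] -/
private theorem distinct_four {a b : ZMod m} (ha : a ∈ repSet m) (hb : b ∈ repSet m) (hab : a ≠ b) :
    a ≠ -a ∧ b ≠ -b ∧ a ≠ -b ∧ b ≠ -a ∧ -a ≠ -b :=
  ⟨ne_neg_of_mem_repSet ha, ne_neg_of_mem_repSet hb, fun h ↦ neg_not_mem_repSet hb (h ▸ ha),
    fun h ↦ neg_not_mem_repSet ha (h ▸ hb), fun h ↦ hab (neg_injective h)⟩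

/-- Shape `{a,a,a,a,−a,−a,−a,−a}`: `8!/(4!4!) = 70` orderings. [folklore] -/
private theorem card_filter_symmOf_A4 {a : ZMod m} (ha : a ∈ repSet m) :
    (univ.filter fun α : Fin 8 → ZMod m ↦ univ.val.map α = symmOf {a, a, a, a}).card = 70 := by
  classical
  have hne : a ≠ -a := ne_neg_of_mem_repSet ha
  have hinj : Function.Injective ![a, -a] := by
    intro i j h
    fin_cases i <;> fin_cases j <;> simp [hne, hne.symm] at h ⊢
  have he : symmOf {a, a, a, a} =
      ({0, 0, 0, 0, 1, 1, 1, 1} : Multiset (Fin 2)).map (⟨![a, -a], hinj⟩ : Fin 2 ↪ ZMod m) := rfl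
  have key := card_orderings_map_emb_mul (n := 8) (⟨![a, -a], hinj⟩ : Fin 2 ↪ ZMod m)
    ({0, 0, 0, 0, 1, 1, 1, 1} : Multiset (Fin 2)) rfl
  have hprod : ∏ y ∈ ({0, 0, 0, 0, 1, 1, 1, 1} : Multiset (Fin 2)).toFinset,
      (Multiset.count y ({0, 0, 0, 0, 1, 1, 1, 1} : Multiset (Fin 2))).factorial = 576 := by decide
  rw [← he, hprod, show Nat.factorial 8 = 40320 by rfl] at key
  omega

/-- Shape `{a,a,a,b,−a,−a,−a,−b}`, `a ≠ b` representatives: `8!/(3!3!) = 1120` orderings. [folklore] -/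
private theorem card_filter_symmOf_A3B {a b : ZMod m} (ha : a ∈ repSet m) (hb : b ∈ repSet m) (hab : a ≠ b) :
    (univ.filter fun α : Fin 8 → ZMod m ↦ univ.val.map α = symmOf {a, a, a, b}).card = 1120 := by
  classical
  obtain ⟨h1, h2, h3, h4, h5⟩ := distinct_four ha hb hab
  have hinj : Function.Injective ![a, b, -a, -b] := by
    intro i j h
    fin_cases i <;> fin_cases j <;>
      simp [hab, hab.symm, h1, h1.symm, h2, h2.symm, h3, h3.symm, h4, h4.symm, h5, h5.symm] at h ⊢
  have he : symmOf {a, a, a, b} =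
      ({0, 0, 0, 1, 2, 2, 2, 3} : Multiset (Fin 4)).map (⟨![a, b, -a, -b], hinj⟩ : Fin 4 ↪ ZMod m) := rfl
  have key := card_orderings_map_emb_mul (n := 8) (⟨![a, b, -a, -b], hinj⟩ : Fin 4 ↪ ZMod m)
    ({0, 0, 0, 1, 2, 2, 2, 3} : Multiset (Fin 4)) rfl
  have hprod : ∏ y ∈ ({0, 0, 0, 1, 2, 2, 2, 3} : Multiset (Fin 4)).toFinset,
      (Multiset.count y ({0, 0, 0, 1, 2, 2, 2, 3} : Multiset (Fin 4))).factorial = 36 := by decide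
  rw [← he, hprod, show Nat.factorial 8 = 40320 by rfl] at key
  omega

/-- Shape `{a,b,a,b,−a,−b,−a,−b}`, `a ≠ b` representatives: `8!/(2!)⁴ = 2520` orderings. [folklore] -/
private theorem card_filter_symmOf_A2B2 {a b : ZMod m} (ha : a ∈ repSet m) (hb : b ∈ repSet m) (hab : a ≠ b) :
    (univ.filter fun α : Fin 8 → ZMod m ↦ univ.val.map α = symmOf ({a, b} + {a, b})).card = 2520 := by
  classical
  obtain ⟨h1, h2, h3, h4, h5⟩ := distinct_four ha hb hab
  have hinj : Function.Injective ![a, b, -a, -b] := by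
    intro i j h
    fin_cases i <;> fin_cases j <;>
      simp [hab, hab.symm, h1, h1.symm, h2, h2.symm, h3, h3.symm, h4, h4.symm, h5, h5.symm] at h ⊢
  have he : symmOf ({a, b} + {a, b}) =
      ({0, 1, 0, 1, 2, 3, 2, 3} : Multiset (Fin 4)).map (⟨![a, b, -a, -b], hinj⟩ : Fin 4 ↪ ZMod m) := rfl
  have key := card_orderings_map_emb_mul (n := 8) (⟨![a, b, -a, -b], hinj⟩ : Fin 4 ↪ ZMod m)
    ({0, 1, 0, 1, 2, 3, 2, 3} : Multiset (Fin 4)) rfl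
  have hprod : ∏ y ∈ ({0, 1, 0, 1, 2, 3, 2, 3} : Multiset (Fin 4)).toFinset,
      (Multiset.count y ({0, 1, 0, 1, 2, 3, 2, 3} : Multiset (Fin 4))).factorial = 16 := by decide
  rw [← he, hprod, show Nat.factorial 8 = 40320 by rfl] at key
  omega

/-- Shape `{a,a,b,c,−a,−a,−b,−c}`, `a, b, c` distinct representatives: `8!/(2!2!) = 10080` orderings. [folklore] -/
private theorem card_filter_symmOf_A2BC {a b c : ZMod m} (ha : a ∈ repSet m) (hb : b ∈ repSet m)
    (hc : c ∈ repSet m) (hab : a ≠ b) (hac : a ≠ c) (hbc : b ≠ c) :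
    (univ.filter fun α : Fin 8 → ZMod m ↦ univ.val.map α = symmOf ({a, a} + {b, c})).card = 10080 := by
  classical
  obtain ⟨h1, h2, h3, h4, h5⟩ := distinct_four ha hb hab
  obtain ⟨-, h6, h7, h8, h9⟩ := distinct_four ha hc hac
  obtain ⟨-, -, h10, h11, h12⟩ := distinct_four hb hc hbc
  have hinj : Function.Injective ![a, b, c, -a, -b, -c] := by
    intro i j h
    fin_cases i <;> fin_cases j <;>
      simp [hab, hab.symm, hac, hac.symm, hbc, hbc.symm, h1, h1.symm, h2, h2.symm, h3, h3.symm, h4, h4.symm,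
        h5, h5.symm, h6, h6.symm, h7, h7.symm, h8, h8.symm, h9, h9.symm, h10, h10.symm, h11, h11.symm,
        h12, h12.symm] at h ⊢
  have he : symmOf ({a, a} + {b, c}) =
      ({0, 0, 1, 2, 3, 3, 4, 5} : Multiset (Fin 6)).map (⟨![a, b, c, -a, -b, -c], hinj⟩ : Fin 6 ↪ ZMod m) := rfl
  have key := card_orderings_map_emb_mul (n := 8) (⟨![a, b, c, -a, -b, -c], hinj⟩ : Fin 6 ↪ ZMod m)
    ({0, 0, 1, 2, 3, 3, 4, 5} : Multiset (Fin 6)) rfl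
  have hprod : ∏ y ∈ ({0, 0, 1, 2, 3, 3, 4, 5} : Multiset (Fin 6)).toFinset,
      (Multiset.count y ({0, 0, 1, 2, 3, 3, 4, 5} : Multiset (Fin 6))).factorial = 4 := by decide
  rw [← he, hprod, show Nat.factorial 8 = 40320 by rfl] at key
  omega

/-- Shape `T + (−T)`, `T` four distinct representatives: `8! = 40320` orderings. [folklore] -/
private theorem card_filter_symmOf_ABCD {T : Finset (ZMod m)} (hT : T ⊆ repSet m) (hc : T.card = 4) :
    (univ.filter fun α : Fin 8 → ZMod m ↦ univ.val.map α = symmOf T.val).card = 40320 := by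
  classical
  have hnd : (symmOf T.val).Nodup := by
    rw [symmOf]
    refine (Multiset.Nodup.add_iff T.nodup (T.nodup.map neg_injective)).2 ?_
    rw [Multiset.disjoint_left]
    intro x hx hx'
    obtain ⟨y, hy, rfl⟩ := Multiset.mem_map.1 hx'
    exact neg_not_mem_repSet (hT (show y ∈ T from hy)) (hT (show -y ∈ T from hx))
  have hcard : Multiset.card (symmOf T.val) = 8 := by
    rw [card_symmOf, Finset.card_val, hc]
  rw [card_filter_map_eq_factorial _ hnd hcard]
  rfl

/-! ### An invariant separating the five shapes -/

/-- `λ(t) = Σ_{x ∈ t} count_x(t)` (with multiplicity; plumbing: `16, 10, 8, 6, 4` on the five shapes). [folklore] -/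
private def lam (t : Multiset (ZMod m)) : ℕ := (t.map fun x ↦ t.count x).sum

omit [NeZero m] in
/-- `λ{a,a,a,a} = 16`. [folklore] -/
private theorem lam_A4 (a : ZMod m) : lam ({a, a, a, a} : Multiset (ZMod m)) = 16 := by
  simp [lam]

omit [NeZero m] in
/-- `λ{a,a,a,b} = 10`. [folklore] -/
private theorem lam_A3B {a b : ZMod m} (hab : a ≠ b) : lam ({a, a, a, b} : Multiset (ZMod m)) = 10 := by
  simp [lam, Multiset.count_cons, Multiset.count_singleton, hab, hab.symm]

omit [NeZero m] in
/-- `λ({a,b}+{a,b}) = 8`. [folklore] -/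
private theorem lam_A2B2 {a b : ZMod m} (hab : a ≠ b) : lam (({a, b} + {a, b} : Multiset (ZMod m))) = 8 := by
  have e : ({a, b} + {a, b} : Multiset (ZMod m)) = {a, b, a, b} := rfl
  rw [e]
  simp [lam, Multiset.count_cons, Multiset.count_singleton, hab, hab.symm]

omit [NeZero m] in
/-- `λ({a,a}+{b,c}) = 6`. [folklore] -/
private theorem lam_A2BC {a b c : ZMod m} (hab : a ≠ b) (hac : a ≠ c) (hbc : b ≠ c) :
    lam (({a, a} + {b, c} : Multiset (ZMod m))) = 6 := by
  have e : ({a, a} + {b, c} : Multiset (ZMod m)) = {a, a, b, c} := rfl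
  rw [e]
  simp [lam, Multiset.count_cons, Multiset.count_singleton, hab, hab.symm, hac, hac.symm, hbc, hbc.symm]

omit [NeZero m] in
/-- `λ = |t|` on duplicate-free `t`. [folklore] -/
private theorem lam_of_nodup {t : Multiset (ZMod m)} (h : t.Nodup) : lam t = Multiset.card t := by
  classical
  rw [lam]
  have : t.map (fun x ↦ t.count x) = t.map (fun _ ↦ 1) :=
    Multiset.map_congr rfl fun x hx ↦ Multiset.count_eq_one_of_mem h hx
  rw [this, Multiset.map_const', Multiset.sum_replicate, smul_eq_mul, mul_one]

/-! ### The count at odd level (octuples) -/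

open scoped Classical in
/-- **The number of paired Hodge octuples at odd level `m`** (characters `α ∈ 𝔅⁶ₘ` of the Fermat sixfold `X⁶ₘ` whose
multiset of values is a union of four pairs `{a, −a}`; Degtyarev–Shimada's `Γ_𝒥` for `n = 6`): with `h = (m−1)/2`,
`#{paired α ∈ 𝔅⁶ₘ} = 40320·C(h,4) + 10080·(h·C(h−1,2)) + 2520·C(h,2) + 1120·h(h−1) + 70·h`
(`= 1680h⁴ − 5040h³ + 5740h² − 2310h = 105m⁴ − 1050m³ + 3955m² − 6335m + 3325`, the `n = 6`, odd-`m` case of the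
polynomial printed in [Degtyarev–Shimada, Remark 4.4]; `card_isHodge_isPaired_eight_eq_poly`), the five terms
counting the orderings of `t + (−t)` for `t ⊆ R` of the shapes `{a,b,c,d}`, `{a,a,b,c}`, `{a,a,b,b}`, `{a,a,a,b}`,
`{a,a,a,a}`. The elementary counting proof is this formalisation's. [cite: DegtyarevShimada2016, Theorem 1.4 and Remark 4.4] -/
theorem card_isHodge_isPaired_eight (hm : ¬ 2 ∣ m) :
    (univ.filter fun α : Fin 8 → ZMod m ↦ IsHodge α ∧ IsPaired α).card =
      40320 * ((m - 1) / 2).choose 4 + 10080 * ((m - 1) / 2 * (((m - 1) / 2 - 1).choose 2))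
        + 2520 * ((m - 1) / 2).choose 2 + 1120 * ((m - 1) / 2 * ((m - 1) / 2 - 1)) + 70 * ((m - 1) / 2) := by
  classical
  -- the five families of `R`-parts, ordered by `λ`
  set F4 : Finset (Multiset (ZMod m)) := ((repSet m).powersetCard 4).image fun T ↦ T.val with hF4
  set F211 : Finset (Multiset (ZMod m)) :=
    ((repSet m).sigma fun a ↦ ((repSet m).erase a).powersetCard 2).image fun q ↦ {q.1, q.1} + q.2.val with hF211
  set F22 : Finset (Multiset (ZMod m)) := ((repSet m).powersetCard 2).image fun T ↦ T.val + T.val with hF22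
  set F31 : Finset (Multiset (ZMod m)) := (repSet m).offDiag.image fun p ↦ {p.1, p.1, p.1, p.2} with hF31
  set F40 : Finset (Multiset (ZMod m)) := (repSet m).image fun a ↦ {a, a, a, a} with hF40
  set P : Finset (Fin 8 → ZMod m) := univ.filter fun α ↦ IsHodge α ∧ IsPaired α with hP
  -- members consist of representatives and have four elements
  have memT : ∀ {k : ℕ} {T : Finset (ZMod m)}, T ∈ (repSet m).powersetCard k → ∀ x ∈ T.val, x ∈ repSet m :=
    fun hT x hx ↦ (Finset.mem_powersetCard.1 hT).1 (show x ∈ _ from hx)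
  have hq : ∀ {q : Σ _ : ZMod m, Finset (ZMod m)}, q ∈ ((repSet m).sigma fun a ↦ ((repSet m).erase a).powersetCard 2) →
      q.1 ∈ repSet m ∧ (∀ x ∈ q.2, x ∈ repSet m ∧ x ≠ q.1) ∧ q.2.card = 2 := by
    intro q hq
    rw [Finset.mem_sigma, Finset.mem_powersetCard] at hq
    exact ⟨hq.1, fun x hx ↦ ⟨Finset.mem_of_mem_erase (hq.2.1 hx), Finset.ne_of_mem_erase (hq.2.1 hx)⟩, hq.2.2⟩
  have hfam : ∀ t ∈ F4 ∪ F211 ∪ F22 ∪ F31 ∪ F40, (∀ x ∈ t, x ∈ repSet m) ∧ Multiset.card t = 4 := by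
    intro t ht
    simp only [Finset.mem_union] at ht
    rcases ht with (((ht | ht) | ht) | ht) | ht
    · obtain ⟨T, hT, rfl⟩ := Finset.mem_image.1 ht
      exact ⟨memT hT, by rw [Finset.card_val]; exact (Finset.mem_powersetCard.1 hT).2⟩
    · obtain ⟨q, hq', rfl⟩ := Finset.mem_image.1 ht
      obtain ⟨h1, h2, h3⟩ := hq hq'
      refine ⟨fun x hx ↦ ?_, by simp [h3]⟩
      rcases Multiset.mem_add.1 hx with hx | hx
      · simp only [Multiset.insert_eq_cons, Multiset.mem_cons, Multiset.mem_singleton, or_self] at hx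
        exact hx ▸ h1
      · exact (h2 x hx).1
    · obtain ⟨T, hT, rfl⟩ := Finset.mem_image.1 ht
      refine ⟨fun x hx ↦ ?_, by simp [(Finset.mem_powersetCard.1 hT).2]⟩
      rcases Multiset.mem_add.1 hx with hx | hx <;> exact memT hT x hx
    · obtain ⟨p, hp, rfl⟩ := Finset.mem_image.1 ht
      obtain ⟨h1, h2, -⟩ := Finset.mem_offDiag.1 hp
      refine ⟨fun x hx ↦ ?_, rfl⟩
      simp only [Multiset.insert_eq_cons, Multiset.mem_cons, Multiset.mem_singleton] at hx
      rcases hx with rfl | rfl | rfl | rfl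
      · exact h1
      · exact h1
      · exact h1
      · exact h2
    · obtain ⟨a, ha, rfl⟩ := Finset.mem_image.1 ht
      refine ⟨fun x hx ↦ ?_, rfl⟩
      simp only [Multiset.insert_eq_cons, Multiset.mem_cons, Multiset.mem_singleton, or_self] at hx
      exact hx ▸ ha
  -- the invariant `λ` on the families
  have hl4 : ∀ t ∈ F4, lam t = 4 := fun t ht ↦ by
    obtain ⟨T, hT, rfl⟩ := Finset.mem_image.1 ht
    rw [lam_of_nodup T.nodup, Finset.card_val, (Finset.mem_powersetCard.1 hT).2]
  have hl211 : ∀ t ∈ F211, lam t = 6 := fun t ht ↦ by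
    obtain ⟨q, hq', rfl⟩ := Finset.mem_image.1 ht
    obtain ⟨-, h2, h3⟩ := hq hq'
    obtain ⟨b, c, hbc, hq2⟩ := Finset.card_eq_two.1 h3
    have hb := h2 b (by rw [hq2]; simp)
    have hc := h2 c (by rw [hq2]; simp)
    rw [hq2, pair_val hbc]
    exact lam_A2BC hb.2.symm hc.2.symm hbc
  have hl22 : ∀ t ∈ F22, lam t = 8 := fun t ht ↦ by
    obtain ⟨T, hT, rfl⟩ := Finset.mem_image.1 ht
    obtain ⟨a, b, hab, rfl⟩ := Finset.card_eq_two.1 (Finset.mem_powersetCard.1 hT).2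
    rw [pair_val hab]
    exact lam_A2B2 hab
  have hl31 : ∀ t ∈ F31, lam t = 10 := fun t ht ↦ by
    obtain ⟨p, hp, rfl⟩ := Finset.mem_image.1 ht
    exact lam_A3B (Finset.mem_offDiag.1 hp).2.2
  have hl40 : ∀ t ∈ F40, lam t = 16 := fun t ht ↦ by
    obtain ⟨a, -, rfl⟩ := Finset.mem_image.1 ht
    exact lam_A4 a
  -- disjointness of the left-nested unions, by `λ`
  have disj : ∀ {A B : Finset (Multiset (ZMod m))} (b c : ℕ), (∀ t ∈ A, lam t ≤ b) →
      (∀ t ∈ B, lam t = c) → b < c → Disjoint A B := by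
    intro A B b c hA hB hbc
    rw [Finset.disjoint_left]
    intro t htA htB
    have h1 := hA t htA
    have h2 := hB t htB
    omega
  have ext : ∀ {A B : Finset (Multiset (ZMod m))} (b c : ℕ), (∀ t ∈ A, lam t ≤ b) →
      (∀ t ∈ B, lam t = c) → b ≤ c → ∀ t ∈ A ∪ B, lam t ≤ c := by
    intro A B b c hA hB hbc t ht
    rcases Finset.mem_union.1 ht with ht | ht
    · exact (hA t ht).trans hbc
    · exact (hB t ht).le
  have hb0 : ∀ t ∈ F4, lam t ≤ 4 := fun t ht ↦ (hl4 t ht).le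
  have hb1 := ext 4 6 hb0 hl211 (by norm_num)
  have hb2 := ext 6 8 hb1 hl22 (by norm_num)
  have hb3 := ext 8 10 hb2 hl31 (by norm_num)
  have hd1 : Disjoint F4 F211 := disj 4 6 hb0 hl211 (by norm_num)
  have hd2 : Disjoint (F4 ∪ F211) F22 := disj 6 8 hb1 hl22 (by norm_num)
  have hd3 : Disjoint (F4 ∪ F211 ∪ F22) F31 := disj 8 10 hb2 hl31 (by norm_num)
  have hd4 : Disjoint (F4 ∪ F211 ∪ F22 ∪ F31) F40 := disj 10 16 hb3 hl40 (by norm_num)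
  -- the `R`-part of a paired Hodge octuple lies in one of the families
  have hmaps : (P : Set (Fin 8 → ZMod m)).MapsTo (fun α ↦ (univ.val.map α).filter (· ∈ repSet m))
      ↑(F4 ∪ F211 ∪ F22 ∪ F31 ∪ F40) := by
    intro α hα
    rw [Finset.mem_coe, hP, Finset.mem_filter] at hα
    show (univ.val.map α).filter (· ∈ repSet m) ∈
      ((F4 ∪ F211 ∪ F22 ∪ F31 ∪ F40 : Finset (Multiset (ZMod m))) : Set (Multiset (ZMod m)))
    rw [Finset.mem_coe]
    obtain ⟨t, ht, hct, he⟩ := map_eq_symmOf_of_isPaired_eight hm hα.2.1 hα.2.2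
    rw [he, filter_symmOf ht]
    simp only [Finset.mem_union]
    rcases shape_four hct with ⟨a, rfl⟩ | ⟨a, b, hab, rfl⟩ | ⟨a, b, hab, rfl⟩ | ⟨a, b, c, hab, hac, hbc, rfl⟩ | hnd
    · exact Or.inr (Finset.mem_image.2 ⟨a, ht a (by simp), rfl⟩)
    · refine Or.inl (Or.inr (Finset.mem_image.2 ⟨(a, b), ?_, rfl⟩))
      exact Finset.mem_offDiag.2 ⟨ht a (by simp), ht b (by simp), hab⟩
    · refine Or.inl (Or.inl (Or.inr (Finset.mem_image.2 ⟨{a, b}, ?_, by rw [pair_val hab]⟩)))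
      rw [Finset.mem_powersetCard]
      refine ⟨fun x hx ↦ ?_, Finset.card_pair hab⟩
      simp only [Finset.mem_insert, Finset.mem_singleton] at hx
      rcases hx with rfl | rfl
      · exact ht _ (Multiset.mem_add.2 (Or.inl (by simp)))
      · exact ht _ (Multiset.mem_add.2 (Or.inl (by simp)))
    · refine Or.inl (Or.inl (Or.inl (Or.inr (Finset.mem_image.2 ⟨⟨a, {b, c}⟩, ?_, by rw [pair_val hbc]⟩))))
      rw [Finset.mem_sigma, Finset.mem_powersetCard]
      refine ⟨ht a (Multiset.mem_add.2 (Or.inl (by simp))), fun x hx ↦ ?_, Finset.card_pair hbc⟩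
      simp only [Finset.mem_insert, Finset.mem_singleton] at hx
      rw [Finset.mem_erase]
      rcases hx with rfl | rfl
      · exact ⟨hab.symm, ht _ (Multiset.mem_add.2 (Or.inr (by simp)))⟩
      · exact ⟨hac.symm, ht _ (Multiset.mem_add.2 (Or.inr (by simp)))⟩
    · refine Or.inl (Or.inl (Or.inl (Or.inl (Finset.mem_image.2 ⟨t.toFinset, ?_, ?_⟩))))
      · rw [Finset.mem_powersetCard]
        refine ⟨fun x hx ↦ ht x (Multiset.mem_toFinset.1 hx), ?_⟩
        rw [Multiset.toFinset_card_of_nodup hnd, hct]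
      · rw [Multiset.toFinset_val, Multiset.dedup_eq_self.2 hnd]
  rw [Finset.card_eq_sum_card_fiberwise hmaps]
  -- the fibre over `t` is the set of ALL orderings of `t + (−t)`
  have hfib : ∀ t ∈ F4 ∪ F211 ∪ F22 ∪ F31 ∪ F40,
      (P.filter fun α ↦ (univ.val.map α).filter (· ∈ repSet m) = t).card =
      (univ.filter fun α : Fin 8 → ZMod m ↦ univ.val.map α = symmOf t).card := by
    intro t ht𝒯
    obtain ⟨ht, -⟩ := hfam t ht𝒯
    rw [hP, Finset.filter_filter]
    congr 1
    refine Finset.filter_congr fun α _ ↦ ⟨fun h ↦ ?_, fun h ↦ ?_⟩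
    · obtain ⟨⟨hH, hp⟩, hφ⟩ := h
      obtain ⟨t', ht', -, he⟩ := map_eq_symmOf_of_isPaired_eight hm hH hp
      rw [he, filter_symmOf ht'] at hφ
      rw [he, hφ]
    · exact ⟨isHodge_and_isPaired_of_map_eq_symmOf hm ht h, by rw [h, filter_symmOf ht]⟩
  rw [Finset.sum_congr rfl hfib]
  -- injectivity of the parametrisations
  have hinj4 : Set.InjOn (fun T : Finset (ZMod m) ↦ T.val) ↑((repSet m).powersetCard 4) :=
    fun T _ T' _ h ↦ Finset.val_injective h
  have hinj211 : Set.InjOn (fun q : (Σ _ : ZMod m, Finset (ZMod m)) ↦ ({q.1, q.1} : Multiset (ZMod m)) + q.2.val)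
      ↑((repSet m).sigma fun a ↦ ((repSet m).erase a).powersetCard 2) := by
    rintro ⟨a, T⟩ hq1 ⟨a', T'⟩ hq2 h
    obtain ⟨-, h2, -⟩ := hq (Finset.mem_coe.1 hq1)
    obtain ⟨-, h2', -⟩ := hq (Finset.mem_coe.1 hq2)
    have h' : ({a, a} : Multiset (ZMod m)) + T.val = {a', a'} + T'.val := h
    -- `a` occurs twice on the left; on the right it occurs twice only if `a = a'`
    have haT : Multiset.count a T.val = 0 :=
      Multiset.count_eq_zero.2 fun hx ↦ (h2 a hx).2 rfl
    have haT' : Multiset.count a T'.val ≤ 1 := Multiset.nodup_iff_count_le_one.1 T'.nodup a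
    have hc := congrArg (Multiset.count a) h'
    simp only [Multiset.count_add, Multiset.insert_eq_cons, Multiset.count_cons_self, Multiset.count_singleton_self,
      haT] at hc
    have haa' : a = a' := by
      by_contra hne
      rw [Multiset.count_cons_of_ne hne, Multiset.count_singleton, if_neg hne] at hc
      omega
    subst haa'
    have hT : T.val = T'.val := add_left_cancel h'
    rw [Finset.val_injective hT]
  have hinj22 : Set.InjOn (fun T : Finset (ZMod m) ↦ T.val + T.val) ↑((repSet m).powersetCard 2) := by
    intro T _ T' _ h
    have h' : T.val + T.val = T'.val + T'.val := h
    apply Finset.val_injective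
    refine Multiset.ext.mpr fun x ↦ ?_
    have := congrArg (Multiset.count x) h'
    rw [Multiset.count_add, Multiset.count_add] at this
    omega
  have hinj31 : Set.InjOn (fun p : ZMod m × ZMod m ↦ ({p.1, p.1, p.1, p.2} : Multiset (ZMod m)))
      ↑(repSet m).offDiag := by
    rintro ⟨a, b⟩ hp ⟨a', b'⟩ hp' e
    obtain ⟨-, -, hab⟩ := Finset.mem_offDiag.1 hp
    obtain ⟨-, -, hab'⟩ := Finset.mem_offDiag.1 hp'
    simp only [ne_eq] at hab hab'
    have e' : ({a, a, a, b} : Multiset (ZMod m)) = {a', a', a', b'} := e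
    have hc := congrArg (Multiset.count a) e'
    have haa' : a = a' := by
      by_contra hne
      by_cases hab2 : a = b'
      · subst hab2
        simp [hab, Ne.symm hab'] at hc
      · simp [hab, hne, hab2] at hc
    subst haa'
    simp only [Multiset.insert_eq_cons, Multiset.cons_inj_right, Multiset.singleton_inj] at e'
    rw [e']
  have hinj40 : Set.InjOn (fun a : ZMod m ↦ ({a, a, a, a} : Multiset (ZMod m))) ↑(repSet m) := by
    intro a _ a' _ h
    have h' : ({a, a, a, a} : Multiset (ZMod m)) = {a', a', a', a'} := h
    have : a ∈ ({a', a', a', a'} : Multiset (ZMod m)) := by rw [← h']; simp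
    simpa using this
  -- the five partial sums
  have hf4 : ∀ T ∈ (repSet m).powersetCard 4,
      (univ.filter fun α : Fin 8 → ZMod m ↦ univ.val.map α = symmOf T.val).card = 40320 := fun T hT ↦
    card_filter_symmOf_ABCD (Finset.mem_powersetCard.1 hT).1 (Finset.mem_powersetCard.1 hT).2
  have hs4 : ∑ T ∈ (repSet m).powersetCard 4,
      (univ.filter fun α : Fin 8 → ZMod m ↦ univ.val.map α = symmOf T.val).card =
      40320 * ((repSet m).powersetCard 4).card := by
    rw [Finset.sum_congr rfl hf4, Finset.sum_const, smul_eq_mul]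
    exact mul_comm _ _
  have hf211 : ∀ q ∈ ((repSet m).sigma fun a ↦ ((repSet m).erase a).powersetCard 2),
      (univ.filter fun α : Fin 8 → ZMod m ↦ univ.val.map α = symmOf ({q.1, q.1} + q.2.val)).card = 10080 := by
    intro q hq'
    obtain ⟨h1, h2, h3⟩ := hq hq'
    obtain ⟨b, c, hbc, hq2⟩ := Finset.card_eq_two.1 h3
    have hb := h2 b (by rw [hq2]; simp)
    have hc := h2 c (by rw [hq2]; simp)
    rw [hq2, pair_val hbc]
    exact card_filter_symmOf_A2BC h1 hb.1 hc.1 hb.2.symm hc.2.symm hbc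
  have hs211 : ∑ q ∈ ((repSet m).sigma fun a ↦ ((repSet m).erase a).powersetCard 2),
      (univ.filter fun α : Fin 8 → ZMod m ↦ univ.val.map α = symmOf ({q.1, q.1} + q.2.val)).card =
      10080 * ((repSet m).card * ((repSet m).card - 1).choose 2) := by
    have hcardσ : ((repSet m).sigma fun a ↦ ((repSet m).erase a).powersetCard 2).card =
        (repSet m).card * ((repSet m).card - 1).choose 2 := by
      rw [Finset.card_sigma, Finset.sum_congr rfl (g := fun _ ↦ ((repSet m).card - 1).choose 2)
        fun a ha ↦ by rw [Finset.card_powersetCard, Finset.card_erase_of_mem ha], Finset.sum_const, smul_eq_mul]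
    rw [Finset.sum_congr rfl hf211, Finset.sum_const, smul_eq_mul, hcardσ]
    exact mul_comm _ _
  have hf22 : ∀ T ∈ (repSet m).powersetCard 2,
      (univ.filter fun α : Fin 8 → ZMod m ↦ univ.val.map α = symmOf (T.val + T.val)).card = 2520 := by
    intro T hT
    obtain ⟨hTR, hTc⟩ := Finset.mem_powersetCard.1 hT
    obtain ⟨a, b, hab, rfl⟩ := Finset.card_eq_two.1 hTc
    rw [pair_val hab]
    exact card_filter_symmOf_A2B2 (hTR (by simp)) (hTR (by simp)) hab
  have hs22 : ∑ T ∈ (repSet m).powersetCard 2,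
      (univ.filter fun α : Fin 8 → ZMod m ↦ univ.val.map α = symmOf (T.val + T.val)).card =
      2520 * ((repSet m).powersetCard 2).card := by
    rw [Finset.sum_congr rfl hf22, Finset.sum_const, smul_eq_mul]
    exact mul_comm _ _
  have hf31 : ∀ p ∈ (repSet m).offDiag,
      (univ.filter fun α : Fin 8 → ZMod m ↦ univ.val.map α = symmOf {p.1, p.1, p.1, p.2}).card = 1120 := by
    intro p hp
    obtain ⟨h1, h2, h12⟩ := Finset.mem_offDiag.1 hp
    exact card_filter_symmOf_A3B h1 h2 h12
  have hs31 : ∑ p ∈ (repSet m).offDiag,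
      (univ.filter fun α : Fin 8 → ZMod m ↦ univ.val.map α = symmOf {p.1, p.1, p.1, p.2}).card =
      1120 * (repSet m).offDiag.card := by
    rw [Finset.sum_congr rfl hf31, Finset.sum_const, smul_eq_mul]
    exact mul_comm _ _
  have hs40 : ∑ a ∈ repSet m,
      (univ.filter fun α : Fin 8 → ZMod m ↦ univ.val.map α = symmOf {a, a, a, a}).card = 70 * (repSet m).card := by
    rw [Finset.sum_congr rfl fun a ha ↦ card_filter_symmOf_A4 ha, Finset.sum_const, smul_eq_mul]
    exact mul_comm _ _
  rw [Finset.sum_union hd4, Finset.sum_union hd3, Finset.sum_union hd2, Finset.sum_union hd1, hF4,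
    Finset.sum_image hinj4, hs4, hF211, Finset.sum_image hinj211, hs211, hF22, Finset.sum_image hinj22, hs22, hF31,
    Finset.sum_image hinj31, hs31, hF40, Finset.sum_image hinj40, hs40, Finset.offDiag_card,
    Finset.card_powersetCard, Finset.card_powersetCard, card_repSet hm, Nat.mul_sub_one]

open scoped Classical in
/-- **Degtyarev–Shimada 2016, Remark 4.4, `n = 6`, odd `m`**: `#{paired α ∈ 𝔅⁶ₘ} = 105m⁴ − 1050m³ + 3955m² − 6335m + 3325`
(the printed polynomial `105m⁴ − 1050m³ + 3955m² − 6335m + 3325 + (210m² − 1302m + 2010)δₘ` at `δₘ = 0`; the number of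
characters `(a₀, …, a₇)` with non-zero entries splitting into pairs `{a, −a}`, i.e. `|Γ_𝒥|` for the Fermat sixfold,
whose successor is the rank of the lattice of its `105·m⁴` standard `3`-spaces, Thm. 1.4). [cite: DegtyarevShimada2016, Theorem 1.4 and Remark 4.4] -/
theorem card_isHodge_isPaired_eight_eq_poly (hm : ¬ 2 ∣ m) :
    ((univ.filter fun α : Fin 8 → ZMod m ↦ IsHodge α ∧ IsPaired α).card : ℤ) =
      105 * (m : ℤ) ^ 4 - 1050 * (m : ℤ) ^ 3 + 3955 * (m : ℤ) ^ 2 - 6335 * m + 3325 := by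
  rw [card_isHodge_isPaired_eight hm]
  have hm1 : 1 ≤ m := Nat.pos_of_ne_zero (NeZero.ne m)
  obtain ⟨h, hh⟩ : ∃ h, m = 2 * h + 1 := ⟨(m - 1) / 2, by have := Nat.two_dvd_ne_zero.mp hm; omega⟩
  have hdiv : (m - 1) / 2 = h := by omega
  rw [hdiv]
  have hc2 : ∀ k : ℕ, (k.choose 2 : ℤ) * 2 = k * (k - 1) := by
    intro k
    have h2 := Nat.descFactorial_eq_factorial_mul_choose k 2
    rw [show Nat.factorial 2 = 2 by rfl] at h2
    rcases Nat.lt_or_ge k 2 with hlt | hge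
    · rw [Nat.choose_eq_zero_of_lt hlt]
      interval_cases k <;> norm_num
    · have e : (k.descFactorial 2 : ℤ) = k * (k - 1) := by
        simp only [Nat.descFactorial_succ, Nat.descFactorial_zero, mul_one, Nat.sub_zero]
        push_cast [Nat.cast_sub (by omega : 1 ≤ k)]
        ring
      rw [← e, h2]
      push_cast
      ring
  have hc4 : (h.choose 4 : ℤ) * 24 = h * (h - 1) * (h - 2) * (h - 3) := by
    have h4 := Nat.descFactorial_eq_factorial_mul_choose h 4
    rw [show Nat.factorial 4 = 24 by rfl] at h4
    rcases Nat.lt_or_ge h 4 with hlt | hge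
    · rw [Nat.choose_eq_zero_of_lt hlt]
      interval_cases h <;> norm_num
    · have e : (h.descFactorial 4 : ℤ) = h * (h - 1) * (h - 2) * (h - 3) := by
        simp only [Nat.descFactorial_succ, Nat.descFactorial_zero, mul_one, Nat.sub_zero]
        push_cast [Nat.cast_sub (by omega : 1 ≤ h), Nat.cast_sub (by omega : 2 ≤ h), Nat.cast_sub (by omega : 3 ≤ h)]
        ring
      rw [← e, h4]
      push_cast
      ring
  have hA := hc2 h
  have hC := hc4
  rcases Nat.eq_zero_or_pos h with h0 | hpos
  · subst h0
    simp [hh]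
  · have hB := hc2 (h - 1)
    push_cast [Nat.cast_sub hpos, hh] at hB ⊢
    linear_combination 1260 * hA + 5040 * (h : ℤ) * hB + 1680 * hC

open scoped Classical in
/-- Instances: `m = 3` (the Fermat cubic sixfold: `70 = C(8,4)` paired octuples, all of shape `{a,a,a,a,−a,−a,−a,−a}`)
and `m = 25` (`26926200`). [cite: DegtyarevShimada2016, Remark 4.4] -/
theorem card_isHodge_isPaired_eight_three_and_twentyfive :
    (univ.filter fun α : Fin 8 → ZMod 3 ↦ IsHodge α ∧ IsPaired α).card = 70 ∧
      (univ.filter fun α : Fin 8 → ZMod 25 ↦ IsHodge α ∧ IsPaired α).card = 26926200 := by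
  refine ⟨?_, ?_⟩
  · rw [card_isHodge_isPaired_eight (m := 3) (by norm_num)]
    decide
  · rw [card_isHodge_isPaired_eight (m := 25) (by norm_num)]
    decide

end Octuples

/-! ## Octuples at even level (Degtyarev–Shimada 2016, Remark 4.4, `n = 6`, every `m`)

As for sextuples: at even level the value multiset of a paired Hodge octuple is `t + (−t) + 2j·{η}`, `t ⊆ R`,
`|t| + j = 4`, and every ordering of such a multiset is a paired Hodge octuple. Twelve shapes: the five with `j = 0`,
then `{a,a,a}`, `{a,a,b}`, `{a,b,c}` (`j = 1`; `560, 5040, 20160` orderings), `{a,a}`, `{a,b}` (`j = 2`; `420, 1680`),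
`{a}` (`j = 3`; `56`), `∅` (`j = 4`; `1`), separated by the invariant `100|t| + λ(t)`. -/

section OctuplesEven

/-- **Classification (even level, octuples).** The multiset of values of a paired Hodge octuple `α` is
`t + (−t) + 2j·{η}`, `t` the representatives among the values, `|t| + j = 4`. [folklore] -/
private theorem map_eq_symmOf_add_of_isPaired_eight (hm : 2 ∣ m) {α : Fin 8 → ZMod m} (hα : IsHodge α)
    (hp : IsPaired α) :
    ∃ j : ℕ, Multiset.card ((univ.val.map α).filter (· ∈ repSet m)) + j = 4 ∧
      univ.val.map α = symmOf ((univ.val.map α).filter (· ∈ repSet m)) + Multiset.replicate (2 * j) (eta m) := by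
  classical
  set s := univ.val.map α with hs
  have h0 : (0 : ZMod m) ∉ s := by
    intro h
    obtain ⟨i, -, hi⟩ := Multiset.mem_map.1 h
    exact hα.1.1 i hi
  have hsym := count_eq_count_neg_of_isPaired' hp
  have he := eq_symmOf_filter_add h0 hsym
  rw [filter_eq_neg_eq_replicate hm h0] at he
  have hc : Multiset.card s = 8 := by simp [hs]
  have hk := congrArg Multiset.card he
  rw [Multiset.card_add, card_symmOf, Multiset.card_replicate, hc] at hk
  refine ⟨4 - Multiset.card (s.filter (· ∈ repSet m)), by omega, ?_⟩
  have h2 : 2 * (4 - Multiset.card (s.filter (· ∈ repSet m))) = s.count (eta m) := by omega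
  rw [h2]
  exact he

/-- **Every ordering of `t + (−t) + 2j·{η}` (`t` representatives, `|t| + j = 4`) is a paired Hodge octuple.** [folklore] -/
private theorem isHodge_and_isPaired_of_map_eq_symmOf_add_eight (hm : 2 ∣ m) {t : Multiset (ZMod m)}
    (ht : ∀ x ∈ t, x ∈ repSet m) {j : ℕ} (hc : Multiset.card t + j = 4) {α : Fin 8 → ZMod m}
    (h : univ.val.map α = symmOf t + Multiset.replicate (2 * j) (eta m)) : IsHodge α ∧ IsPaired α := by
  classical
  obtain ⟨r, a, ha⟩ := exists_eq_univ_val_map (t + Multiset.replicate j (eta m))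
  have hr : r = 4 := by
    have := congrArg Multiset.card ha
    simp only [Multiset.card_map, Finset.card_val, Finset.card_univ, Fintype.card_fin, Multiset.card_add,
      Multiset.card_replicate] at this
    omega
  subst hr
  have hw : univ.val.map (Fin.append a (-a)) = univ.val.map α := by
    rw [univ_val_map_append_neg, h, symmOf, symmOf, ha, Multiset.map_add, Multiset.map_replicate, neg_eta hm,
      two_mul, Multiset.replicate_add]
    abel
  obtain ⟨σ, hσ⟩ := exists_perm_of_univ_val_map_eq hw
  have hp : IsPaired α := by
    rw [hσ]
    exact isPaired_comp_perm (isPaired_append_neg a) σ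
  have h0 : ∀ i, α i ≠ 0 := by
    intro i
    have hi : α i ∈ symmOf t + Multiset.replicate (2 * j) (eta m) := by
      rw [← h]
      exact Multiset.mem_map_of_mem α (mem_univ_val i)
    rcases Multiset.mem_add.1 hi with hi | hi
    · rcases mem_symmOf.1 hi with hi | hi
      · exact ne_zero_of_mem_repSet (ht _ hi)
      · exact fun e ↦ ne_zero_of_mem_repSet (ht _ hi) (by rw [e, neg_zero])
    · rw [Multiset.eq_of_mem_replicate hi]
      exact eta_ne_zero hm
  exact ⟨hp.isHodge h0, hp⟩

/-! ### Orderings of the seven new shapes -/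

/-- Injectivity of the alphabet `(a, −a, η)` for a representative `a`. [folklore] -/
private theorem injective_alphabet₃ (hm : 2 ∣ m) {a : ZMod m} (ha : a ∈ repSet m) :
    Function.Injective ![a, -a, eta m] := by
  have h1 : a ≠ -a := ne_neg_of_mem_repSet ha
  have h2 : a ≠ eta m := ne_eta_of_mem_repSet hm ha
  have h3 : -a ≠ eta m := neg_ne_eta_of_mem_repSet hm ha
  intro i j h
  fin_cases i <;> fin_cases j <;> simp [h1, h1.symm, h2, h2.symm, h3, h3.symm] at h ⊢

/-- Injectivity of the alphabet `(a, b, −a, −b, η)` for distinct representatives `a, b`. [folklore] -/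
private theorem injective_alphabet₅ (hm : 2 ∣ m) {a b : ZMod m} (ha : a ∈ repSet m) (hb : b ∈ repSet m)
    (hab : a ≠ b) : Function.Injective ![a, b, -a, -b, eta m] := by
  obtain ⟨h1, h2, h3, h4, h5⟩ := distinct_four ha hb hab
  have h6 : a ≠ eta m := ne_eta_of_mem_repSet hm ha
  have h7 : b ≠ eta m := ne_eta_of_mem_repSet hm hb
  have h8 : -a ≠ eta m := neg_ne_eta_of_mem_repSet hm ha
  have h9 : -b ≠ eta m := neg_ne_eta_of_mem_repSet hm hb
  intro i j h
  fin_cases i <;> fin_cases j <;>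
    simp [hab, hab.symm, h1, h1.symm, h2, h2.symm, h3, h3.symm, h4, h4.symm, h5, h5.symm, h6, h6.symm,
      h7, h7.symm, h8, h8.symm, h9, h9.symm] at h ⊢

/-- Shape `{a,a,a,−a,−a,−a,η,η}`: `8!/(3!3!2!) = 560` orderings. [folklore] -/
private theorem card_filter_shape8_AAA (hm : 2 ∣ m) {a : ZMod m} (ha : a ∈ repSet m) :
    (univ.filter fun α : Fin 8 → ZMod m ↦
      univ.val.map α = symmOf {a, a, a} + Multiset.replicate 2 (eta m)).card = 560 := by
  classical
  have he : symmOf {a, a, a} + Multiset.replicate 2 (eta m) =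
      ({0, 0, 0, 1, 1, 1, 2, 2} : Multiset (Fin 3)).map (⟨_, injective_alphabet₃ hm ha⟩ : Fin 3 ↪ ZMod m) := rfl
  have key := card_orderings_map_emb_mul (n := 8) (⟨_, injective_alphabet₃ hm ha⟩ : Fin 3 ↪ ZMod m)
    ({0, 0, 0, 1, 1, 1, 2, 2} : Multiset (Fin 3)) rfl
  have hprod : ∏ y ∈ ({0, 0, 0, 1, 1, 1, 2, 2} : Multiset (Fin 3)).toFinset,
      (Multiset.count y ({0, 0, 0, 1, 1, 1, 2, 2} : Multiset (Fin 3))).factorial = 72 := by decide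
  rw [← he, hprod, show Nat.factorial 8 = 40320 by rfl] at key
  omega

/-- Shape `{a,a,b,−a,−a,−b,η,η}`, `a ≠ b` representatives: `8!/(2!2!2!) = 5040` orderings. [folklore] -/
private theorem card_filter_shape8_AAB (hm : 2 ∣ m) {a b : ZMod m} (ha : a ∈ repSet m) (hb : b ∈ repSet m)
    (hab : a ≠ b) :
    (univ.filter fun α : Fin 8 → ZMod m ↦
      univ.val.map α = symmOf {a, a, b} + Multiset.replicate 2 (eta m)).card = 5040 := by
  classical
  have he : symmOf {a, a, b} + Multiset.replicate 2 (eta m) =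
      ({0, 0, 1, 2, 2, 3, 4, 4} : Multiset (Fin 5)).map (⟨_, injective_alphabet₅ hm ha hb hab⟩ : Fin 5 ↪ ZMod m) := rfl
  have key := card_orderings_map_emb_mul (n := 8) (⟨_, injective_alphabet₅ hm ha hb hab⟩ : Fin 5 ↪ ZMod m)
    ({0, 0, 1, 2, 2, 3, 4, 4} : Multiset (Fin 5)) rfl
  have hprod : ∏ y ∈ ({0, 0, 1, 2, 2, 3, 4, 4} : Multiset (Fin 5)).toFinset,
      (Multiset.count y ({0, 0, 1, 2, 2, 3, 4, 4} : Multiset (Fin 5))).factorial = 8 := by decide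
  rw [← he, hprod, show Nat.factorial 8 = 40320 by rfl] at key
  omega

/-- Shape `{a,b,c,−a,−b,−c,η,η}`, `a, b, c` distinct representatives: `8!/2! = 20160` orderings. [folklore] -/
private theorem card_filter_shape8_ABC (hm : 2 ∣ m) {a b c : ZMod m} (ha : a ∈ repSet m) (hb : b ∈ repSet m)
    (hc : c ∈ repSet m) (hab : a ≠ b) (hac : a ≠ c) (hbc : b ≠ c) :
    (univ.filter fun α : Fin 8 → ZMod m ↦
      univ.val.map α = symmOf {a, b, c} + Multiset.replicate 2 (eta m)).card = 20160 := by
  classical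
  obtain ⟨h1, h2, h3, h4, h5⟩ := distinct_four ha hb hab
  obtain ⟨-, h6, h7, h8, h9⟩ := distinct_four ha hc hac
  obtain ⟨-, -, h10, h11, h12⟩ := distinct_four hb hc hbc
  have h13 : a ≠ eta m := ne_eta_of_mem_repSet hm ha
  have h14 : b ≠ eta m := ne_eta_of_mem_repSet hm hb
  have h15 : c ≠ eta m := ne_eta_of_mem_repSet hm hc
  have h16 : -a ≠ eta m := neg_ne_eta_of_mem_repSet hm ha
  have h17 : -b ≠ eta m := neg_ne_eta_of_mem_repSet hm hb
  have h18 : -c ≠ eta m := neg_ne_eta_of_mem_repSet hm hc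
  have hinj : Function.Injective ![a, b, c, -a, -b, -c, eta m] := by
    intro i j h
    fin_cases i <;> fin_cases j <;>
      simp [hab, hab.symm, hac, hac.symm, hbc, hbc.symm, h1, h1.symm, h2, h2.symm, h3, h3.symm, h4, h4.symm,
        h5, h5.symm, h6, h6.symm, h7, h7.symm, h8, h8.symm, h9, h9.symm, h10, h10.symm, h11, h11.symm,
        h12, h12.symm, h13, h13.symm, h14, h14.symm, h15, h15.symm, h16, h16.symm, h17, h17.symm, h18,
        h18.symm] at h ⊢
  have he : symmOf {a, b, c} + Multiset.replicate 2 (eta m) =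
      ({0, 1, 2, 3, 4, 5, 6, 6} : Multiset (Fin 7)).map (⟨_, hinj⟩ : Fin 7 ↪ ZMod m) := rfl
  have key := card_orderings_map_emb_mul (n := 8) (⟨_, hinj⟩ : Fin 7 ↪ ZMod m)
    ({0, 1, 2, 3, 4, 5, 6, 6} : Multiset (Fin 7)) rfl
  have hprod : ∏ y ∈ ({0, 1, 2, 3, 4, 5, 6, 6} : Multiset (Fin 7)).toFinset,
      (Multiset.count y ({0, 1, 2, 3, 4, 5, 6, 6} : Multiset (Fin 7))).factorial = 2 := by decide
  rw [← he, hprod, show Nat.factorial 8 = 40320 by rfl] at key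
  omega

/-- Shape `{a,a,−a,−a,η,η,η,η}`: `8!/(2!2!4!) = 420` orderings. [folklore] -/
private theorem card_filter_shape8_AA (hm : 2 ∣ m) {a : ZMod m} (ha : a ∈ repSet m) :
    (univ.filter fun α : Fin 8 → ZMod m ↦
      univ.val.map α = symmOf {a, a} + Multiset.replicate 4 (eta m)).card = 420 := by
  classical
  have he : symmOf {a, a} + Multiset.replicate 4 (eta m) =
      ({0, 0, 1, 1, 2, 2, 2, 2} : Multiset (Fin 3)).map (⟨_, injective_alphabet₃ hm ha⟩ : Fin 3 ↪ ZMod m) := rfl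
  have key := card_orderings_map_emb_mul (n := 8) (⟨_, injective_alphabet₃ hm ha⟩ : Fin 3 ↪ ZMod m)
    ({0, 0, 1, 1, 2, 2, 2, 2} : Multiset (Fin 3)) rfl
  have hprod : ∏ y ∈ ({0, 0, 1, 1, 2, 2, 2, 2} : Multiset (Fin 3)).toFinset,
      (Multiset.count y ({0, 0, 1, 1, 2, 2, 2, 2} : Multiset (Fin 3))).factorial = 96 := by decide
  rw [← he, hprod, show Nat.factorial 8 = 40320 by rfl] at key
  omega

/-- Shape `{a,b,−a,−b,η,η,η,η}`, `a ≠ b` representatives: `8!/4! = 1680` orderings. [folklore] -/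
private theorem card_filter_shape8_AB (hm : 2 ∣ m) {a b : ZMod m} (ha : a ∈ repSet m) (hb : b ∈ repSet m)
    (hab : a ≠ b) :
    (univ.filter fun α : Fin 8 → ZMod m ↦
      univ.val.map α = symmOf {a, b} + Multiset.replicate 4 (eta m)).card = 1680 := by
  classical
  have he : symmOf {a, b} + Multiset.replicate 4 (eta m) =
      ({0, 1, 2, 3, 4, 4, 4, 4} : Multiset (Fin 5)).map (⟨_, injective_alphabet₅ hm ha hb hab⟩ : Fin 5 ↪ ZMod m) := rfl
  have key := card_orderings_map_emb_mul (n := 8) (⟨_, injective_alphabet₅ hm ha hb hab⟩ : Fin 5 ↪ ZMod m)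
    ({0, 1, 2, 3, 4, 4, 4, 4} : Multiset (Fin 5)) rfl
  have hprod : ∏ y ∈ ({0, 1, 2, 3, 4, 4, 4, 4} : Multiset (Fin 5)).toFinset,
      (Multiset.count y ({0, 1, 2, 3, 4, 4, 4, 4} : Multiset (Fin 5))).factorial = 24 := by decide
  rw [← he, hprod, show Nat.factorial 8 = 40320 by rfl] at key
  omega

/-- Shape `{a,−a,η,η,η,η,η,η}`: `8!/6! = 56` orderings. [folklore] -/
private theorem card_filter_shape8_A (hm : 2 ∣ m) {a : ZMod m} (ha : a ∈ repSet m) :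
    (univ.filter fun α : Fin 8 → ZMod m ↦
      univ.val.map α = symmOf {a} + Multiset.replicate 6 (eta m)).card = 56 := by
  classical
  have he : symmOf {a} + Multiset.replicate 6 (eta m) =
      ({0, 1, 2, 2, 2, 2, 2, 2} : Multiset (Fin 3)).map (⟨_, injective_alphabet₃ hm ha⟩ : Fin 3 ↪ ZMod m) := rfl
  have key := card_orderings_map_emb_mul (n := 8) (⟨_, injective_alphabet₃ hm ha⟩ : Fin 3 ↪ ZMod m)
    ({0, 1, 2, 2, 2, 2, 2, 2} : Multiset (Fin 3)) rfl
  have hprod : ∏ y ∈ ({0, 1, 2, 2, 2, 2, 2, 2} : Multiset (Fin 3)).toFinset,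
      (Multiset.count y ({0, 1, 2, 2, 2, 2, 2, 2} : Multiset (Fin 3))).factorial = 720 := by decide
  rw [← he, hprod, show Nat.factorial 8 = 40320 by rfl] at key
  omega

/-- Shape `{η,η,η,η,η,η,η,η}`: one ordering. [folklore] -/
private theorem card_filter_shape8_empty :
    (univ.filter fun α : Fin 8 → ZMod m ↦
      univ.val.map α = symmOf 0 + Multiset.replicate 8 (eta m)).card = 1 := by
  classical
  have hinj : Function.Injective ![eta m] := fun i j _ ↦ Subsingleton.elim i j
  have he : symmOf (0 : Multiset (ZMod m)) + Multiset.replicate 8 (eta m) =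
      ({0, 0, 0, 0, 0, 0, 0, 0} : Multiset (Fin 1)).map (⟨![eta m], hinj⟩ : Fin 1 ↪ ZMod m) := rfl
  have key := card_orderings_map_emb_mul (n := 8) (⟨![eta m], hinj⟩ : Fin 1 ↪ ZMod m)
    ({0, 0, 0, 0, 0, 0, 0, 0} : Multiset (Fin 1)) rfl
  have hprod : ∏ y ∈ ({0, 0, 0, 0, 0, 0, 0, 0} : Multiset (Fin 1)).toFinset,
      (Multiset.count y ({0, 0, 0, 0, 0, 0, 0, 0} : Multiset (Fin 1))).factorial = 40320 := by decide
  rw [← he, hprod, show Nat.factorial 8 = 40320 by rfl] at key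
  omega

/-! ### The invariant `μ = 100|t| + λ(t)` -/

/-- `μ(t) = 100|t| + λ(t)` (plumbing: separates the twelve shapes). [folklore] -/
private def mu (t : Multiset (ZMod m)) : ℕ := 100 * Multiset.card t + lam t

omit [NeZero m] in
/-- `λ{a,a,a} = 9`, `λ{a,a,b} = 5` (`a ≠ b`), `λ{a,a} = 4`, `λ{a} = 1`, `λ∅ = 0`. [folklore] -/
private theorem lam_small (a b : ZMod m) (hab : a ≠ b) :
    lam ({a, a, a} : Multiset (ZMod m)) = 9 ∧ lam ({a, a, b} : Multiset (ZMod m)) = 5 ∧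
      lam ({a, a} : Multiset (ZMod m)) = 4 ∧ lam ({a} : Multiset (ZMod m)) = 1 ∧
      lam (0 : Multiset (ZMod m)) = 0 := by
  refine ⟨?_, ?_, ?_, ?_, ?_⟩ <;>
    simp [lam, Multiset.count_cons, Multiset.count_singleton, hab, hab.symm]

open scoped Classical in
/-- **The number of paired Hodge octuples at even level `m`** (`Γ_𝒥` of [Degtyarev–Shimada] for `n = 6`, even `m`):
with `h = (m−2)/2`,
`#{paired α ∈ 𝔅⁶ₘ} = 1 + 56h + 420h + 1680C(h,2) + 560h + 5040h(h−1) + 20160C(h,3) + 40320C(h,4) + 10080·h·C(h−1,2)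
 + 2520C(h,2) + 1120h(h−1) + 70h` (`= 1680h⁴ − 1680h³ + 1540h² − 434h + 1`), the twelve terms counting the orderings of
`t + (−t) + (8 − 2|t|)·{η}` by the shape of `t`: `∅`; `{a}`; `{a,a}`, `{a,b}`; `{a,a,a}`, `{a,a,b}`, `{a,b,c}`;
`{a,b,c,d}`, `{a,a,b,c}`, `{a,a,b,b}`, `{a,a,a,b}`, `{a,a,a,a}`. With the odd case this gives the printed polynomial
for `n = 6` at every `m` (`card_isHodge_isPaired_eight_eq_degtyarevShimada`). The elementary counting proof is this
formalisation's. [cite: DegtyarevShimada2016, Theorem 1.4 and Remark 4.4] -/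
theorem card_isHodge_isPaired_eight_even (hm : 2 ∣ m) :
    (univ.filter fun α : Fin 8 → ZMod m ↦ IsHodge α ∧ IsPaired α).card =
      1 + 56 * ((m - 2) / 2) + 420 * ((m - 2) / 2) + 1680 * ((m - 2) / 2).choose 2
        + 560 * ((m - 2) / 2) + 5040 * ((m - 2) / 2 * ((m - 2) / 2 - 1)) + 20160 * ((m - 2) / 2).choose 3
        + 40320 * ((m - 2) / 2).choose 4 + 10080 * ((m - 2) / 2 * (((m - 2) / 2 - 1).choose 2))
        + 2520 * ((m - 2) / 2).choose 2 + 1120 * ((m - 2) / 2 * ((m - 2) / 2 - 1)) + 70 * ((m - 2) / 2) := by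
  classical
  -- the twelve families of `R`-parts, ordered by `μ`
  set G0 : Finset (Multiset (ZMod m)) := {0} with hG0
  set G1 : Finset (Multiset (ZMod m)) := (repSet m).image fun a ↦ {a} with hG1
  set G2A : Finset (Multiset (ZMod m)) := (repSet m).image fun a ↦ {a, a} with hG2A
  set G2B : Finset (Multiset (ZMod m)) := ((repSet m).powersetCard 2).image fun T ↦ T.val with hG2B
  set G3A : Finset (Multiset (ZMod m)) := (repSet m).image fun a ↦ {a, a, a} with hG3A
  set G3B : Finset (Multiset (ZMod m)) := (repSet m).offDiag.image fun p ↦ {p.1, p.1, p.2} with hG3B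
  set G3C : Finset (Multiset (ZMod m)) := ((repSet m).powersetCard 3).image fun T ↦ T.val with hG3C
  set F4 : Finset (Multiset (ZMod m)) := ((repSet m).powersetCard 4).image fun T ↦ T.val with hF4
  set F211 : Finset (Multiset (ZMod m)) :=
    ((repSet m).sigma fun a ↦ ((repSet m).erase a).powersetCard 2).image fun q ↦ {q.1, q.1} + q.2.val with hF211
  set F22 : Finset (Multiset (ZMod m)) := ((repSet m).powersetCard 2).image fun T ↦ T.val + T.val with hF22
  set F31 : Finset (Multiset (ZMod m)) := (repSet m).offDiag.image fun p ↦ {p.1, p.1, p.1, p.2} with hF31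
  set F40 : Finset (Multiset (ZMod m)) := (repSet m).image fun a ↦ {a, a, a, a} with hF40
  set P : Finset (Fin 8 → ZMod m) := univ.filter fun α ↦ IsHodge α ∧ IsPaired α with hP
  -- members consist of representatives and have at most four elements
  have memT : ∀ {k : ℕ} {T : Finset (ZMod m)}, T ∈ (repSet m).powersetCard k → ∀ x ∈ T.val, x ∈ repSet m :=
    fun hT x hx ↦ (Finset.mem_powersetCard.1 hT).1 (show x ∈ _ from hx)
  have hq : ∀ {q : Σ _ : ZMod m, Finset (ZMod m)}, q ∈ ((repSet m).sigma fun a ↦ ((repSet m).erase a).powersetCard 2) →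
      q.1 ∈ repSet m ∧ (∀ x ∈ q.2, x ∈ repSet m ∧ x ≠ q.1) ∧ q.2.card = 2 := by
    intro q hq
    rw [Finset.mem_sigma, Finset.mem_powersetCard] at hq
    exact ⟨hq.1, fun x hx ↦ ⟨Finset.mem_of_mem_erase (hq.2.1 hx), Finset.ne_of_mem_erase (hq.2.1 hx)⟩, hq.2.2⟩
  have mem_le3 : ∀ {a b c : ZMod m}, a ∈ repSet m → b ∈ repSet m → c ∈ repSet m →
      ∀ x ∈ ({a, b, c} : Multiset (ZMod m)), x ∈ repSet m := by
    intro a b c ha hb hc x hx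
    simp only [Multiset.insert_eq_cons, Multiset.mem_cons, Multiset.mem_singleton] at hx
    rcases hx with rfl | rfl | rfl
    · exact ha
    · exact hb
    · exact hc
  set 𝒢 := G0 ∪ G1 ∪ G2A ∪ G2B ∪ G3A ∪ G3B ∪ G3C ∪ F4 ∪ F211 ∪ F22 ∪ F31 ∪ F40 with h𝒢
  have hfam : ∀ t ∈ 𝒢, (∀ x ∈ t, x ∈ repSet m) ∧ Multiset.card t ≤ 4 := by
    intro t ht
    simp only [h𝒢, Finset.mem_union] at ht
    rcases ht with ((((((((((ht | ht) | ht) | ht) | ht) | ht) | ht) | ht) | ht) | ht) | ht) | ht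
    · rw [hG0, Finset.mem_singleton] at ht
      subst ht
      exact ⟨fun x hx ↦ (Multiset.notMem_zero x hx).elim, by simp⟩
    · obtain ⟨a, ha, rfl⟩ := Finset.mem_image.1 ht
      exact ⟨fun x hx ↦ by rw [Multiset.mem_singleton] at hx; exact hx ▸ ha, by simp⟩
    · obtain ⟨a, ha, rfl⟩ := Finset.mem_image.1 ht
      refine ⟨fun x hx ↦ ?_, by simp⟩
      simp only [Multiset.insert_eq_cons, Multiset.mem_cons, Multiset.mem_singleton, or_self] at hx
      exact hx ▸ ha
    · obtain ⟨T, hT, rfl⟩ := Finset.mem_image.1 ht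
      exact ⟨memT hT, by rw [Finset.card_val, (Finset.mem_powersetCard.1 hT).2]; norm_num⟩
    · obtain ⟨a, ha, rfl⟩ := Finset.mem_image.1 ht
      exact ⟨mem_le3 ha ha ha, by simp⟩
    · obtain ⟨p, hp, rfl⟩ := Finset.mem_image.1 ht
      obtain ⟨h1, h2, -⟩ := Finset.mem_offDiag.1 hp
      exact ⟨mem_le3 h1 h1 h2, by simp⟩
    · obtain ⟨T, hT, rfl⟩ := Finset.mem_image.1 ht
      exact ⟨memT hT, by rw [Finset.card_val, (Finset.mem_powersetCard.1 hT).2]; norm_num⟩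
    · obtain ⟨T, hT, rfl⟩ := Finset.mem_image.1 ht
      exact ⟨memT hT, le_of_eq (by rw [Finset.card_val, (Finset.mem_powersetCard.1 hT).2])⟩
    · obtain ⟨q, hq', rfl⟩ := Finset.mem_image.1 ht
      obtain ⟨h1, h2, h3⟩ := hq hq'
      refine ⟨fun x hx ↦ ?_, le_of_eq (by simp [h3])⟩
      rcases Multiset.mem_add.1 hx with hx | hx
      · simp only [Multiset.insert_eq_cons, Multiset.mem_cons, Multiset.mem_singleton, or_self] at hx
        exact hx ▸ h1
      · exact (h2 x hx).1
    · obtain ⟨T, hT, rfl⟩ := Finset.mem_image.1 ht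
      refine ⟨fun x hx ↦ ?_, le_of_eq (by simp [(Finset.mem_powersetCard.1 hT).2])⟩
      rcases Multiset.mem_add.1 hx with hx | hx <;> exact memT hT x hx
    · obtain ⟨p, hp, rfl⟩ := Finset.mem_image.1 ht
      obtain ⟨h1, h2, -⟩ := Finset.mem_offDiag.1 hp
      refine ⟨fun x hx ↦ ?_, le_of_eq rfl⟩
      simp only [Multiset.insert_eq_cons, Multiset.mem_cons, Multiset.mem_singleton] at hx
      rcases hx with rfl | rfl | rfl | rfl
      · exact h1
      · exact h1
      · exact h1
      · exact h2
    · obtain ⟨a, ha, rfl⟩ := Finset.mem_image.1 ht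
      refine ⟨fun x hx ↦ ?_, le_of_eq rfl⟩
      simp only [Multiset.insert_eq_cons, Multiset.mem_cons, Multiset.mem_singleton, or_self] at hx
      exact hx ▸ ha
  -- the invariant `μ` on the families
  have hμG0 : ∀ t ∈ G0, mu t = 0 := fun t ht ↦ by
    rw [hG0, Finset.mem_singleton] at ht
    subst ht
    simp [mu, lam]
  have hμG1 : ∀ t ∈ G1, mu t = 101 := fun t ht ↦ by
    obtain ⟨a, -, rfl⟩ := Finset.mem_image.1 ht
    simp [mu, lam]
  have hμG2A : ∀ t ∈ G2A, mu t = 204 := fun t ht ↦ by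
    obtain ⟨a, -, rfl⟩ := Finset.mem_image.1 ht
    simp [mu, lam]
  have hμG2B : ∀ t ∈ G2B, mu t = 202 := fun t ht ↦ by
    obtain ⟨T, hT, rfl⟩ := Finset.mem_image.1 ht
    rw [mu, lam_of_nodup T.nodup, Finset.card_val, (Finset.mem_powersetCard.1 hT).2]
  have hμG3A : ∀ t ∈ G3A, mu t = 309 := fun t ht ↦ by
    obtain ⟨a, -, rfl⟩ := Finset.mem_image.1 ht
    simp [mu, lam]
  have hμG3B : ∀ t ∈ G3B, mu t = 305 := fun t ht ↦ by
    obtain ⟨p, hp, rfl⟩ := Finset.mem_image.1 ht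
    have := (lam_small p.1 p.2 (Finset.mem_offDiag.1 hp).2.2).2.1
    rw [mu, this]
    rfl
  have hμG3C : ∀ t ∈ G3C, mu t = 303 := fun t ht ↦ by
    obtain ⟨T, hT, rfl⟩ := Finset.mem_image.1 ht
    rw [mu, lam_of_nodup T.nodup, Finset.card_val, (Finset.mem_powersetCard.1 hT).2]
  have hμF4 : ∀ t ∈ F4, mu t = 404 := fun t ht ↦ by
    obtain ⟨T, hT, rfl⟩ := Finset.mem_image.1 ht
    rw [mu, lam_of_nodup T.nodup, Finset.card_val, (Finset.mem_powersetCard.1 hT).2]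
  have hμF211 : ∀ t ∈ F211, mu t = 406 := fun t ht ↦ by
    obtain ⟨q, hq', rfl⟩ := Finset.mem_image.1 ht
    obtain ⟨-, h2, h3⟩ := hq hq'
    obtain ⟨b, c, hbc, hq2⟩ := Finset.card_eq_two.1 h3
    have hb := h2 b (by rw [hq2]; simp)
    have hc := h2 c (by rw [hq2]; simp)
    rw [hq2, pair_val hbc, mu, lam_A2BC hb.2.symm hc.2.symm hbc]
    rfl
  have hμF22 : ∀ t ∈ F22, mu t = 408 := fun t ht ↦ by
    obtain ⟨T, hT, rfl⟩ := Finset.mem_image.1 ht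
    obtain ⟨a, b, hab, rfl⟩ := Finset.card_eq_two.1 (Finset.mem_powersetCard.1 hT).2
    rw [pair_val hab, mu, lam_A2B2 hab]
    rfl
  have hμF31 : ∀ t ∈ F31, mu t = 410 := fun t ht ↦ by
    obtain ⟨p, hp, rfl⟩ := Finset.mem_image.1 ht
    rw [mu, lam_A3B (Finset.mem_offDiag.1 hp).2.2]
    rfl
  have hμF40 : ∀ t ∈ F40, mu t = 416 := fun t ht ↦ by
    obtain ⟨a, -, rfl⟩ := Finset.mem_image.1 ht
    rw [mu, lam_A4 a]
    rfl
  -- disjointness of the left-nested unions, by `μ`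
  have disj : ∀ {A B : Finset (Multiset (ZMod m))} (b c : ℕ), (∀ t ∈ A, mu t ≤ b) →
      (∀ t ∈ B, mu t = c) → b < c → Disjoint A B := by
    intro A B b c hA hB hbc
    rw [Finset.disjoint_left]
    intro t htA htB
    have h1 := hA t htA
    have h2 := hB t htB
    omega
  have ext : ∀ {A B : Finset (Multiset (ZMod m))} (b c : ℕ), (∀ t ∈ A, mu t ≤ b) →
      (∀ t ∈ B, mu t = c) → b ≤ c → ∀ t ∈ A ∪ B, mu t ≤ c := by
    intro A B b c hA hB hbc t ht
    rcases Finset.mem_union.1 ht with ht | ht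
    · exact (hA t ht).trans hbc
    · exact (hB t ht).le
  have hb0 : ∀ t ∈ G0, mu t ≤ 0 := fun t ht ↦ (hμG0 t ht).le
  have hb1 := ext 0 101 hb0 hμG1 (by norm_num)
  have hb2 := ext 101 204 hb1 hμG2A (by norm_num)
  -- (the order `G2A` before `G2B` is by construction of the union; `μ` decreases there, so swap the bound)
  have hb2' : ∀ t ∈ G0 ∪ G1 ∪ G2A, mu t ≤ 204 := hb2
  have hd1 : Disjoint G0 G1 := disj 0 101 hb0 hμG1 (by norm_num)
  have hd2 : Disjoint (G0 ∪ G1) G2A := disj 101 204 hb1 hμG2A (by norm_num)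
  have hd3 : Disjoint (G0 ∪ G1 ∪ G2A) G2B := by
    rw [Finset.disjoint_left]
    intro t htA htB
    have h2 := hμG2B t htB
    rcases Finset.mem_union.1 htA with htA | htA
    · have h1 := hb1 t htA
      omega
    · have h1 := hμG2A t htA
      omega
  have hb3 : ∀ t ∈ G0 ∪ G1 ∪ G2A ∪ G2B, mu t ≤ 204 := by
    intro t ht
    rcases Finset.mem_union.1 ht with ht | ht
    · exact hb2' t ht
    · exact (hμG2B t ht).le.trans (by norm_num)
  have hb4 := ext 204 309 hb3 hμG3A (by norm_num)
  have hd4 : Disjoint (G0 ∪ G1 ∪ G2A ∪ G2B) G3A := disj 204 309 hb3 hμG3A (by norm_num)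
  have hd5 : Disjoint (G0 ∪ G1 ∪ G2A ∪ G2B ∪ G3A) G3B := by
    rw [Finset.disjoint_left]
    intro t htA htB
    have h2 := hμG3B t htB
    rcases Finset.mem_union.1 htA with htA | htA
    · have h1 := hb3 t htA
      omega
    · have h1 := hμG3A t htA
      omega
  have hb5 : ∀ t ∈ G0 ∪ G1 ∪ G2A ∪ G2B ∪ G3A ∪ G3B, mu t ≤ 309 := by
    intro t ht
    rcases Finset.mem_union.1 ht with ht | ht
    · exact hb4 t ht
    · exact (hμG3B t ht).le.trans (by norm_num)
  have hd6 : Disjoint (G0 ∪ G1 ∪ G2A ∪ G2B ∪ G3A ∪ G3B) G3C := by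
    rw [Finset.disjoint_left]
    intro t htA htB
    have h2 := hμG3C t htB
    rcases Finset.mem_union.1 htA with htA | htA
    · rcases Finset.mem_union.1 htA with htA | htA
      · have h1 := hb3 t htA
        omega
      · have h1 := hμG3A t htA
        omega
    · have h1 := hμG3B t htA
      omega
  have hb6 : ∀ t ∈ G0 ∪ G1 ∪ G2A ∪ G2B ∪ G3A ∪ G3B ∪ G3C, mu t ≤ 309 := by
    intro t ht
    rcases Finset.mem_union.1 ht with ht | ht
    · exact hb5 t ht
    · exact (hμG3C t ht).le.trans (by norm_num)
  have hb7 := ext 309 404 hb6 hμF4 (by norm_num)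
  have hb8 := ext 404 406 hb7 hμF211 (by norm_num)
  have hb9 := ext 406 408 hb8 hμF22 (by norm_num)
  have hb10 := ext 408 410 hb9 hμF31 (by norm_num)
  have hd7 : Disjoint (G0 ∪ G1 ∪ G2A ∪ G2B ∪ G3A ∪ G3B ∪ G3C) F4 := disj 309 404 hb6 hμF4 (by norm_num)
  have hd8 : Disjoint (G0 ∪ G1 ∪ G2A ∪ G2B ∪ G3A ∪ G3B ∪ G3C ∪ F4) F211 := disj 404 406 hb7 hμF211 (by norm_num)
  have hd9 : Disjoint (G0 ∪ G1 ∪ G2A ∪ G2B ∪ G3A ∪ G3B ∪ G3C ∪ F4 ∪ F211) F22 := disj 406 408 hb8 hμF22 (by norm_num)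
  have hd10 : Disjoint (G0 ∪ G1 ∪ G2A ∪ G2B ∪ G3A ∪ G3B ∪ G3C ∪ F4 ∪ F211 ∪ F22) F31 :=
    disj 408 410 hb9 hμF31 (by norm_num)
  have hd11 : Disjoint (G0 ∪ G1 ∪ G2A ∪ G2B ∪ G3A ∪ G3B ∪ G3C ∪ F4 ∪ F211 ∪ F22 ∪ F31) F40 :=
    disj 410 416 hb10 hμF40 (by norm_num)
  -- the `R`-part of a paired Hodge octuple lies in one of the families
  have hmaps : (P : Set (Fin 8 → ZMod m)).MapsTo (fun α ↦ (univ.val.map α).filter (· ∈ repSet m)) ↑𝒢 := by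
    intro α hα
    rw [Finset.mem_coe, hP, Finset.mem_filter] at hα
    show (univ.val.map α).filter (· ∈ repSet m) ∈ ((𝒢 : Finset (Multiset (ZMod m))) : Set (Multiset (ZMod m)))
    rw [Finset.mem_coe]
    obtain ⟨j, hj, -⟩ := map_eq_symmOf_add_of_isPaired_eight hm hα.2.1 hα.2.2
    set t := (univ.val.map α).filter (· ∈ repSet m) with htdef
    have ht : ∀ x ∈ t, x ∈ repSet m := fun x hx ↦ (Multiset.mem_filter.1 hx).2
    simp only [h𝒢, Finset.mem_union]
    have hcases : Multiset.card t = 0 ∨ Multiset.card t = 1 ∨ Multiset.card t = 2 ∨ Multiset.card t = 3 ∨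
        Multiset.card t = 4 := by
      omega
    rcases hcases with hc | hc | hc | hc | hc
    · refine Or.inl (Or.inl (Or.inl (Or.inl (Or.inl (Or.inl (Or.inl (Or.inl (Or.inl (Or.inl (Or.inl ?_))))))))))
      rw [hG0, Finset.mem_singleton]
      exact Multiset.card_eq_zero.1 hc
    · obtain ⟨a, ha⟩ := Multiset.card_eq_one.1 hc
      refine Or.inl (Or.inl (Or.inl (Or.inl (Or.inl (Or.inl (Or.inl (Or.inl (Or.inl (Or.inl (Or.inr ?_))))))))))
      rw [ha]
      exact Finset.mem_image.2 ⟨a, ht a (by rw [ha]; simp), rfl⟩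
    · obtain ⟨a, b, hab⟩ := Multiset.card_eq_two.1 hc
      by_cases he : a = b
      · rw [he] at hab
        refine Or.inl (Or.inl (Or.inl (Or.inl (Or.inl (Or.inl (Or.inl (Or.inl (Or.inl (Or.inr ?_)))))))))
        rw [hab]
        exact Finset.mem_image.2 ⟨b, ht b (by rw [hab]; simp), rfl⟩
      · refine Or.inl (Or.inl (Or.inl (Or.inl (Or.inl (Or.inl (Or.inl (Or.inl (Or.inr ?_))))))))
        rw [hab]
        refine Finset.mem_image.2 ⟨{a, b}, ?_, pair_val he⟩
        rw [Finset.mem_powersetCard]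
        refine ⟨fun x hx ↦ ?_, Finset.card_pair he⟩
        simp only [Finset.mem_insert, Finset.mem_singleton] at hx
        rcases hx with rfl | rfl
        · exact ht _ (by rw [hab]; simp)
        · exact ht _ (by rw [hab]; simp)
    · rcases shape_three hc with ⟨a, ha⟩ | ⟨a, b, hab, he⟩ | hnd
      · refine Or.inl (Or.inl (Or.inl (Or.inl (Or.inl (Or.inl (Or.inl (Or.inr ?_)))))))
        rw [ha]
        exact Finset.mem_image.2 ⟨a, ht a (by rw [ha]; simp), rfl⟩
      · refine Or.inl (Or.inl (Or.inl (Or.inl (Or.inl (Or.inl (Or.inr ?_))))))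
        rw [he]
        refine Finset.mem_image.2 ⟨(a, b), ?_, rfl⟩
        exact Finset.mem_offDiag.2 ⟨ht a (by rw [he]; simp), ht b (by rw [he]; simp), hab⟩
      · refine Or.inl (Or.inl (Or.inl (Or.inl (Or.inl (Or.inr (Finset.mem_image.2 ⟨t.toFinset, ?_, ?_⟩))))))
        · rw [Finset.mem_powersetCard]
          refine ⟨fun x hx ↦ ht x (Multiset.mem_toFinset.1 hx), ?_⟩
          rw [Multiset.toFinset_card_of_nodup hnd, hc]
        · rw [Multiset.toFinset_val, Multiset.dedup_eq_self.2 hnd]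
    · rcases shape_four hc with ⟨a, hta⟩ | ⟨a, b, hab, hta⟩ | ⟨a, b, hab, hta⟩ | ⟨a, b, c, hab, hac, hbc, hta⟩ | hnd
      · refine Or.inr (Finset.mem_image.2 ⟨a, ht a (by rw [hta]; simp), hta.symm⟩)
      · refine Or.inl (Or.inr (Finset.mem_image.2 ⟨(a, b), ?_, hta.symm⟩))
        exact Finset.mem_offDiag.2 ⟨ht a (by rw [hta]; simp), ht b (by rw [hta]; simp), hab⟩
      · refine Or.inl (Or.inl (Or.inr (Finset.mem_image.2 ⟨{a, b}, ?_, by rw [pair_val hab, hta]⟩)))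
        rw [Finset.mem_powersetCard]
        refine ⟨fun x hx ↦ ?_, Finset.card_pair hab⟩
        simp only [Finset.mem_insert, Finset.mem_singleton] at hx
        rcases hx with rfl | rfl
        · exact ht _ (by rw [hta]; exact Multiset.mem_add.2 (Or.inl (by simp)))
        · exact ht _ (by rw [hta]; exact Multiset.mem_add.2 (Or.inl (by simp)))
      · refine Or.inl (Or.inl (Or.inl (Or.inr (Finset.mem_image.2 ⟨⟨a, {b, c}⟩, ?_, by rw [pair_val hbc, hta]⟩))))
        rw [Finset.mem_sigma, Finset.mem_powersetCard]
        refine ⟨ht a (by rw [hta]; exact Multiset.mem_add.2 (Or.inl (by simp))), fun x hx ↦ ?_, Finset.card_pair hbc⟩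
        simp only [Finset.mem_insert, Finset.mem_singleton] at hx
        rw [Finset.mem_erase]
        rcases hx with rfl | rfl
        · exact ⟨hab.symm, ht _ (by rw [hta]; exact Multiset.mem_add.2 (Or.inr (by simp)))⟩
        · exact ⟨hac.symm, ht _ (by rw [hta]; exact Multiset.mem_add.2 (Or.inr (by simp)))⟩
      · refine Or.inl (Or.inl (Or.inl (Or.inl (Or.inr (Finset.mem_image.2 ⟨t.toFinset, ?_, ?_⟩)))))
        · rw [Finset.mem_powersetCard]
          refine ⟨fun x hx ↦ ht x (Multiset.mem_toFinset.1 hx), ?_⟩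
          rw [Multiset.toFinset_card_of_nodup hnd, hc]
        · rw [Multiset.toFinset_val, Multiset.dedup_eq_self.2 hnd]
  rw [Finset.card_eq_sum_card_fiberwise hmaps]
  -- the fibre over `t` is the set of ALL orderings of `t + (−t) + (8 − 2|t|)·{η}`
  have hfib : ∀ t ∈ 𝒢, (P.filter fun α ↦ (univ.val.map α).filter (· ∈ repSet m) = t).card =
      (univ.filter fun α : Fin 8 → ZMod m ↦
        univ.val.map α = symmOf t + Multiset.replicate (8 - 2 * Multiset.card t) (eta m)).card := by
    intro t ht𝒢
    obtain ⟨ht, hct⟩ := hfam t ht𝒢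
    rw [hP, Finset.filter_filter]
    congr 1
    refine Finset.filter_congr fun α _ ↦ ⟨fun h ↦ ?_, fun h ↦ ?_⟩
    · obtain ⟨⟨hH, hp⟩, hφ⟩ := h
      obtain ⟨j, hj, he⟩ := map_eq_symmOf_add_of_isPaired_eight hm hH hp
      rw [hφ] at hj he
      rw [he]
      congr 2
      omega
    · have hj : Multiset.card t + (4 - Multiset.card t) = 4 := by omega
      have h' : univ.val.map α = symmOf t + Multiset.replicate (2 * (4 - Multiset.card t)) (eta m) := by
        rw [h]
        congr 2
        omega
      exact ⟨isHodge_and_isPaired_of_map_eq_symmOf_add_eight hm ht hj h',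
        by rw [h, filter_symmOf_add_replicate hm ht]⟩
  rw [Finset.sum_congr rfl hfib]
  -- injectivity of the parametrisations
  have hinjG1 : Set.InjOn (fun a : ZMod m ↦ ({a} : Multiset (ZMod m))) ↑(repSet m) :=
    fun a _ a' _ h ↦ Multiset.singleton_inj.1 h
  have hinjG2A : Set.InjOn (fun a : ZMod m ↦ ({a, a} : Multiset (ZMod m))) ↑(repSet m) := by
    intro a _ a' _ h
    have h' : ({a, a} : Multiset (ZMod m)) = {a', a'} := h
    have : a ∈ ({a', a'} : Multiset (ZMod m)) := by rw [← h']; simp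
    simpa using this
  have hinjT : ∀ k, Set.InjOn (fun T : Finset (ZMod m) ↦ T.val) ↑((repSet m).powersetCard k) :=
    fun k T _ T' _ h ↦ Finset.val_injective h
  have hinjG3A : Set.InjOn (fun a : ZMod m ↦ ({a, a, a} : Multiset (ZMod m))) ↑(repSet m) := by
    intro a _ a' _ h
    have h' : ({a, a, a} : Multiset (ZMod m)) = {a', a', a'} := h
    have : a ∈ ({a', a', a'} : Multiset (ZMod m)) := by rw [← h']; simp
    simpa using this
  have hinjG3B : Set.InjOn (fun p : ZMod m × ZMod m ↦ ({p.1, p.1, p.2} : Multiset (ZMod m))) ↑(repSet m).offDiag := by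
    rintro ⟨a, b⟩ hp ⟨a', b'⟩ hp' e
    obtain ⟨-, -, hab⟩ := Finset.mem_offDiag.1 hp
    obtain ⟨-, -, hab'⟩ := Finset.mem_offDiag.1 hp'
    simp only [ne_eq] at hab hab'
    have e' : ({a, a, b} : Multiset (ZMod m)) = {a', a', b'} := e
    have hc := congrArg (Multiset.count a) e'
    have haa' : a = a' := by
      by_contra hne
      by_cases hab2 : a = b'
      · subst hab2
        simp [hab, Ne.symm hab'] at hc
      · simp [hab, hne, hab2] at hc
    subst haa'
    simp only [Multiset.insert_eq_cons, Multiset.cons_inj_right, Multiset.singleton_inj] at e'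
    rw [e']
  have hinjF211 : Set.InjOn (fun q : (Σ _ : ZMod m, Finset (ZMod m)) ↦ ({q.1, q.1} : Multiset (ZMod m)) + q.2.val)
      ↑((repSet m).sigma fun a ↦ ((repSet m).erase a).powersetCard 2) := by
    rintro ⟨a, T⟩ hq1 ⟨a', T'⟩ hq2 h
    obtain ⟨-, h2, -⟩ := hq (Finset.mem_coe.1 hq1)
    have h' : ({a, a} : Multiset (ZMod m)) + T.val = {a', a'} + T'.val := h
    have haT : Multiset.count a T.val = 0 :=
      Multiset.count_eq_zero.2 fun hx ↦ (h2 a hx).2 rfl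
    have haT' : Multiset.count a T'.val ≤ 1 := Multiset.nodup_iff_count_le_one.1 T'.nodup a
    have hc := congrArg (Multiset.count a) h'
    simp only [Multiset.count_add, Multiset.insert_eq_cons, Multiset.count_cons_self, Multiset.count_singleton_self,
      haT] at hc
    have haa' : a = a' := by
      by_contra hne
      rw [Multiset.count_cons_of_ne hne, Multiset.count_singleton, if_neg hne] at hc
      omega
    subst haa'
    have hT : T.val = T'.val := add_left_cancel h'
    rw [Finset.val_injective hT]
  have hinjF22 : Set.InjOn (fun T : Finset (ZMod m) ↦ T.val + T.val) ↑((repSet m).powersetCard 2) := by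
    intro T _ T' _ h
    have h' : T.val + T.val = T'.val + T'.val := h
    apply Finset.val_injective
    refine Multiset.ext.mpr fun x ↦ ?_
    have := congrArg (Multiset.count x) h'
    rw [Multiset.count_add, Multiset.count_add] at this
    omega
  have hinjF31 : Set.InjOn (fun p : ZMod m × ZMod m ↦ ({p.1, p.1, p.1, p.2} : Multiset (ZMod m)))
      ↑(repSet m).offDiag := by
    rintro ⟨a, b⟩ hp ⟨a', b'⟩ hp' e
    obtain ⟨-, -, hab⟩ := Finset.mem_offDiag.1 hp
    obtain ⟨-, -, hab'⟩ := Finset.mem_offDiag.1 hp'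
    simp only [ne_eq] at hab hab'
    have e' : ({a, a, a, b} : Multiset (ZMod m)) = {a', a', a', b'} := e
    have hc := congrArg (Multiset.count a) e'
    have haa' : a = a' := by
      by_contra hne
      by_cases hab2 : a = b'
      · subst hab2
        simp [hab, Ne.symm hab'] at hc
      · simp [hab, hne, hab2] at hc
    subst haa'
    simp only [Multiset.insert_eq_cons, Multiset.cons_inj_right, Multiset.singleton_inj] at e'
    rw [e']
  have hinjF40 : Set.InjOn (fun a : ZMod m ↦ ({a, a, a, a} : Multiset (ZMod m))) ↑(repSet m) := by
    intro a _ a' _ h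
    have h' : ({a, a, a, a} : Multiset (ZMod m)) = {a', a', a', a'} := h
    have : a ∈ ({a', a', a', a'} : Multiset (ZMod m)) := by rw [← h']; simp
    simpa using this
  -- the twelve partial sums (abbreviation for the summand)
  have hsG0 : ∑ t ∈ G0, (univ.filter fun α : Fin 8 → ZMod m ↦
      univ.val.map α = symmOf t + Multiset.replicate (8 - 2 * Multiset.card t) (eta m)).card = 1 := by
    rw [hG0, Finset.sum_singleton, Multiset.card_zero, Nat.mul_zero, Nat.sub_zero]
    exact card_filter_shape8_empty
  have hsG1 : ∑ t ∈ G1, (univ.filter fun α : Fin 8 → ZMod m ↦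
      univ.val.map α = symmOf t + Multiset.replicate (8 - 2 * Multiset.card t) (eta m)).card = 56 * (repSet m).card := by
    have hf : ∀ a ∈ repSet m, (univ.filter fun α : Fin 8 → ZMod m ↦ univ.val.map α =
        symmOf {a} + Multiset.replicate (8 - 2 * Multiset.card ({a} : Multiset (ZMod m))) (eta m)).card = 56 := by
      intro a ha
      rw [Multiset.card_singleton]
      exact card_filter_shape8_A hm ha
    rw [hG1, Finset.sum_image hinjG1, Finset.sum_congr rfl hf, Finset.sum_const, smul_eq_mul]
    exact mul_comm _ _
  have hsG2A : ∑ t ∈ G2A, (univ.filter fun α : Fin 8 → ZMod m ↦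
      univ.val.map α = symmOf t + Multiset.replicate (8 - 2 * Multiset.card t) (eta m)).card = 420 * (repSet m).card := by
    have hf : ∀ a ∈ repSet m, (univ.filter fun α : Fin 8 → ZMod m ↦ univ.val.map α =
        symmOf {a, a} + Multiset.replicate (8 - 2 * Multiset.card ({a, a} : Multiset (ZMod m))) (eta m)).card = 420 := by
      intro a ha
      rw [Multiset.card_pair]
      exact card_filter_shape8_AA hm ha
    rw [hG2A, Finset.sum_image hinjG2A, Finset.sum_congr rfl hf, Finset.sum_const, smul_eq_mul]
    exact mul_comm _ _
  have hsG2B : ∑ t ∈ G2B, (univ.filter fun α : Fin 8 → ZMod m ↦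
      univ.val.map α = symmOf t + Multiset.replicate (8 - 2 * Multiset.card t) (eta m)).card =
      1680 * ((repSet m).powersetCard 2).card := by
    have hf : ∀ T ∈ (repSet m).powersetCard 2, (univ.filter fun α : Fin 8 → ZMod m ↦ univ.val.map α =
        symmOf T.val + Multiset.replicate (8 - 2 * Multiset.card T.val) (eta m)).card = 1680 := by
      intro T hT
      obtain ⟨hTR, hTc⟩ := Finset.mem_powersetCard.1 hT
      obtain ⟨a, b, hab, rfl⟩ := Finset.card_eq_two.1 hTc
      rw [pair_val hab, Multiset.card_pair]
      exact card_filter_shape8_AB hm (hTR (by simp)) (hTR (by simp)) hab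
    rw [hG2B, Finset.sum_image (hinjT 2), Finset.sum_congr rfl hf, Finset.sum_const, smul_eq_mul]
    exact mul_comm _ _
  have hsG3A : ∑ t ∈ G3A, (univ.filter fun α : Fin 8 → ZMod m ↦
      univ.val.map α = symmOf t + Multiset.replicate (8 - 2 * Multiset.card t) (eta m)).card = 560 * (repSet m).card := by
    have hf : ∀ a ∈ repSet m, (univ.filter fun α : Fin 8 → ZMod m ↦ univ.val.map α =
        symmOf {a, a, a} + Multiset.replicate (8 - 2 * Multiset.card ({a, a, a} : Multiset (ZMod m))) (eta m)).card
        = 560 := by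
      intro a ha
      have hc : 8 - 2 * Multiset.card ({a, a, a} : Multiset (ZMod m)) = 2 := by simp
      rw [hc]
      exact card_filter_shape8_AAA hm ha
    rw [hG3A, Finset.sum_image hinjG3A, Finset.sum_congr rfl hf, Finset.sum_const, smul_eq_mul]
    exact mul_comm _ _
  have hsG3B : ∑ t ∈ G3B, (univ.filter fun α : Fin 8 → ZMod m ↦
      univ.val.map α = symmOf t + Multiset.replicate (8 - 2 * Multiset.card t) (eta m)).card =
      5040 * (repSet m).offDiag.card := by
    have hf : ∀ p ∈ (repSet m).offDiag, (univ.filter fun α : Fin 8 → ZMod m ↦ univ.val.map α =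
        symmOf {p.1, p.1, p.2} + Multiset.replicate (8 - 2 * Multiset.card ({p.1, p.1, p.2} : Multiset (ZMod m)))
          (eta m)).card = 5040 := by
      intro p hp
      obtain ⟨h1, h2, h12⟩ := Finset.mem_offDiag.1 hp
      have hc : 8 - 2 * Multiset.card ({p.1, p.1, p.2} : Multiset (ZMod m)) = 2 := by simp
      rw [hc]
      exact card_filter_shape8_AAB hm h1 h2 h12
    rw [hG3B, Finset.sum_image hinjG3B, Finset.sum_congr rfl hf, Finset.sum_const, smul_eq_mul]
    exact mul_comm _ _
  have hsG3C : ∑ t ∈ G3C, (univ.filter fun α : Fin 8 → ZMod m ↦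
      univ.val.map α = symmOf t + Multiset.replicate (8 - 2 * Multiset.card t) (eta m)).card =
      20160 * ((repSet m).powersetCard 3).card := by
    have hf : ∀ T ∈ (repSet m).powersetCard 3, (univ.filter fun α : Fin 8 → ZMod m ↦ univ.val.map α =
        symmOf T.val + Multiset.replicate (8 - 2 * Multiset.card T.val) (eta m)).card = 20160 := by
      intro T hT
      obtain ⟨hTR, hTc⟩ := Finset.mem_powersetCard.1 hT
      obtain ⟨a, b, c, hab, hac, hbc, rfl⟩ := Finset.card_eq_three.1 hTc
      have hv : ({a, b, c} : Finset (ZMod m)).val = ({a, b, c} : Multiset (ZMod m)) := by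
        rw [Finset.insert_val_of_notMem (by simp [hab, hac]), pair_val hbc]
        rfl
      have hc' : 8 - 2 * Multiset.card ({a, b, c} : Multiset (ZMod m)) = 2 := by simp
      rw [hv, hc']
      exact card_filter_shape8_ABC hm (hTR (by simp)) (hTR (by simp)) (hTR (by simp)) hab hac hbc
    rw [hG3C, Finset.sum_image (hinjT 3), Finset.sum_congr rfl hf, Finset.sum_const, smul_eq_mul]
    exact mul_comm _ _
  have hsF4 : ∑ t ∈ F4, (univ.filter fun α : Fin 8 → ZMod m ↦
      univ.val.map α = symmOf t + Multiset.replicate (8 - 2 * Multiset.card t) (eta m)).card =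
      40320 * ((repSet m).powersetCard 4).card := by
    have hf : ∀ T ∈ (repSet m).powersetCard 4, (univ.filter fun α : Fin 8 → ZMod m ↦ univ.val.map α =
        symmOf T.val + Multiset.replicate (8 - 2 * Multiset.card T.val) (eta m)).card = 40320 := by
      intro T hT
      obtain ⟨h1, h2⟩ := Finset.mem_powersetCard.1 hT
      have hc : 8 - 2 * Multiset.card T.val = 0 := by
        have := Finset.card_val T
        omega
      rw [hc, Multiset.replicate_zero, add_zero]
      exact card_filter_symmOf_ABCD h1 h2
    rw [hF4, Finset.sum_image (hinjT 4), Finset.sum_congr rfl hf, Finset.sum_const, smul_eq_mul]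
    exact mul_comm _ _
  have hsF211 : ∑ t ∈ F211, (univ.filter fun α : Fin 8 → ZMod m ↦
      univ.val.map α = symmOf t + Multiset.replicate (8 - 2 * Multiset.card t) (eta m)).card =
      10080 * ((repSet m).card * ((repSet m).card - 1).choose 2) := by
    have hf : ∀ q ∈ ((repSet m).sigma fun a ↦ ((repSet m).erase a).powersetCard 2),
        (univ.filter fun α : Fin 8 → ZMod m ↦ univ.val.map α = symmOf ({q.1, q.1} + q.2.val) +
          Multiset.replicate (8 - 2 * Multiset.card (({q.1, q.1} : Multiset (ZMod m)) + q.2.val)) (eta m)).card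
        = 10080 := by
      intro q hq'
      obtain ⟨h1, h2, h3⟩ := hq hq'
      obtain ⟨b, c, hbc, hq2⟩ := Finset.card_eq_two.1 h3
      have hb := h2 b (by rw [hq2]; simp)
      have hc := h2 c (by rw [hq2]; simp)
      have hc' : 8 - 2 * Multiset.card (({q.1, q.1} : Multiset (ZMod m)) + q.2.val) = 0 := by
        have := Finset.card_val q.2
        simp only [Multiset.card_add, Multiset.insert_eq_cons, Multiset.card_cons, Multiset.card_singleton]
        omega
      rw [hc', Multiset.replicate_zero, add_zero, hq2, pair_val hbc]
      exact card_filter_symmOf_A2BC h1 hb.1 hc.1 hb.2.symm hc.2.symm hbc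
    have hcardσ : ((repSet m).sigma fun a ↦ ((repSet m).erase a).powersetCard 2).card =
        (repSet m).card * ((repSet m).card - 1).choose 2 := by
      rw [Finset.card_sigma, Finset.sum_congr rfl (g := fun _ ↦ ((repSet m).card - 1).choose 2)
        fun a ha ↦ by rw [Finset.card_powersetCard, Finset.card_erase_of_mem ha], Finset.sum_const, smul_eq_mul]
    rw [hF211, Finset.sum_image hinjF211, Finset.sum_congr rfl hf, Finset.sum_const, smul_eq_mul, hcardσ]
    exact mul_comm _ _
  have hsF22 : ∑ t ∈ F22, (univ.filter fun α : Fin 8 → ZMod m ↦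
      univ.val.map α = symmOf t + Multiset.replicate (8 - 2 * Multiset.card t) (eta m)).card =
      2520 * ((repSet m).powersetCard 2).card := by
    have hf : ∀ T ∈ (repSet m).powersetCard 2, (univ.filter fun α : Fin 8 → ZMod m ↦ univ.val.map α =
        symmOf (T.val + T.val) + Multiset.replicate (8 - 2 * Multiset.card (T.val + T.val)) (eta m)).card = 2520 := by
      intro T hT
      obtain ⟨hTR, hTc⟩ := Finset.mem_powersetCard.1 hT
      have hc : 8 - 2 * Multiset.card (T.val + T.val) = 0 := by
        have := Finset.card_val T
        rw [Multiset.card_add]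
        omega
      rw [hc, Multiset.replicate_zero, add_zero]
      obtain ⟨a, b, hab, rfl⟩ := Finset.card_eq_two.1 hTc
      rw [pair_val hab]
      exact card_filter_symmOf_A2B2 (hTR (by simp)) (hTR (by simp)) hab
    rw [hF22, Finset.sum_image hinjF22, Finset.sum_congr rfl hf, Finset.sum_const, smul_eq_mul]
    exact mul_comm _ _
  have hsF31 : ∑ t ∈ F31, (univ.filter fun α : Fin 8 → ZMod m ↦
      univ.val.map α = symmOf t + Multiset.replicate (8 - 2 * Multiset.card t) (eta m)).card =
      1120 * (repSet m).offDiag.card := by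
    have hf : ∀ p ∈ (repSet m).offDiag, (univ.filter fun α : Fin 8 → ZMod m ↦ univ.val.map α =
        symmOf {p.1, p.1, p.1, p.2} +
          Multiset.replicate (8 - 2 * Multiset.card ({p.1, p.1, p.1, p.2} : Multiset (ZMod m))) (eta m)).card = 1120 := by
      intro p hp
      obtain ⟨h1, h2, h12⟩ := Finset.mem_offDiag.1 hp
      have hc : 8 - 2 * Multiset.card ({p.1, p.1, p.1, p.2} : Multiset (ZMod m)) = 0 := by simp
      rw [hc, Multiset.replicate_zero, add_zero]
      exact card_filter_symmOf_A3B h1 h2 h12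
    rw [hF31, Finset.sum_image hinjF31, Finset.sum_congr rfl hf, Finset.sum_const, smul_eq_mul]
    exact mul_comm _ _
  have hsF40 : ∑ t ∈ F40, (univ.filter fun α : Fin 8 → ZMod m ↦
      univ.val.map α = symmOf t + Multiset.replicate (8 - 2 * Multiset.card t) (eta m)).card = 70 * (repSet m).card := by
    have hf : ∀ a ∈ repSet m, (univ.filter fun α : Fin 8 → ZMod m ↦ univ.val.map α =
        symmOf {a, a, a, a} + Multiset.replicate (8 - 2 * Multiset.card ({a, a, a, a} : Multiset (ZMod m))) (eta m)).card
        = 70 := by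
      intro a ha
      have hc : 8 - 2 * Multiset.card ({a, a, a, a} : Multiset (ZMod m)) = 0 := by simp
      rw [hc, Multiset.replicate_zero, add_zero]
      exact card_filter_symmOf_A4 ha
    rw [hF40, Finset.sum_image hinjF40, Finset.sum_congr rfl hf, Finset.sum_const, smul_eq_mul]
    exact mul_comm _ _
  rw [h𝒢, Finset.sum_union hd11, Finset.sum_union hd10, Finset.sum_union hd9, Finset.sum_union hd8,
    Finset.sum_union hd7, Finset.sum_union hd6, Finset.sum_union hd5, Finset.sum_union hd4, Finset.sum_union hd3,
    Finset.sum_union hd2, Finset.sum_union hd1, hsG0, hsG1, hsG2A, hsG2B, hsG3A, hsG3B, hsG3C, hsF4, hsF211, hsF22,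
    hsF31, hsF40, Finset.offDiag_card, Finset.card_powersetCard, Finset.card_powersetCard, Finset.card_powersetCard,
    card_repSet_even hm, Nat.mul_sub_one]

open scoped Classical in
/-- The even-level octuple count as a polynomial: `1680h⁴ − 1680h³ + 1540h² − 434h + 1`, `h = (m−2)/2`, i.e.
`105m⁴ − 1050m³ + 4165m² − 7637m + 5335`. [cite: DegtyarevShimada2016, Remark 4.4] -/
theorem card_isHodge_isPaired_eight_even_eq_poly (hm : 2 ∣ m) :
    ((univ.filter fun α : Fin 8 → ZMod m ↦ IsHodge α ∧ IsPaired α).card : ℤ) =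
      105 * (m : ℤ) ^ 4 - 1050 * (m : ℤ) ^ 3 + 4165 * (m : ℤ) ^ 2 - 7637 * m + 5335 := by
  rw [card_isHodge_isPaired_eight_even hm]
  obtain ⟨h, hh⟩ : ∃ h, m = 2 * h + 2 := ⟨(m - 2) / 2, by have := two_le_of_two_dvd hm; omega⟩
  have hdiv : (m - 2) / 2 = h := by omega
  rw [hdiv]
  have hc2 : ∀ k : ℕ, (k.choose 2 : ℤ) * 2 = k * (k - 1) := by
    intro k
    have h2 := Nat.descFactorial_eq_factorial_mul_choose k 2
    rw [show Nat.factorial 2 = 2 by rfl] at h2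
    rcases Nat.lt_or_ge k 2 with hlt | hge
    · rw [Nat.choose_eq_zero_of_lt hlt]
      interval_cases k <;> norm_num
    · have e : (k.descFactorial 2 : ℤ) = k * (k - 1) := by
        simp only [Nat.descFactorial_succ, Nat.descFactorial_zero, mul_one, Nat.sub_zero]
        push_cast [Nat.cast_sub (by omega : 1 ≤ k)]
        ring
      rw [← e, h2]
      push_cast
      ring
  have hc3 : (h.choose 3 : ℤ) * 6 = h * (h - 1) * (h - 2) := by
    have h3 := Nat.descFactorial_eq_factorial_mul_choose h 3
    rw [show Nat.factorial 3 = 6 by rfl] at h3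
    rcases Nat.lt_or_ge h 3 with hlt | hge
    · rw [Nat.choose_eq_zero_of_lt hlt]
      interval_cases h <;> norm_num
    · have e : (h.descFactorial 3 : ℤ) = h * (h - 1) * (h - 2) := by
        simp only [Nat.descFactorial_succ, Nat.descFactorial_zero, mul_one, Nat.sub_zero]
        push_cast [Nat.cast_sub (by omega : 1 ≤ h), Nat.cast_sub (by omega : 2 ≤ h)]
        ring
      rw [← e, h3]
      push_cast
      ring
  have hc4 : (h.choose 4 : ℤ) * 24 = h * (h - 1) * (h - 2) * (h - 3) := by
    have h4 := Nat.descFactorial_eq_factorial_mul_choose h 4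
    rw [show Nat.factorial 4 = 24 by rfl] at h4
    rcases Nat.lt_or_ge h 4 with hlt | hge
    · rw [Nat.choose_eq_zero_of_lt hlt]
      interval_cases h <;> norm_num
    · have e : (h.descFactorial 4 : ℤ) = h * (h - 1) * (h - 2) * (h - 3) := by
        simp only [Nat.descFactorial_succ, Nat.descFactorial_zero, mul_one, Nat.sub_zero]
        push_cast [Nat.cast_sub (by omega : 1 ≤ h), Nat.cast_sub (by omega : 2 ≤ h), Nat.cast_sub (by omega : 3 ≤ h)]
        ring
      rw [← e, h4]
      push_cast
      ring
  have hA := hc2 h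
  rcases Nat.eq_zero_or_pos h with h0 | hpos
  · subst h0
    simp [hh]
  · have hB := hc2 (h - 1)
    push_cast [Nat.cast_sub hpos, hh] at hB ⊢
    linear_combination (840 + 1260) * hA + 5040 * (h : ℤ) * hB + 3360 * hc3 + 1680 * hc4

open scoped Classical in
/-- **Degtyarev–Shimada 2016, Remark 4.4, `n = 6`, at every level `m`**: the number of characters `(a₀, …, a₇)`,
`aᵢ ∈ ℤ/m ∖ {0}`, admitting a matching into pairs `{a, −a}` (`Γ_𝒥` for the Fermat sixfold; its successor is the rank
of the lattice of the `105·m⁴` standard `3`-spaces, Thm. 1.4) is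
`105m⁴ − 1050m³ + 3955m² − 6335m + 3325 + (210m² − 1302m + 2010)·δₘ`, `δₘ = 1` for even `m`, `0` for odd `m` — the
printed polynomial (read, as for `n = 4`, as the value of `|Γ_𝒥|`). [cite: DegtyarevShimada2016, Theorem 1.4 and Remark 4.4] -/
theorem card_isHodge_isPaired_eight_eq_degtyarevShimada :
    ((univ.filter fun α : Fin 8 → ZMod m ↦ IsHodge α ∧ IsPaired α).card : ℤ) =
      105 * (m : ℤ) ^ 4 - 1050 * (m : ℤ) ^ 3 + 3955 * (m : ℤ) ^ 2 - 6335 * m + 3325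
        + (210 * (m : ℤ) ^ 2 - 1302 * m + 2010) * (if 2 ∣ m then 1 else 0) := by
  by_cases hm : 2 ∣ m
  · rw [card_isHodge_isPaired_eight_even_eq_poly hm, if_pos hm]
    ring
  · rw [card_isHodge_isPaired_eight_eq_poly hm, if_neg hm]
    ring

open scoped Classical in
/-- Instances at even level: `m = 4` (`h = 1`: `1107`) and `m = 26` (`h = 12`: `32149993`). [cite: DegtyarevShimada2016, Remark 4.4] -/
theorem card_isHodge_isPaired_eight_four_and_twentysix :
    (univ.filter fun α : Fin 8 → ZMod 4 ↦ IsHodge α ∧ IsPaired α).card = 1107 ∧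
      (univ.filter fun α : Fin 8 → ZMod 26 ↦ IsHodge α ∧ IsPaired α).card = 32149993 := by
  refine ⟨?_, ?_⟩
  · rw [card_isHodge_isPaired_eight_even (m := 4) (by norm_num)]
    decide
  · rw [card_isHodge_isPaired_eight_even (m := 26) (by norm_num)]
    decide

end OctuplesEven

end Literature.AlgebraicGeometry.Shioda1981
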